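import Literature.NumberTheory.LFunctions.RodgersTaoTruncHamiltonianExpansionProofs
import Literature.NumberTheory.LFunctions.RodgersTaoRenormHamiltonianDecayLeafProofs
import Mathlib.Analysis.Convex.Jensen
import Mathlib.Analysis.Convex.Mul
import Mathlib.Analysis.PSeries
import Mathlib.Analysis.SpecialFunctions.Pow.Asymptotics
import HarnessLib

/-!
# Rodgers–Tao 2020, Lemma 24 — RH-FREE CONTENT twin: if the truncated Hamiltonian `H̃_T(t)` is
# large then the truncated energy `Ẽ_T(t)` is exponentially larger, on a window above a
# real-rooted time, under the location law (50) and the gap law (52)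

RH-FREE literature proofs (no definitions, no named facts, no `sorry`). Trunk T-ANT
(`Literature/NumberTheory/LFunctions`); companion of `RodgersTaoHamiltonian.lean` (the typed,
VACUOUS-AS-PRINTED / EX-FALSO fact
`Literature.NumberTheory.LFunctions.rodgers_tao_truncEnergy_lower_bound`, Rodgers–Tao 2020
Lemma 24 = arXiv v4 Lemma 7.9, FMP p. 54, whose ex-falso discharge
`rodgers_tao_truncEnergy_lower_bound_holds` lives in `RodgersTaoHamiltonianProofs.lean`) and its
CONTENT twin: the printed proof (pp. 54–56) carried out above an arbitrary real-rooted time, with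
its inputs Lemma 19 and Lemma 20 taken from their content twins
`rodgers_tao_truncHamiltonian_expansion_of` (`RodgersTaoTruncHamiltonianExpansionProofs.lean`) and
`rodgers_tao_renormHamiltonian_decay_of` (`RodgersTaoRenormHamiltonianDecayLeafProofs.lean`). C3 cell,
CONTENT-TWIN programme (rt-lead standing ruling: content twins are 0-fact new modules; rt/STATUS
RULING (63)(f), row «L23 'lame'»).

> B. Rodgers, T. Tao, *The de Bruijn–Newman constant is non-negative*, Forum Math. Pi 8 (2020)
> e6 (= arXiv:1801.05914v4 §7), **Lemma 24** (FMP p. 54; v4 Lemma 7.9, v5 TeX l. 1366–1368,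
> label `lame`): "Let `m` be a natural number, and let `Λ/2 ≤ t ≤ 0`. Let `T > 0`, and let
> `δ = δ(T)` go to zero as `T → ∞` sufficiently slowly. If `H̃_T(t) ≥ δ m T log³₊ T`, then
> `Ẽ_T(t) ≫ δ 2^{2m} T log³₊ T` where the implied constant is absolute."
> Proof (pp. 54–56, v5 l. 1370–1409): from Lemma 19 (`hamil-form`),
> `Σ_{j∼_T k} ψψH̃_{jk} ≥ (99/100) δ m T log³ T`; from Lemma 20 (`lrdec`),
> `Σ_{k: j∼_T k, |k−j| ≥ ε(j) log²₊ξ_j} H̃_{jk} ≪ ε(j) log²₊ j`, whence (85)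
> `Σ_{j∼_T k, |k−j| < ε(j) log²₊ ξ_j} ψψH̃_{jk} ≫ δ m T log³₊ T`; (86) the pairs with
> `|x_j − x_k| ≥ 2^{−m}|ξ_j − ξ_k|` contribute `≪ δ² m T log³ T`, using `L_{jk} ≪ m + |x_j−x_k|/|ξ_j−ξ_k|`,
> `ψ_T(j) ≍ ψ_T(k)`, the count `Σ ψ_T(j)² ≪ δ² T log³ T` and (87)
> `Σ ψ_T(j)² |x_j − x_k|/|j − k| ≪ δ² T log² T` ("telescoping series and (50)"); finally, on the
> remaining pairs, "from (70), (62) … `H̃_{jk} ≪ log(|ξ_j−ξ_k|/|x_j−x_k|) ≪ m2^{−2m}|ξ_j−ξ_k|²/|x_j−x_k|²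
> ≪ m 2^{−2m} Ẽ_{jk}` and the claim follows."

Label map (rt-ref 17:09:55Z): `lame` = Lemma 24 p. 54; inputs `hamil-form` = Lemma 19,
`lrdec` = Lemma 20, `hform` = (69), `llog` = (70), `add-2` = (45), `xji` = (50), `vlog` = (62);
proof displays `opt0` = (85), `opt1` = (86), `clam` = (87) (OCR: (86) is `δ²mT log³T`, (87) is
`δ²T log²T`).

## Main results (all `theorem`s, 0 new facts)

* **`rodgers_tao_truncEnergy_lower_bound_of`** — THE SCHEMA (`η`-form): `t₀ < t₁`, `H_{t₀}`
  real-rooted, (50) and (52) on `[t₁,t₂]` ⟹ `∃ c > 0, ∀ η > 0, ∃ T₁, ∀ T ≥ T₁, ∀ t ∈ [t₁,t₂],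
  ∀ m ≥ 1, ∀ δ ≥ η`: `H̃_T(t) ≥ δ m T log³ T ∧ Ẽ_T(t)` finite ⟹ `Ẽ_T(t) ≥ c δ 2^{2m} T log³ T`.
* **`rodgers_tao_truncEnergy_lower_bound_of_cor33`** — the AS-PRINTED reduction
  `RodgersTao2020.cor33_location → RodgersTao2020.cor33_gaps → rodgers_tao_truncEnergy_lower_bound`
  (window `[t₀/2, 0]` above the witness `t₀ < 0`; the «`δ(T) → 0` sufficiently slowly» threshold
  rate `δ₀` is CONSTRUCTED by `exists_rate_of_thresholds`). No second `_holds` is declared.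
* Steps of the printed proof: `renormLog_le_of_inv_two_pow_lt` ((86): `L(r) ≤ m log 2 + r` for
  `r > 2^{−m}`), `log_inv_le_mul_inv_sq` (last display: `log(1/r) ≤ (m log 2)4^{−m} r^{−2}` for
  `r ≤ 2^{−m}`), `inv_sq_le_four_add_renormPotential` ((62)), `renormHamiltonianZ_le_chain_sum`
  (the per-pair inequality, see REPAIR below), `sum_inv_length_le_of_straddle` and
  `pair_chain_sum_le` (the pair → consecutive-gap exchange behind (87) and the last display),
  `exists_gap_weighted_sum_le` ((87): `Σ_{i≤M}(x_{i+1} − x_i)ψ_T(i)²log₊³ i ≪_B T log³ T`, by a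
  monotone Abel exchange `sum_sub_mul_le_of_antitone` against the majorant `ξ_i + B log₊ ξ_i ≥ x_i`
  from (50) — the printed dyadic "telescoping series and (50)", equivalently), `far_row_sum_le` /
  `farPairs_indicator_tsum_le` (the Lemma 20 part «`≪ ε(j) log²₊ j`» and its `j`-sum),
  `exists_smallPairs_indicator_tsum_le` («trivial from compactness for `T = O(1)`»: bounded
  indices), `nearPairs_indicator_tsum_le` ((86) + (87) + last display, assembled),
  `tsum_indicator_le_of_cover` (splitting the nearby sum), and the toolkit of §4 ((43)–(45) in
  the forms used: `log₊ ξ_j ≍ log₊ j` on `ℤ*`, `ξ_{i+1} − ξ_i ≪ 1/log₊ ξ_i`,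
  `ξ_hi − ξ_lo ≫ (hi − lo)/log₊ ξ_hi`, `ψ_T`-comparability on short chains, `ψ_T log₊³ ≪ log³ T`,
  `Σ_{i≤M} ψ_T(i)/log₊ ξ_i ≪ T`).

## Divergences from print, and one REPAIRED STEP (ERRATUM CANDIDATE, rt/STATUS 16:35:44Z)

Statement-level: none beyond the house form — the printed `Λ/2 ≤ t ≤ 0` (VACUOUS-AS-PRINTED,
`Λ ≥ 0` in the tree) is replaced by an arbitrary window `[t₁, t₂]` above a real-rooted time with
(50)/(52) as explicit hypotheses (cell ruling R2 / (42)); «`δ(T) → 0` sufficiently slowly» is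
rendered as in the typed fact (threshold rate `δ₀`, claim for every `δ ≥ δ₀` eventually), obtained
from the `η`-form in which the thresholds depend on a lower bound `η ≤ δ` only; `m ≥ 1` as in the
typed fact; `Ẽ_T(t) = +∞` (trivially fine in print) is the `Summable` hypothesis.

Proof-level: (i) the nearby sum is split at `|j| < J` / `|j| ≥ J` (`J = J(η)`, where Lemma 20's
`ε(j) ≤ η'` beyond `J`), the bounded indices being `O_J(1)`; beyond `J` the near pairs
`|k − j| < ε(j) log₊² ξ_j` are enlarged to `|k − j| < η' log₊² ξ_j` (using `H̃ ≥ 0`) and, by the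
symmetry `(j,k) ↦ (−j,−k)`, reduced to positive indices. (ii) (87) is proved by an Abel-type
monotone exchange instead of dyadic blocks (same input (50), same output). (iii) **REPAIR of the
last display of p. 56.** As printed, `m2^{−2m}|ξ_j−ξ_k|²/|x_j−x_k|² ≪ m2^{−2m}Ẽ_{jk}` drops the
factor `|ξ_j − ξ_k|²`: for `r = |x_j−x_k|/|ξ_j−ξ_k| ≤ 2^{−m} ≤ 1/2` one has `Ẽ_{jk} = V(r)/|ξ_j−ξ_k|²
≍ 1/|x_j − x_k|²` by (62), so `|ξ_j−ξ_k|²/|x_j−x_k|² ≍ |ξ_j−ξ_k|² Ẽ_{jk}`, and on the range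
`|k − j| < ε(j) log²₊ ξ_j` the factor `|ξ_j−ξ_k|² ≍ |k−j|²/log²₊ξ_j` is as large as `ε(j)² log²₊ ξ_j`,
which is unbounded (Lemma 20's `ε(j) → 0` only «sufficiently slowly», at the unquantified rate of
(52)); as printed the chain gives `Ẽ_T ≫ δ2^{2m}T log³T` only up to a factor `sup ε(j)²log²₊ξ_j`.
The repair used here (`renormHamiltonianZ_le_chain_sum`, then `pair_chain_sum_le`): for a near pair
`lo < hi` write `r = (Σ_i g_i)/(Σ_i d_i)` over the chain of CONSECUTIVE gaps `g_i = x_{i+1} − x_i`,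
`d_i = ξ_{i+1} − ξ_i` (`i ∈ [lo, hi)`); Jensen for the convex `s ↦ s^{−2}` with weights `d_i/Σd`
gives `r^{−2} ≤ Σ_i (d_i/Σd)(d_i/g_i)²`, and `(d_i/g_i)² ≤ 4 + 4 d_i² Ẽ_{i,i+1}` by (62); since
`d_i ≍ 1/log₊ ξ_i` IS bounded, the exchange of summations (each consecutive pair `(i,i+1)` is
straddled by `≪ h` near pairs of each length `h`, weighted `1/(ξ_hi − ξ_lo) ≪ log₊ξ/h`) yields
`Σ_{near, r ≤ 2^{−m}} ψψH̃ ≤ C m 4^{−m}(η'·T log³T + Ẽ_T)` with an ABSOLUTE `C`, which is what the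
printed conclusion needs. The statement of Lemma 24 STANDS; only this step of its proof is
re-routed (GAP-class). (iv) Constants: all `≪`-constants are explicit functions of the (43)–(45),
Prop. 13 and Lemma 20 constants; `c` depends on them and not on `η`, `t`, `m`, `δ`.

bears_on: N-C/N-P (COLUMN 3 DBN). LINE 1 — LABEL: RH-FREE CONTENT (0 facts). WHAT THIS IS NOT: a
lattice-sum inequality for the zeros of `H_t` above a real-rooted time under (50)/(52); the
printed `Λ/2 ≤ t ≤ 0` instance is VACUOUS-AS-PRINTED (`Λ ≥ 0`); no statement here is progress
toward RH and nothing here bears on the truth of RH.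

## References

* B. Rodgers, T. Tao, Forum Math. Pi 8 (2020) e6, §7: Lemma 24 p. 54 and its proof pp. 54–56
  ((85)–(87)); Lemma 19 p. 44, Lemma 20 p. 45, (62) p. 40, (66)–(67) p. 42, (69)–(71) pp. 43–44;
  Corollary 10 (50)–(52) p. 23; Lemma 8 (43)–(45) p. 21; Prop. 13 p. 34 (= arXiv:1801.05914v4
  Lemma 7.9, Lemma 7.4, Lemma 7.5, Cor. 3.3, Lemma 3.1, Prop. 5.1; v5 TeX l. 1366–1409).
-/

noncomputable section

open Set Filter Topology Finset Real

namespace Literature.NumberTheory.LFunctions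

/-! ### §1 Three elementary inequalities behind the last display of the proof of Lemma 24 -/

/-- For `0 < r ≤ 2^{-m}` and `m ≥ 1`: `log(1/r) ≤ (m log 2/4^m) · (1/r²)` («`log(|ξ_j−ξ_k|/|x_j−x_k|)
≪ m 2^{−2m}|ξ_j−ξ_k|²/|x_j−x_k|²`», with the constant `log 2`).
[cite: RodgersTaoFMP2020, Lemma 24 p. 56 (proof, last display)] -/
theorem log_inv_le_mul_inv_sq {r : ℝ} {m : ℕ} (hr : 0 < r) (hm : 1 ≤ m)
    (hrm : r ≤ ((2 : ℝ) ^ m)⁻¹) :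
    Real.log (1 / r) ≤ m * Real.log 2 / 4 ^ m * (1 / r ^ 2) := by
  have h2m : (0 : ℝ) < 2 ^ m := by positivity
  set u : ℝ := ((2 : ℝ) ^ m * r)⁻¹ with hu
  have hu0 : 0 < u := by positivity
  have hu1 : 1 ≤ u := by
    rw [hu, one_le_inv₀ (by positivity)]
    calc (2 : ℝ) ^ m * r ≤ 2 ^ m * (2 ^ m)⁻¹ := by gcongr
      _ = 1 := mul_inv_cancel₀ h2m.ne'
  have hlog2 : (1 : ℝ) / 2 < Real.log 2 := by have := Real.log_two_gt_d9; linarith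
  have h1 : Real.log (1 / r) = m * Real.log 2 + Real.log u := by
    rw [hu, Real.log_inv, Real.log_mul h2m.ne' hr.ne', Real.log_pow, one_div, Real.log_inv]
    ring
  have hu2 : m * Real.log 2 / 4 ^ m * (1 / r ^ 2) = m * Real.log 2 * u ^ 2 := by
    have e4 : (4 : ℝ) ^ m = (2 ^ m) ^ 2 := by
      rw [← pow_mul, mul_comm, pow_mul]; norm_num
    rw [hu, e4, inv_pow, mul_pow]
    field_simp
  rw [h1, hu2]
  have hm1 : (1 : ℝ) ≤ m := by exact_mod_cast hm
  have hlogu : Real.log u ≤ (u ^ 2 - 1) / 2 := by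
    have := Real.log_le_sub_one_of_pos hu0
    nlinarith
  have key : Real.log u ≤ m * Real.log 2 * (u ^ 2 - 1) := hlogu.trans (by
    have h0 : 0 ≤ u ^ 2 - 1 := by nlinarith
    have h12 : (1 : ℝ) / 2 ≤ m * Real.log 2 := by nlinarith
    calc (u ^ 2 - 1) / 2 = 1 / 2 * (u ^ 2 - 1) := by ring
      _ ≤ m * Real.log 2 * (u ^ 2 - 1) := mul_le_mul_of_nonneg_right h12 h0)
  linarith

/-- For `r > 2^{-m}` (`r > 0`): `L(r) ≤ m log 2 + r` («`L_{jk} ≪ m + |x_j−x_k|/|ξ_j−ξ_k|`»).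
[cite: RodgersTaoFMP2020, Lemma 24 p. 55 (proof of (86))] -/
theorem renormLog_le_of_inv_two_pow_lt {r : ℝ} {m : ℕ} (hr : 0 < r) (h : ((2 : ℝ) ^ m)⁻¹ < r) :
    renormLog r ≤ m * Real.log 2 + r := by
  have hml : 0 ≤ (m : ℝ) * Real.log 2 := mul_nonneg (Nat.cast_nonneg _) (Real.log_nonneg one_le_two)
  rcases le_or_gt r 1 with h1 | h1
  · rw [renormLog_eq, abs_of_pos hr]
    have : -Real.log r ≤ m * Real.log 2 := by
      rw [← Real.log_inv, ← Real.log_pow]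
      exact Real.log_le_log (inv_pos.2 hr) (inv_le_of_inv_le₀ (by positivity) h.le)
    linarith
  · have h2 := renormLog_le_abs (x := r) (by rw [abs_of_pos hr]; exact h1.le)
    rw [abs_of_pos hr] at h2
    linarith

/-- For `s > 0`: `1/s² ≤ 4 + 4 V(s)` ((62): `V(s) ≥ 1/(4s²)` for `s ≤ 1/2`).
[cite: RodgersTaoFMP2020, §7 p. 40 (62)] -/
theorem inv_sq_le_four_add_renormPotential {s : ℝ} (hs : 0 < s) :
    1 / s ^ 2 ≤ 4 + 4 * renormPotential s := by
  have hV : 0 ≤ renormPotential s := renormPotential_nonneg hs.ne'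
  rcases le_or_gt s (1 / 2) with h | h
  · have h1 := le_renormPotential_of_abs_le_half hs.ne' (by rwa [abs_of_pos hs])
    have e : 1 / s ^ 2 = 4 * (1 / (4 * s ^ 2)) := by field_simp
    rw [e]; linarith
  · have : 1 / s ^ 2 < 4 := by
      rw [div_lt_iff₀ (by positivity)]; nlinarith
    linarith

/-- Telescoping over a discrete interval of `ℤ`. [folklore] -/
private theorem sum_Ico_int_sub_sub (f : ℤ → ℝ) {lo hi : ℤ} (h : lo ≤ hi) :
    ∑ i ∈ Finset.Ico lo hi, (f (i + 1) - f i) = f hi - f lo := by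
  obtain ⟨n, rfl⟩ := Int.le.dest h
  induction n with
  | zero => simp
  | succ n ih =>
    have h1 : Finset.Ico lo (lo + ((n + 1 : ℕ) : ℤ)) =
        Finset.Ico lo (lo + n) ∪ Finset.Ico (lo + n) (lo + n + 1) := by
      push_cast
      rw [← add_assoc, Finset.Ico_union_Ico_eq_Ico (by omega) (by omega)]
    have h2 : Finset.Ico (lo + n) (lo + n + 1) = {lo + (n : ℤ)} := by
      ext i; simp only [Finset.mem_Ico, Finset.mem_singleton]; omega
    rw [h1, Finset.sum_union (by rw [h2]; simp [Finset.mem_Ico]), h2, Finset.sum_singleton,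
      ih (by omega)]
    push_cast; ring

/-! ### §2 The per-pair bound: `H̃_{jk}` against the chain of consecutive gaps (Jensen) -/

/-- **The per-pair inequality** (repairing the last display of the printed proof): for `t` above a
real-rooted time, `lo < hi` in `ℤ` and `m ≥ 1`, with `d_i = ξ_{i+1} − ξ_i`, `g_i = x_{i+1} − x_i`,
`D = ξ_hi − ξ_lo = Σ d_i`:
`H̃_{lo,hi} ≤ Σ_{i∈[lo,hi)} (d_i/D)·[m log 2 + g_i/d_i + (4 log 2) m 4^{−m} (1 + d_i² Ẽ_{i,i+1})]`.
Case `r = (x_hi−x_lo)/(ξ_hi−ξ_lo) > 2^{−m}`: `L(r) ≤ m log 2 + r` and `r = Σ (d_i/D)(g_i/d_i)`; case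
`r ≤ 2^{−m}`: `L(r) ≤ log(1/r) ≤ (m log 2) 4^{−m} r^{−2}`, Jensen for `s ↦ s^{−2}` with weights
`d_i/D` gives `r^{−2} ≤ Σ (d_i/D)(d_i/g_i)²`, and `(d_i/g_i)² ≤ 4 + 4 d_i² Ẽ_{i,i+1}` by (62).
[cite: RodgersTaoFMP2020, Lemma 24 pp. 55–56 (proof, (86) and last display)] -/
theorem renormHamiltonianZ_le_chain_sum {t : ℝ}
    (hΛ : ∃ t' : ℝ, t' < t ∧ HasOnlyRealZeros (deBruijnH t'))
    {lo hi : ℤ} (hlh : lo < hi) {m : ℕ} (hm : 1 ≤ m) :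
    renormHamiltonianZ t lo hi ≤
      ∑ i ∈ Finset.Ico lo hi,
        (classicalLocationZ (i + 1) - classicalLocationZ i) /
            (classicalLocationZ hi - classicalLocationZ lo) *
          (m * Real.log 2 +
            (deBruijnZeroZ t (i + 1) - deBruijnZeroZ t i) /
              (classicalLocationZ (i + 1) - classicalLocationZ i) +
            4 * Real.log 2 * m / 4 ^ m *
              (1 + (classicalLocationZ (i + 1) - classicalLocationZ i) ^ 2 *
                renormEnergyZ t i (i + 1))) := by
  have hmx := strictMono_deBruijnZeroZ hΛ
  have hmξ := strictMono_classicalLocationZ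
  set d : ℤ → ℝ := fun i ↦ classicalLocationZ (i + 1) - classicalLocationZ i with hd
  set g : ℤ → ℝ := fun i ↦ deBruijnZeroZ t (i + 1) - deBruijnZeroZ t i with hg
  set D : ℝ := classicalLocationZ hi - classicalLocationZ lo with hD
  set G : ℝ := deBruijnZeroZ t hi - deBruijnZeroZ t lo with hG
  have hd0 : ∀ i, 0 < d i := fun i ↦ sub_pos.2 (hmξ (by omega))
  have hg0 : ∀ i, 0 < g i := fun i ↦ sub_pos.2 (hmx (by omega))
  have hD0 : 0 < D := sub_pos.2 (hmξ hlh)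
  have hG0 : 0 < G := sub_pos.2 (hmx hlh)
  have hDsum : ∑ i ∈ Finset.Ico lo hi, d i = D := sum_Ico_int_sub_sub classicalLocationZ hlh.le
  have hGsum : ∑ i ∈ Finset.Ico lo hi, g i = G := sum_Ico_int_sub_sub (deBruijnZeroZ t) hlh.le
  set r : ℝ := G / D with hr
  have hr0 : 0 < r := div_pos hG0 hD0
  have hH : renormHamiltonianZ t lo hi = renormLog r := by
    rw [renormHamiltonianZ_eq, ← neg_sub (deBruijnZeroZ t hi), ← neg_sub (classicalLocationZ hi),
      neg_div_neg_eq]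
  -- the weights
  have hw0 : ∀ i, 0 ≤ d i / D := fun i ↦ div_nonneg (hd0 i).le hD0.le
  have hw1 : ∑ i ∈ Finset.Ico lo hi, d i / D = 1 := by
    rw [← Finset.sum_div, hDsum, div_self hD0.ne']
  have hwr : ∑ i ∈ Finset.Ico lo hi, d i / D * (g i / d i) = r := by
    have : ∀ i ∈ Finset.Ico lo hi, d i / D * (g i / d i) = g i / D := fun i _ ↦ by
      field_simp [(hd0 i).ne']
    rw [Finset.sum_congr rfl this, ← Finset.sum_div, hGsum]
  -- the extra term is non-negative
  set c4 : ℝ := 4 * Real.log 2 * m / 4 ^ m with hc4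
  have hc4_0 : 0 ≤ c4 := by rw [hc4]; positivity
  have hE0 : ∀ i, 0 ≤ 1 + d i ^ 2 * renormEnergyZ t i (i + 1) := fun i ↦ by
    have : 0 ≤ renormEnergyZ t i (i + 1) :=
      renormEnergyZ_nonneg_of_strictMono hmx (by omega)
    positivity
  have hml : 0 ≤ (m : ℝ) * Real.log 2 := mul_nonneg (Nat.cast_nonneg _) (Real.log_nonneg one_le_two)
  rw [hH]
  change renormLog r ≤ ∑ i ∈ Finset.Ico lo hi, d i / D * (m * Real.log 2 + g i / d i +
    c4 * (1 + d i ^ 2 * renormEnergyZ t i (i + 1)))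
  rcases lt_or_ge ((2 : ℝ) ^ m)⁻¹ r with hcase | hcase
  · -- r > 2^{-m}
    calc renormLog r ≤ m * Real.log 2 + r := renormLog_le_of_inv_two_pow_lt hr0 hcase
      _ = ∑ i ∈ Finset.Ico lo hi, d i / D * (m * Real.log 2 + g i / d i) := by
          rw [Finset.sum_congr rfl fun i _ ↦ mul_add (d i / D) _ _, Finset.sum_add_distrib,
            ← Finset.sum_mul, hw1, one_mul, hwr]
      _ ≤ _ := Finset.sum_le_sum fun i _ ↦ by
          have : 0 ≤ d i / D * (c4 * (1 + d i ^ 2 * renormEnergyZ t i (i + 1))) :=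
            mul_nonneg (hw0 i) (mul_nonneg hc4_0 (hE0 i))
          nlinarith
  · -- r ≤ 2^{-m}: Jensen
    have hr1 : r ≤ 1 := hcase.trans (inv_le_one_of_one_le₀ (one_le_pow₀ one_le_two))
    have hL : renormLog r ≤ Real.log (1 / r) := by
      rw [renormLog_eq, abs_of_pos hr0, one_div, Real.log_inv]
      linarith
    have hJ : (1 / r ^ 2) ≤ ∑ i ∈ Finset.Ico lo hi, d i / D * (d i / g i) ^ 2 := by
      have hconv := (convexOn_zpow (-2 : ℤ) : ConvexOn ℝ (Ioi (0 : ℝ)) fun x : ℝ ↦ x ^ (-2 : ℤ))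
      have key := hconv.map_sum_le (t := Finset.Ico lo hi) (w := fun i ↦ d i / D)
        (p := fun i ↦ g i / d i) (fun i _ ↦ hw0 i) hw1 (fun i _ ↦ div_pos (hg0 i) (hd0 i))
      simp only [smul_eq_mul] at key
      rw [hwr] at key
      have e1 : r ^ (-2 : ℤ) = 1 / r ^ 2 := by
        rw [zpow_neg, zpow_ofNat, one_div]
      have e2 : ∀ i ∈ Finset.Ico lo hi, d i / D * (g i / d i) ^ (-2 : ℤ) = d i / D * (d i / g i) ^ 2 := by
        intro i _
        rw [zpow_neg, zpow_ofNat, ← inv_pow, inv_div]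
      rwa [e1, Finset.sum_congr rfl e2] at key
    have hV : ∀ i, (d i / g i) ^ 2 ≤ 4 * (1 + d i ^ 2 * renormEnergyZ t i (i + 1)) := by
      intro i
      have h1 := inv_sq_le_four_add_renormPotential (div_pos (hg0 i) (hd0 i))
      have e : renormEnergyZ t i (i + 1) = renormPotential (g i / d i) / d i ^ 2 := by
        rw [renormEnergyZ_eq]
      rw [e, mul_div_cancel₀ _ (pow_ne_zero 2 (hd0 i).ne')]
      rw [div_pow, one_div, inv_div, ← div_pow] at h1
      linarith
    calc renormLog r ≤ Real.log (1 / r) := hL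
      _ ≤ m * Real.log 2 / 4 ^ m * (1 / r ^ 2) := log_inv_le_mul_inv_sq hr0 hm hcase
      _ ≤ m * Real.log 2 / 4 ^ m * ∑ i ∈ Finset.Ico lo hi, d i / D * (4 * (1 + d i ^ 2 *
            renormEnergyZ t i (i + 1))) := by
          refine mul_le_mul_of_nonneg_left (hJ.trans (Finset.sum_le_sum fun i _ ↦ ?_)) (by positivity)
          exact mul_le_mul_of_nonneg_left (hV i) (hw0 i)
      _ = ∑ i ∈ Finset.Ico lo hi, d i / D * (c4 * (1 + d i ^ 2 * renormEnergyZ t i (i + 1))) := by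
          rw [Finset.mul_sum]
          refine Finset.sum_congr rfl fun i _ ↦ ?_
          rw [hc4]; ring
      _ ≤ _ := Finset.sum_le_sum fun i _ ↦ by
          have : 0 ≤ d i / D * (m * Real.log 2 + g i / d i) :=
            mul_nonneg (hw0 i) (add_nonneg hml (div_nonneg (hg0 i).le (hd0 i).le))
          nlinarith


/-! ### §3 Double counting: pairs straddling an index, and the exchange of summations -/

/-- **Harmonic straddle count.** If every pair `p = (j,k)` of a finite set `S ⊂ ℤ²` straddles the
index `i` (`min ≤ i < max`) and has length `max − min ≤ R`, then `Σ_{p∈S} 1/(max − min) ≤ 2R`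
(for each length `h` there are at most `2h` such pairs). [folklore] -/
private theorem sum_inv_length_le_of_straddle (i : ℤ) {R : ℝ} (hR : 0 ≤ R) (S : Finset (ℤ × ℤ))
    (hS : ∀ p ∈ S, min p.1 p.2 ≤ i ∧ i < max p.1 p.2 ∧
      (((max p.1 p.2 - min p.1 p.2 : ℤ) : ℝ)) ≤ R) :
    ∑ p ∈ S, (1 : ℝ) / ((max p.1 p.2 - min p.1 p.2 : ℤ) : ℝ) ≤ 2 * R := by
  classical
  set h : ℤ × ℤ → ℕ := fun p ↦ (max p.1 p.2 - min p.1 p.2).toNat with hh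
  set Rn : ℕ := ⌊R⌋₊ with hRn
  have hlen : ∀ p ∈ S, ((h p : ℕ) : ℤ) = max p.1 p.2 - min p.1 p.2 := by
    intro p hp
    obtain ⟨h1, h2, -⟩ := hS p hp
    rw [hh]; dsimp only
    exact Int.toNat_of_nonneg (by omega)
  have hmaps : ∀ p ∈ S, h p ∈ Finset.Icc 1 Rn := by
    intro p hp
    obtain ⟨h1, h2, h3⟩ := hS p hp
    have hl := hlen p hp
    rw [Finset.mem_Icc]
    constructor
    · have : (1 : ℤ) ≤ (h p : ℕ) := by rw [hl]; omega
      exact_mod_cast this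
    · rw [hRn]
      refine Nat.le_floor ?_
      have e : ((h p : ℕ) : ℝ) = ((max p.1 p.2 - min p.1 p.2 : ℤ) : ℝ) := by
        rw [← hl]; norm_cast
      rw [e]; exact h3
  rw [← Finset.sum_fiberwise_of_maps_to hmaps]
  have hfib : ∀ n ∈ Finset.Icc 1 Rn,
      ∑ p ∈ S with h p = n, (1 : ℝ) / ((max p.1 p.2 - min p.1 p.2 : ℤ) : ℝ) ≤ 2 := by
    intro n hn
    rw [Finset.mem_Icc] at hn
    have hn0 : (0 : ℝ) < n := by exact_mod_cast hn.1
    have hval : ∀ p ∈ S.filter (fun p ↦ h p = n),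
        (1 : ℝ) / ((max p.1 p.2 - min p.1 p.2 : ℤ) : ℝ) = 1 / n := by
      intro p hp
      rw [Finset.mem_filter] at hp
      have hl := hlen p hp.1
      rw [hp.2] at hl
      rw [← hl, Int.cast_natCast]
    rw [Finset.sum_congr rfl hval, Finset.sum_const, nsmul_eq_mul]
    have hcard : ((S.filter (fun p ↦ h p = n)).card : ℝ) ≤ 2 * n := by
      set φ : ℤ × Bool → ℤ × ℤ := fun q ↦ if q.2 then (q.1, q.1 + n) else (q.1 + n, q.1) with hφ
      have hsub : S.filter (fun p ↦ h p = n) ⊆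
          ((Finset.Ioc (i - n) i) ×ˢ (Finset.univ : Finset Bool)).image φ := by
        intro p hp
        rw [Finset.mem_filter] at hp
        obtain ⟨h1, h2, -⟩ := hS p hp.1
        have hmn : max p.1 p.2 - min p.1 p.2 = n := by
          have hl := hlen p hp.1
          rw [hp.2] at hl
          exact hl.symm
        rw [Finset.mem_image]
        rcases le_total p.1 p.2 with hle | hle
        · rw [min_eq_left hle] at hmn h1
          rw [max_eq_right hle] at hmn h2
          refine ⟨(p.1, true), ?_, ?_⟩
          · rw [Finset.mem_product, Finset.mem_Ioc]
            exact ⟨⟨by omega, h1⟩, Finset.mem_univ _⟩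
          · rw [hφ]; dsimp only; rw [if_pos rfl]
            ext
            · rfl
            · show p.1 + n = p.2; omega
        · rw [min_eq_right hle] at hmn h1
          rw [max_eq_left hle] at hmn h2
          refine ⟨(p.2, false), ?_, ?_⟩
          · rw [Finset.mem_product, Finset.mem_Ioc]
            exact ⟨⟨by omega, h1⟩, Finset.mem_univ _⟩
          · rw [hφ]; dsimp only; rw [if_neg (by decide)]
            ext
            · show p.2 + n = p.1; omega
            · rfl
      calc ((S.filter (fun p ↦ h p = n)).card : ℝ)
          ≤ (((Finset.Ioc (i - n) i) ×ˢ (Finset.univ : Finset Bool)).image φ).card := by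
            exact_mod_cast Finset.card_le_card hsub
        _ ≤ ((Finset.Ioc (i - n) i) ×ˢ (Finset.univ : Finset Bool)).card := by
            exact_mod_cast Finset.card_image_le
        _ = 2 * n := by
            rw [Finset.card_product, Int.card_Ioc, Finset.card_univ, Fintype.card_bool]
            have : (i - (i - n)).toNat = n := by simp
            rw [this]; push_cast; ring
    calc ((S.filter (fun p ↦ h p = n)).card : ℝ) * (1 / (n : ℝ)) ≤ (2 * n) * (1 / n) :=
          mul_le_mul_of_nonneg_right hcard (by positivity)
      _ = 2 := by field_simp
  calc ∑ n ∈ Finset.Icc 1 Rn, ∑ p ∈ S with h p = n,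
        (1 : ℝ) / ((max p.1 p.2 - min p.1 p.2 : ℤ) : ℝ)
      ≤ ∑ n ∈ Finset.Icc 1 Rn, (2 : ℝ) := Finset.sum_le_sum hfib
    _ = 2 * Rn := by rw [Finset.sum_const, Nat.card_Icc, nsmul_eq_mul]; push_cast; ring
    _ ≤ 2 * R := by rw [hRn]; gcongr; exact Nat.floor_le hR

/-- **Exchange of summations over the chains of consecutive gaps.** For a finite set `P` of ordered
pairs of distinct indices in `[1, M]`, weights `0 ≤ W(p) ≤ w(i)` along the chain
`i ∈ [min p, max p)`, `ξ_max − ξ_min ≥ (max − min)/(A ℓ_i)` and chain lengths `≤ ρ_i`, one has for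
every `Q ≥ 0`, with `d_i = ξ_{i+1} − ξ_i`:
`Σ_{p∈P} W(p) Σ_{i∈chain(p)} (d_i/(ξ_max − ξ_min)) Q_i ≤ 2A Σ_{i∈[1,M]} w(i) ℓ_i ρ_i d_i Q_i`
(the pair → consecutive-gap exchange used for (87) and for the last display of the proof).
[cite: RodgersTaoFMP2020, Lemma 24 pp. 55–56 (proof of (87), «telescoping series»)] -/
theorem pair_chain_sum_le {M : ℤ} (P : Finset (ℤ × ℤ))
    (hP : ∀ p ∈ P, p.1 ≠ p.2 ∧ 1 ≤ min p.1 p.2 ∧ max p.1 p.2 ≤ M)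
    (W : ℤ × ℤ → ℝ) (w : ℤ → ℝ) (hw0 : ∀ i, 0 ≤ w i)
    (hW : ∀ p ∈ P, ∀ i ∈ Finset.Ico (min p.1 p.2) (max p.1 p.2), W p ≤ w i)
    (ℓ : ℤ → ℝ) (hℓ : ∀ i, 0 < ℓ i) {A : ℝ} (hA : 0 < A)
    (hD : ∀ p ∈ P, ∀ i ∈ Finset.Ico (min p.1 p.2) (max p.1 p.2),
      (((max p.1 p.2 - min p.1 p.2 : ℤ) : ℝ)) / (A * ℓ i) ≤
        classicalLocationZ (max p.1 p.2) - classicalLocationZ (min p.1 p.2))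
    (ρ : ℤ → ℝ) (hρ : ∀ i, 0 ≤ ρ i)
    (hR : ∀ p ∈ P, ∀ i ∈ Finset.Ico (min p.1 p.2) (max p.1 p.2),
      (((max p.1 p.2 - min p.1 p.2 : ℤ) : ℝ)) ≤ ρ i)
    (Q : ℤ → ℝ) (hQ : ∀ i, 0 ≤ Q i) :
    ∑ p ∈ P, W p * ∑ i ∈ Finset.Ico (min p.1 p.2) (max p.1 p.2),
        (classicalLocationZ (i + 1) - classicalLocationZ i) /
          (classicalLocationZ (max p.1 p.2) - classicalLocationZ (min p.1 p.2)) * Q i ≤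
      2 * A * ∑ i ∈ Finset.Icc 1 M,
        w i * ℓ i * ρ i * (classicalLocationZ (i + 1) - classicalLocationZ i) * Q i := by
  classical
  have hmξ := strictMono_classicalLocationZ
  set d : ℤ → ℝ := fun i ↦ classicalLocationZ (i + 1) - classicalLocationZ i with hd
  have hd0 : ∀ i, 0 < d i := fun i ↦ sub_pos.2 (hmξ (by omega))
  set lo : ℤ × ℤ → ℤ := fun p ↦ min p.1 p.2 with hlo
  set hi : ℤ × ℤ → ℤ := fun p ↦ max p.1 p.2 with hhi
  set D : ℤ × ℤ → ℝ := fun p ↦ classicalLocationZ (hi p) - classicalLocationZ (lo p) with hDdef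
  change ∑ p ∈ P, W p * ∑ i ∈ Finset.Ico (lo p) (hi p), d i / D p * Q i ≤
    2 * A * ∑ i ∈ Finset.Icc 1 M, w i * ℓ i * ρ i * d i * Q i
  have hlohi : ∀ p ∈ P, lo p < hi p := by
    intro p hp
    have := (hP p hp).1
    simp only [hlo, hhi]
    rcases lt_or_gt_of_ne this with h | h
    · rw [min_eq_left h.le, max_eq_right h.le]; exact h
    · rw [min_eq_right h.le, max_eq_left h.le]; exact h
  have hDpos : ∀ p ∈ P, 0 < D p := fun p hp ↦ sub_pos.2 (hmξ (hlohi p hp))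
  -- Step 1: expand and exchange
  rw [Finset.sum_congr rfl fun p _ ↦ (Finset.mul_sum _ _ _)]
  rw [Finset.sum_comm' (s' := fun i ↦ P.filter (fun p ↦ i ∈ Finset.Ico (lo p) (hi p)))
    (t' := Finset.Icc 1 M)
    (h := by
      intro p i
      constructor
      · rintro ⟨hp, hi'⟩
        refine ⟨Finset.mem_filter.2 ⟨hp, hi'⟩, ?_⟩
        obtain ⟨-, h1, h2⟩ := hP p hp
        rw [Finset.mem_Ico] at hi'
        rw [Finset.mem_Icc]
        simp only [hlo, hhi] at hi'
        constructor <;> omega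
      · rintro ⟨hp, -⟩
        rw [Finset.mem_filter] at hp
        exact hp)]
  rw [Finset.mul_sum]
  refine Finset.sum_le_sum fun i _ ↦ ?_
  -- Step 2: pointwise on the pairs through i
  set S := P.filter (fun p ↦ i ∈ Finset.Ico (lo p) (hi p)) with hSdef
  have hSmem : ∀ p ∈ S, p ∈ P ∧ i ∈ Finset.Ico (lo p) (hi p) := fun p hp ↦ Finset.mem_filter.1 hp
  have hpt : ∀ p ∈ S, W p * (d i / D p * Q i) ≤
      (w i * ℓ i * d i * Q i * A) * (1 / (((max p.1 p.2 - min p.1 p.2 : ℤ) : ℝ))) := by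
    intro p hp
    obtain ⟨hpP, hiI⟩ := hSmem p hp
    have hlen0 : (0 : ℝ) < ((hi p - lo p : ℤ) : ℝ) := by
      have := hlohi p hpP; exact_mod_cast (by omega : 0 < hi p - lo p)
    have hDge := hD p hpP i hiI
    have hDp := hDpos p hpP
    have hinvD : 1 / D p ≤ A * ℓ i / (((hi p - lo p : ℤ) : ℝ)) := by
      rw [div_le_div_iff₀ hDp hlen0, one_mul]
      have := (div_le_iff₀ (mul_pos hA (hℓ i))).1 hDge
      linarith
    have hWle := hW p hpP i hiI
    calc W p * (d i / D p * Q i) = W p * (d i * Q i) * (1 / D p) := by ring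
      _ ≤ w i * (d i * Q i) * (A * ℓ i / (((hi p - lo p : ℤ) : ℝ))) := by
          refine mul_le_mul (mul_le_mul_of_nonneg_right hWle (mul_nonneg (hd0 i).le (hQ i)))
            hinvD (by positivity) (mul_nonneg (hw0 i) (mul_nonneg (hd0 i).le (hQ i)))
      _ = (w i * ℓ i * d i * Q i * A) * (1 / (((max p.1 p.2 - min p.1 p.2 : ℤ) : ℝ))) := by
          simp only [hlo, hhi]; ring
  have hstr : ∀ p ∈ S, min p.1 p.2 ≤ i ∧ i < max p.1 p.2 ∧
      (((max p.1 p.2 - min p.1 p.2 : ℤ) : ℝ)) ≤ ρ i := by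
    intro p hp
    obtain ⟨hpP, hiI⟩ := hSmem p hp
    rw [Finset.mem_Ico] at hiI
    exact ⟨hiI.1, hiI.2, hR p hpP i (Finset.mem_Ico.2 hiI)⟩
  have hH := sum_inv_length_le_of_straddle i (hρ i) S hstr
  have hc0 : 0 ≤ w i * ℓ i * d i * Q i * A := by
    have := hd0 i; have := hℓ i; have := hQ i; have := hw0 i; positivity
  calc ∑ p ∈ S, W p * (d i / D p * Q i)
      ≤ ∑ p ∈ S, (w i * ℓ i * d i * Q i * A) * (1 / (((max p.1 p.2 - min p.1 p.2 : ℤ) : ℝ))) :=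
        Finset.sum_le_sum hpt
    _ = (w i * ℓ i * d i * Q i * A) * ∑ p ∈ S, (1 / (((max p.1 p.2 - min p.1 p.2 : ℤ) : ℝ))) := by
        rw [Finset.mul_sum]
    _ ≤ (w i * ℓ i * d i * Q i * A) * (2 * ρ i) := mul_le_mul_of_nonneg_left hH hc0
    _ = 2 * A * (w i * ℓ i * ρ i * d i * Q i) := by ring


/-! ### §4 Toolkit: `log₊ ξ_j ≍ log₊ j`, consecutive spacings, `ψ_T`-comparability, growth lemmas -/

/-- `c log₊ j ≤ log₊ ξ_j` on `ℤ*` for an absolute `0 < c ≤ 1` (Lemma 8 (i), evenness).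
[cite: RodgersTaoFMP2020, Lemma 8 (i) = v4 Lemma 3.1 (i) p. 21] -/
theorem exists_mul_logPlus_le_logPlus_classicalLocationZ :
    ∃ c : ℝ, 0 < c ∧ c ≤ 1 ∧ ∀ j : ℤ, j ≠ 0 → c * logPlus j ≤ logPlus (classicalLocationZ j) := by
  obtain ⟨c, C, hc, -, h⟩ := lemma8_i_order
  refine ⟨min c 1, lt_min hc one_pos, min_le_right _ _, fun j hj ↦ ?_⟩
  have key : ∀ j : ℤ, 0 < j → min c 1 * logPlus j ≤ logPlus (classicalLocationZ j) := by
    intro j hj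
    have hj1 : (1 : ℝ) ≤ (j : ℝ) := by exact_mod_cast hj
    rw [classicalLocationZ_of_pos hj]
    exact (mul_le_mul_of_nonneg_right (min_le_left _ _) (logPlus_nonneg _)).trans
      (h (j : ℝ) hj1).2.2.1
  rcases lt_or_gt_of_ne hj with hj' | hj'
  · have := key (-j) (by omega)
    rw [classicalLocationZ_neg, logPlus_neg] at this
    push_cast at this
    rwa [logPlus_neg] at this
  · exact key j hj'

/-- `|ξ_a| = ξ_{|a|}` (oddness and positivity). [cite: RodgersTaoFMP2020, §3 after (42) p. 21] -/
theorem abs_classicalLocationZ_eq_abs (a : ℤ) : |classicalLocationZ a| = classicalLocationZ |a| := by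
  rcases le_or_gt 0 a with h | h
  · rcases h.eq_or_lt with h' | h'
    · rw [← h', classicalLocationZ_zero, abs_zero, abs_zero, classicalLocationZ_zero]
    · rw [abs_of_nonneg h, abs_of_nonneg (classicalLocationZ_pos h').le]
  · have hp := classicalLocationZ_pos (show 0 < -a by omega)
    rw [classicalLocationZ_neg] at hp
    rw [abs_of_neg h, abs_of_neg (by linarith), ← classicalLocationZ_neg]

/-- `log₊ ξ` is monotone in `|j|`. [cite: RodgersTaoFMP2020, §3 after (42) p. 21] -/
theorem logPlus_classicalLocationZ_mono {a b : ℤ} (h : |a| ≤ |b|) :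
    logPlus (classicalLocationZ a) ≤ logPlus (classicalLocationZ b) := by
  refine logPlus_mono ?_
  rw [abs_classicalLocationZ_eq_abs, abs_classicalLocationZ_eq_abs]
  exact strictMono_classicalLocationZ.monotone h

/-- `log₊ ξ_a ≤ K log₊ ξ_i` whenever `|a| ≤ 2|i|`, `i ≠ 0` (slow variation of `log₊ ξ`).
[cite: RodgersTaoFMP2020, Lemma 8 (i) = v4 Lemma 3.1 (i) p. 21] -/
theorem exists_logPlus_classicalLocationZ_le_of_abs_le_two_mul :
    ∃ K : ℝ, 1 ≤ K ∧ ∀ i a : ℤ, i ≠ 0 → |a| ≤ 2 * |i| →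
      logPlus (classicalLocationZ a) ≤ K * logPlus (classicalLocationZ i) := by
  obtain ⟨C, hC1, hC⟩ := exists_logPlus_classicalLocationZ_le
  obtain ⟨c, hc, hc1, hcle⟩ := exists_mul_logPlus_le_logPlus_classicalLocationZ
  refine ⟨2 * C / c, ?_, fun i a hi ha ↦ ?_⟩
  · rw [le_div_iff₀ hc]; nlinarith
  · have h1 : logPlus (classicalLocationZ a) ≤ logPlus (classicalLocationZ (2 * i)) :=
      logPlus_classicalLocationZ_mono (by rw [abs_mul, abs_two]; exact ha)
    have h2 : logPlus (classicalLocationZ (2 * i)) ≤ C * logPlus ((2 * i : ℤ) : ℝ) := hC (2 * i)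
    have h3 : logPlus ((2 * i : ℤ) : ℝ) ≤ 2 * logPlus (i : ℝ) := by
      push_cast
      rw [logPlus_eq, logPlus_eq, abs_mul, abs_two]
      have e : 2 * Real.log (2 + |(i : ℝ)|) = Real.log ((2 + |(i : ℝ)|) ^ 2) := by
        rw [Real.log_pow]; norm_num
      rw [e]
      exact Real.log_le_log (by positivity) (by nlinarith [abs_nonneg (i : ℝ)])
    have h4 : logPlus (i : ℝ) ≤ logPlus (classicalLocationZ i) / c := by
      rw [le_div_iff₀ hc, mul_comm]; exact hcle i hi
    have hC0 : 0 ≤ C := by linarith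
    calc logPlus (classicalLocationZ a) ≤ C * (2 * (logPlus (classicalLocationZ i) / c)) :=
          h1.trans (h2.trans (mul_le_mul_of_nonneg_left (h3.trans (by linarith)) hC0))
      _ = 2 * C / c * logPlus (classicalLocationZ i) := by
          field_simp

/-- Consecutive spacing of the classical locations, upper bound from (44):
`ξ_{i+1} − ξ_i ≤ C/log₊ ξ_i` for `i ≥ 1`. [cite: RodgersTaoFMP2020, Lemma 8 (ii) (44) p. 21] -/
theorem exists_classicalLocationZ_succ_sub_le :
    ∃ C : ℝ, 0 < C ∧ ∀ i : ℤ, 1 ≤ i →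
      classicalLocationZ (i + 1) - classicalLocationZ i ≤ C / logPlus (classicalLocationZ i) := by
  obtain ⟨c, C, hc, hcC, h44⟩ := RodgersTao2020.lemma31_ii_holds_record
  have hC : 0 < C := hc.trans_le hcC
  refine ⟨C, hC, fun i hi ↦ ?_⟩
  have h := (h44 i (i + 1) (by omega) (by omega)).2
  have hpos : 0 < classicalLocationZ (i + 1) - classicalLocationZ i :=
    sub_pos.2 (strictMono_classicalLocationZ (by omega))
  rw [abs_of_pos hpos] at h
  have e1 : |((i + 1 : ℤ) : ℝ) - (i : ℝ)| = 1 := by push_cast; simp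
  rw [e1] at h
  have hℓ : logPlus (classicalLocationZ i) ≤
      logPlus (|classicalLocationZ i| + |classicalLocationZ (i + 1)|) :=
    logPlus_mono (by rw [abs_of_nonneg (by positivity : (0 : ℝ) ≤ |classicalLocationZ i| +
      |classicalLocationZ (i + 1)|)]; linarith [abs_nonneg (classicalLocationZ (i + 1))])
  calc _ ≤ C * (1 / logPlus (|classicalLocationZ i| + |classicalLocationZ (i + 1)|)) := h
    _ ≤ C * (1 / logPlus (classicalLocationZ i)) := by
        refine mul_le_mul_of_nonneg_left ?_ hC.le
        exact div_le_div_of_nonneg_left zero_le_one (logPlus_pos _) hℓ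
    _ = C / logPlus (classicalLocationZ i) := by ring

/-- Lower bound for `ξ_hi − ξ_lo` from (44): `c (hi − lo)/log₊ ξ_hi ≤ ξ_hi − ξ_lo` for
`1 ≤ lo ≤ hi` (`log₊(ξ_lo + ξ_hi) ≤ 2 log₊ ξ_hi`). [cite: RodgersTaoFMP2020, Lemma 8 (ii) (44) p. 21] -/
theorem exists_mul_sub_div_le_classicalLocationZ_sub :
    ∃ c : ℝ, 0 < c ∧ ∀ lo hi : ℤ, 1 ≤ lo → lo ≤ hi →
      c * (((hi - lo : ℤ) : ℝ)) / logPlus (classicalLocationZ hi) ≤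
        classicalLocationZ hi - classicalLocationZ lo := by
  obtain ⟨c, hc, h⟩ := lemma8_ii_pos
  refine ⟨c / 2, by positivity, fun lo hi hlo hlh ↦ ?_⟩
  have h1 := h lo hi hlo hlh
  rw [← classicalLocationZ_of_pos (by omega : 0 < lo),
    ← classicalLocationZ_of_pos (by omega : 0 < hi)] at h1
  have hξhi : 0 < classicalLocationZ hi := classicalLocationZ_pos (by omega)
  have hξlo : 0 < classicalLocationZ lo := classicalLocationZ_pos (by omega)
  have hlohi' : classicalLocationZ lo ≤ classicalLocationZ hi :=
    strictMono_classicalLocationZ.monotone hlh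
  have hL : logPlus (classicalLocationZ lo + classicalLocationZ hi) ≤
      2 * logPlus (classicalLocationZ hi) := by
    rw [logPlus_eq, logPlus_eq, abs_of_pos (by linarith), abs_of_pos hξhi]
    have e : 2 * Real.log (2 + classicalLocationZ hi) = Real.log ((2 + classicalLocationZ hi) ^ 2) := by
      rw [Real.log_pow]; norm_num
    rw [e]
    exact Real.log_le_log (by positivity) (by nlinarith)
  have hd0 : (0 : ℝ) ≤ (hi : ℝ) - lo := by
    have : (lo : ℝ) ≤ hi := by exact_mod_cast hlh
    linarith
  calc c / 2 * (((hi - lo : ℤ) : ℝ)) / logPlus (classicalLocationZ hi)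
      = c * ((((hi : ℝ) - lo)) / (2 * logPlus (classicalLocationZ hi))) := by push_cast; ring
    _ ≤ c * ((((hi : ℝ) - lo)) / logPlus (classicalLocationZ lo + classicalLocationZ hi)) := by
        refine mul_le_mul_of_nonneg_left ?_ hc.le
        exact div_le_div_of_nonneg_left hd0 (logPlus_pos _) hL
    _ ≤ _ := h1

/-- `ψ_T`-comparability along short chains: for `0 ≤ a ≤ i` with `100 (i − a) ≤ T log T + a`,
`ψ_T(a) ≤ 3 ψ_T(i)` (`(1.01)^{100} ≤ 3`). [cite: RodgersTaoFMP2020, §7 p. 42 (66)] -/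
theorem truncWeight_le_three_mul {T : ℝ} (hT : 0 < T * Real.log T) {a i : ℤ} (ha : 0 ≤ a)
    (hai : a ≤ i) (h : 100 * ((i : ℝ) - a) ≤ T * Real.log T + a) :
    truncWeight T a ≤ 3 * truncWeight T i := by
  set N := T * Real.log T with hN
  have ha' : (0 : ℝ) ≤ a := by exact_mod_cast ha
  have hi' : (a : ℝ) ≤ i := by exact_mod_cast hai
  have hi0 : (0 : ℝ) ≤ i := ha'.trans hi'
  rw [truncWeight_eq, truncWeight_eq, abs_of_nonneg ha', abs_of_nonneg hi0, ← hN]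
  have h1 : 0 < 1 + (a : ℝ) / N := by positivity
  have h2 : 0 < 1 + (i : ℝ) / N := by positivity
  rw [show (3 : ℝ) * ((1 + (i : ℝ) / N) ^ 100)⁻¹ = 3 / (1 + (i : ℝ) / N) ^ 100 by ring,
    inv_eq_one_div, div_le_div_iff₀ (by positivity) (by positivity), one_mul]
  have hvu : (i : ℝ) / N - a / N ≤ (1 + a / N) / 100 := by
    have e : (i : ℝ) / N - a / N = ((i : ℝ) - a) / N := by ring
    rw [e, div_le_div_iff₀ hT (by norm_num : (0 : ℝ) < 100)]
    calc ((i : ℝ) - a) * 100 = 100 * ((i : ℝ) - a) := by ring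
      _ ≤ N + a := by linarith
      _ = (1 + a / N) * N := by field_simp
  have key : 1 + (i : ℝ) / N ≤ (1 + a / N) * (101 / 100) := by linarith
  calc (1 + (i : ℝ) / N) ^ 100 ≤ ((1 + a / N) * (101 / 100)) ^ 100 :=
        pow_le_pow_left₀ h2.le key 100
    _ = (1 + a / N) ^ 100 * (101 / 100) ^ 100 := mul_pow _ _ _
    _ ≤ (1 + a / N) ^ 100 * 3 := by gcongr; norm_num
    _ = 3 * (1 + (a : ℝ) / N) ^ 100 := by ring

/-- Growth lemma: `A log²(2 + x) ≤ x` for `x ≥ N₀(A)` (`log y ≤ 4 y^{1/4}`). [folklore] -/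
private theorem exists_nat_mul_log_sq_le (A : ℝ) :
    ∃ N₀ : ℕ, ∀ x : ℝ, (N₀ : ℝ) ≤ x → A * Real.log (2 + x) ^ 2 ≤ x := by
  refine ⟨⌈1024 * A ^ 2⌉₊ + 2, fun x hx ↦ ?_⟩
  have hceil := Nat.le_ceil (1024 * A ^ 2)
  push_cast at hx
  have hx2 : 2 ≤ x := by
    have : (0 : ℝ) ≤ (⌈1024 * A ^ 2⌉₊ : ℝ) := Nat.cast_nonneg _
    linarith
  have hy : 0 < 2 + x := by linarith
  have hlog : Real.log (2 + x) ≤ 4 * Real.sqrt (Real.sqrt (2 + x)) := by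
    have h1 : Real.log (2 + x) = 4 * Real.log (Real.sqrt (Real.sqrt (2 + x))) := by
      rw [Real.log_sqrt (Real.sqrt_nonneg _), Real.log_sqrt hy.le]; ring
    rw [h1]
    have hs : 0 < Real.sqrt (Real.sqrt (2 + x)) := Real.sqrt_pos.2 (Real.sqrt_pos.2 hy)
    have := Real.log_le_sub_one_of_pos hs
    linarith
  have hlog0 : 0 ≤ Real.log (2 + x) := Real.log_nonneg (by linarith)
  have hsq : Real.log (2 + x) ^ 2 ≤ 16 * Real.sqrt (2 + x) := by
    have := pow_le_pow_left₀ hlog0 hlog 2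
    rw [mul_pow, Real.sq_sqrt (Real.sqrt_nonneg _)] at this
    linarith
  have hsx : Real.sqrt (2 + x) ≤ 2 * Real.sqrt x := by
    have e : (2 : ℝ) * Real.sqrt x = Real.sqrt (4 * x) := by
      rw [Real.sqrt_mul (by norm_num), show Real.sqrt 4 = 2 by
        rw [show (4 : ℝ) = 2 ^ 2 by norm_num, Real.sqrt_sq (by norm_num)]]
    rw [e]
    exact Real.sqrt_le_sqrt (by linarith)
  rcases le_or_gt A 0 with hA | hA
  · exact (mul_nonpos_of_nonpos_of_nonneg hA (sq_nonneg _)).trans (by linarith)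
  · have hxA : 1024 * A ^ 2 ≤ x := by linarith
    have hsqrtx : 32 * A ≤ Real.sqrt x := by
      rw [show 32 * A = Real.sqrt ((32 * A) ^ 2) by rw [Real.sqrt_sq (by positivity)]]
      exact Real.sqrt_le_sqrt (by nlinarith)
    calc A * Real.log (2 + x) ^ 2 ≤ A * (16 * (2 * Real.sqrt x)) :=
          mul_le_mul_of_nonneg_left (hsq.trans (by linarith)) hA.le
      _ = (32 * A) * Real.sqrt x := by ring
      _ ≤ Real.sqrt x * Real.sqrt x := mul_le_mul_of_nonneg_right hsqrtx (Real.sqrt_nonneg _)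
      _ = x := Real.mul_self_sqrt (by linarith)

/-- `1 ≤ log T`, `3 ≤ T log T` and `log(2 + T log T) ≤ 2 log T` for `T ≥ 3`. [folklore] -/
private theorem log_facts_of_three_le {T : ℝ} (hT : 3 ≤ T) :
    1 ≤ Real.log T ∧ 3 ≤ T * Real.log T ∧ Real.log (2 + T * Real.log T) ≤ 2 * Real.log T := by
  have hT0 : 0 < T := by linarith
  have hlogT : 1 ≤ Real.log T := by
    rw [← Real.log_exp 1]
    refine Real.log_le_log (Real.exp_pos 1) ?_
    have := Real.exp_one_lt_d9; linarith
  refine ⟨hlogT, by nlinarith, ?_⟩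
  have h1 : Real.log T ≤ T - 1 := by
    have := Real.log_le_sub_one_of_pos hT0; linarith
  have h2 : 2 + T * Real.log T ≤ T ^ 2 := by nlinarith
  calc Real.log (2 + T * Real.log T) ≤ Real.log (T ^ 2) :=
        Real.log_le_log (by positivity) h2
    _ = 2 * Real.log T := by rw [Real.log_pow]; norm_num

/-- `ψ_T(j) log₊³ j ≤ 64 log³ T` for `T ≥ 3` (the profile bound: `log₊ j ≤ log(2 + N) + |j|/N`,
`N = T log T`, and `u³(1+u)^{−100} ≤ 1`). [cite: RodgersTaoFMP2020, §7 p. 42 (66)] -/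
theorem truncWeight_mul_logPlus_cube_le {T : ℝ} (hT : 3 ≤ T) (j : ℤ) :
    truncWeight T j * logPlus j ^ 3 ≤ 64 * Real.log T ^ 3 := by
  obtain ⟨hlogT, hN3, hlog2N⟩ := log_facts_of_three_le hT
  set N := T * Real.log T with hN
  have hN0 : 0 < N := by linarith
  set u := |(j : ℝ)| / N with hu
  have hu0 : 0 ≤ u := by positivity
  have h1u : 1 ≤ 1 + u := by linarith
  set a := Real.log (2 + N) with ha
  have ha0 : 0 ≤ a := Real.log_nonneg (by linarith)
  have h1 : logPlus (j : ℝ) ≤ a + u := by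
    rw [logPlus_eq, ha]
    have h2 : 2 + |(j : ℝ)| ≤ (2 + N) * (1 + u) := by
      have : (2 + N) * (1 + u) = 2 + N + 2 * u + |(j : ℝ)| := by
        rw [hu]; field_simp; ring
      rw [this]; linarith
    have h3 : Real.log (1 + u) ≤ u := by
      have := Real.log_le_sub_one_of_pos (by linarith : (0 : ℝ) < 1 + u); linarith
    calc Real.log (2 + |(j : ℝ)|) ≤ Real.log ((2 + N) * (1 + u)) :=
          Real.log_le_log (by positivity) h2
      _ = Real.log (2 + N) + Real.log (1 + u) :=
          Real.log_mul (by positivity) (by positivity)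
      _ ≤ Real.log (2 + N) + u := by linarith
  have h4 : logPlus (j : ℝ) ^ 3 ≤ 4 * a ^ 3 + 4 * u ^ 3 := by
    have h5 := pow_le_pow_left₀ (logPlus_nonneg _) h1 3
    have h6 : (a + u) ^ 3 ≤ 4 * a ^ 3 + 4 * u ^ 3 := by
      nlinarith [mul_nonneg (add_nonneg ha0 hu0) (sq_nonneg (a - u))]
    linarith
  have hψ : truncWeight T j = ((1 + u) ^ 100)⁻¹ := by rw [truncWeight_eq]
  have hψ1 : truncWeight T j ≤ 1 := truncWeight_le_one hN0 j
  have hψ0 : 0 ≤ truncWeight T j := (truncWeight_pos hN0 j).le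
  have h7 : truncWeight T j * u ^ 3 ≤ 1 := by
    rw [hψ, inv_mul_le_iff₀ (by positivity), mul_one]
    calc u ^ 3 ≤ (1 + u) ^ 3 := pow_le_pow_left₀ hu0 (by linarith) 3
      _ ≤ (1 + u) ^ 100 := pow_le_pow_right₀ h1u (by norm_num)
  have ha2 : a ≤ 2 * Real.log T := hlog2N
  have ha3 : a ^ 3 ≤ (2 * Real.log T) ^ 3 := pow_le_pow_left₀ ha0 ha2 3
  have hl3 : (1 : ℝ) ≤ Real.log T ^ 3 := one_le_pow₀ hlogT
  calc truncWeight T j * logPlus j ^ 3 ≤ truncWeight T j * (4 * a ^ 3 + 4 * u ^ 3) :=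
        mul_le_mul_of_nonneg_left h4 hψ0
    _ = 4 * a ^ 3 * truncWeight T j + 4 * (truncWeight T j * u ^ 3) := by ring
    _ ≤ 4 * a ^ 3 * 1 + 4 * 1 := by gcongr
    _ ≤ 4 * (2 * Real.log T) ^ 3 + 4 * Real.log T ^ 3 := by linarith
    _ ≤ 64 * Real.log T ^ 3 := by nlinarith

/-- `Σ_{1 ≤ i ≤ M} ψ_T(i)/log₊ ξ_i ≤ C · T` for `T ≥ 3` (`log₊ ξ_i ≫ log T` for `i ≥ √(T log T)`,
and `Σ ψ_T ≤ 2 T log T + 2`). [cite: RodgersTaoFMP2020, §7 p. 42 (66); Lemma 8 (i) p. 21] -/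
theorem exists_sum_truncWeight_div_logPlus_le :
    ∃ C : ℝ, 0 < C ∧ ∀ T : ℝ, 3 ≤ T → ∀ M : ℤ,
      ∑ i ∈ Finset.Icc 1 M, truncWeight T i / logPlus (classicalLocationZ i) ≤ C * T := by
  obtain ⟨c, hc, hc1, hcle⟩ := exists_mul_logPlus_le_logPlus_classicalLocationZ
  refine ⟨10 / c, by positivity, fun T hT M ↦ ?_⟩
  obtain ⟨hlogT, hN3, -⟩ := log_facts_of_three_le hT
  set N := T * Real.log T with hN
  have hT0 : 0 < T := by linarith
  have hN0 : 0 < N := by linarith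
  have hN1 : 1 ≤ N := by linarith
  have hl2 : (1 : ℝ) / 2 < Real.log 2 := by have := Real.log_two_gt_d9; linarith
  have hψ0 : ∀ i : ℤ, 0 ≤ truncWeight T i := fun i ↦ (truncWeight_pos hN0 i).le
  have hψ1 : ∀ i : ℤ, truncWeight T i ≤ 1 := fun i ↦ truncWeight_le_one hN0 i
  set f : ℤ → ℝ := fun i ↦ truncWeight T i / logPlus (classicalLocationZ i) with hf
  have hf0 : ∀ i, 0 ≤ f i := fun i ↦ div_nonneg (hψ0 i) (logPlus_nonneg _)
  have hsqrtN : Real.sqrt N ≤ T := by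
    have h1 : Real.log T ≤ T := by
      have := Real.log_le_sub_one_of_pos hT0; linarith
    have h2 : N ≤ T ^ 2 := by rw [hN]; nlinarith
    calc Real.sqrt N ≤ Real.sqrt (T ^ 2) := Real.sqrt_le_sqrt h2
      _ = T := Real.sqrt_sq hT0.le
  have hNT : T ≤ N := by rw [hN]; nlinarith
  rw [← Finset.sum_filter_add_sum_filter_not (Finset.Icc 1 M) (fun i : ℤ ↦ (i : ℝ) ^ 2 < N)]
  -- small indices: at most √N of them, each term ≤ 2/c
  have hsmall : ∑ i ∈ (Finset.Icc 1 M).filter (fun i : ℤ ↦ (i : ℝ) ^ 2 < N), f i ≤ 4 / c * T := by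
    have hb : ∀ i ∈ (Finset.Icc 1 M).filter (fun i : ℤ ↦ (i : ℝ) ^ 2 < N), f i ≤ 2 / c := by
      intro i hi
      rw [Finset.mem_filter, Finset.mem_Icc] at hi
      have hℓ : c * Real.log 2 ≤ logPlus (classicalLocationZ i) :=
        (mul_le_mul_of_nonneg_left (log_two_le_logPlus (i : ℝ)) hc.le).trans (hcle i (by omega))
      have hcl : 0 < c * Real.log 2 := by positivity
      calc f i ≤ 1 / (c * Real.log 2) := div_le_div₀ zero_le_one (hψ1 i) hcl hℓ
        _ ≤ 2 / c := by rw [div_le_div_iff₀ hcl hc]; nlinarith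
    have hsub : (Finset.Icc 1 M).filter (fun i : ℤ ↦ (i : ℝ) ^ 2 < N) ⊆
        Finset.Icc 1 ⌊Real.sqrt N⌋ := by
      intro i hi
      rw [Finset.mem_filter, Finset.mem_Icc] at hi
      rw [Finset.mem_Icc]
      refine ⟨hi.1.1, Int.le_floor.2 ?_⟩
      have hi0 : (0 : ℝ) ≤ (i : ℝ) := by exact_mod_cast (by omega : (0 : ℤ) ≤ i)
      calc (i : ℝ) = Real.sqrt ((i : ℝ) ^ 2) := (Real.sqrt_sq hi0).symm
        _ ≤ Real.sqrt N := Real.sqrt_le_sqrt hi.2.le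
    have hcard : (((Finset.Icc 1 M).filter (fun i : ℤ ↦ (i : ℝ) ^ 2 < N)).card : ℝ) ≤ T := by
      have h1 := Finset.card_le_card hsub
      rw [Int.card_Icc] at h1
      have h2 : (((⌊Real.sqrt N⌋ + 1 - 1).toNat : ℕ) : ℝ) ≤ Real.sqrt N := by
        rw [add_sub_cancel_right]
        have h3 : ((⌊Real.sqrt N⌋.toNat : ℕ) : ℤ) = ⌊Real.sqrt N⌋ :=
          Int.toNat_of_nonneg (Int.floor_nonneg.2 (Real.sqrt_nonneg N))
        have h4 : ((⌊Real.sqrt N⌋.toNat : ℕ) : ℝ) = ((⌊Real.sqrt N⌋ : ℤ) : ℝ) := by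
          exact_mod_cast h3
        rw [h4]; exact Int.floor_le _
      calc (((Finset.Icc 1 M).filter (fun i : ℤ ↦ (i : ℝ) ^ 2 < N)).card : ℝ)
          ≤ (((⌊Real.sqrt N⌋ + 1 - 1).toNat : ℕ) : ℝ) := by exact_mod_cast h1
        _ ≤ T := h2.trans hsqrtN
    calc ∑ i ∈ (Finset.Icc 1 M).filter (fun i : ℤ ↦ (i : ℝ) ^ 2 < N), f i
        ≤ ((Finset.Icc 1 M).filter (fun i : ℤ ↦ (i : ℝ) ^ 2 < N)).card • (2 / c) :=
          Finset.sum_le_card_nsmul _ _ _ hb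
      _ = (((Finset.Icc 1 M).filter (fun i : ℤ ↦ (i : ℝ) ^ 2 < N)).card : ℝ) * (2 / c) := by
          rw [nsmul_eq_mul]
      _ ≤ T * (2 / c) := mul_le_mul_of_nonneg_right hcard (by positivity)
      _ ≤ 4 / c * T := by
          rw [show 4 / c * T = T * (2 / c) + T * (2 / c) by ring]
          have : 0 ≤ T * (2 / c) := by positivity
          linarith
  -- large indices: log₊ ξ_i ≥ (c/2) log T
  have hlarge : ∑ i ∈ (Finset.Icc 1 M).filter (fun i : ℤ ↦ ¬((i : ℝ) ^ 2 < N)), f i ≤ 6 / c * T := by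
    have hlogT0 : 0 < Real.log T := by linarith
    have hb : ∀ i ∈ (Finset.Icc 1 M).filter (fun i : ℤ ↦ ¬((i : ℝ) ^ 2 < N)),
        f i ≤ 2 / (c * Real.log T) * truncWeight T i := by
      intro i hi
      rw [Finset.mem_filter, Finset.mem_Icc, not_lt] at hi
      have hi0 : (0 : ℝ) ≤ (i : ℝ) := by exact_mod_cast (by omega : (0 : ℤ) ≤ i)
      have hsi : Real.sqrt N ≤ (i : ℝ) := by
        calc Real.sqrt N ≤ Real.sqrt ((i : ℝ) ^ 2) := Real.sqrt_le_sqrt hi.2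
          _ = (i : ℝ) := Real.sqrt_sq hi0
      have hlam : Real.log T / 2 ≤ logPlus (i : ℝ) := by
        rw [logPlus_eq, abs_of_nonneg hi0]
        have h1 : Real.log (Real.sqrt N) = Real.log N / 2 := Real.log_sqrt hN0.le
        have h2 : Real.log T ≤ Real.log N := Real.log_le_log hT0 hNT
        calc Real.log T / 2 ≤ Real.log N / 2 := by linarith
          _ = Real.log (Real.sqrt N) := h1.symm
          _ ≤ Real.log (2 + (i : ℝ)) :=
              Real.log_le_log (Real.sqrt_pos.2 hN0) (by linarith)
      have hℓ : c * Real.log T / 2 ≤ logPlus (classicalLocationZ i) := by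
        have := hcle i (by omega)
        have := mul_le_mul_of_nonneg_left hlam hc.le
        linarith
      have hcl : 0 < c * Real.log T / 2 := by positivity
      calc f i = truncWeight T i / logPlus (classicalLocationZ i) := rfl
        _ ≤ truncWeight T i / (c * Real.log T / 2) :=
            div_le_div_of_nonneg_left (hψ0 i) hcl hℓ
        _ = 2 / (c * Real.log T) * truncWeight T i := by
            field_simp
    obtain ⟨hsψ, htψ⟩ := tsum_truncWeight_le hN1
    have hsumψ : ∑ i ∈ (Finset.Icc 1 M).filter (fun i : ℤ ↦ ¬((i : ℝ) ^ 2 < N)), truncWeight T i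
        ≤ 2 * N + 2 := by
      calc _ ≤ ∑ i ∈ Finset.Icc 1 M, truncWeight T i :=
            Finset.sum_le_sum_of_subset_of_nonneg (Finset.filter_subset _ _) fun i _ _ ↦ hψ0 i
        _ ≤ ∑' i : ℤ, truncWeight T i := hsψ.sum_le_tsum _ fun i _ ↦ hψ0 i
        _ ≤ 2 * N + 2 := htψ
    calc ∑ i ∈ (Finset.Icc 1 M).filter (fun i : ℤ ↦ ¬((i : ℝ) ^ 2 < N)), f i
        ≤ ∑ i ∈ (Finset.Icc 1 M).filter (fun i : ℤ ↦ ¬((i : ℝ) ^ 2 < N)),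
            2 / (c * Real.log T) * truncWeight T i := Finset.sum_le_sum hb
      _ = 2 / (c * Real.log T) *
            ∑ i ∈ (Finset.Icc 1 M).filter (fun i : ℤ ↦ ¬((i : ℝ) ^ 2 < N)), truncWeight T i := by
          rw [Finset.mul_sum]
      _ ≤ 2 / (c * Real.log T) * (2 * N + 2) :=
          mul_le_mul_of_nonneg_left hsumψ (by positivity)
      _ ≤ 2 / (c * Real.log T) * (3 * N) := by gcongr; linarith
      _ = 6 / c * T := by
          have hc0 : c ≠ 0 := hc.ne'
          have hl0 : Real.log T ≠ 0 := hlogT0.ne'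
          rw [hN]; field_simp; ring
  calc _ ≤ 4 / c * T + 6 / c * T := add_le_add hsmall hlarge
    _ = 10 / c * T := by ring

/-! ### §5 The consecutive-gap sum `Σ_i (x_{i+1} − x_i) ψ_T(i)² log₊³ i ≪ T log³ T` ((87)) -/

/-- **Monotone exchange** (Abel summation with a majorant): if `x ≤ X` termwise and `W ≥ 0` is
non-increasing, then `Σ_{n<M} (x_{n+1} − x_n) W_n ≤ Σ_{n<M} (X_{n+1} − X_n) W_n + (X_0 − x_0) W_0`.
[folklore] -/
private theorem sum_sub_mul_le_of_antitone (x X W : ℕ → ℝ) (M : ℕ) (hxX : ∀ n, x n ≤ X n)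
    (hW0 : ∀ n, 0 ≤ W n) (hW : ∀ n, W (n + 1) ≤ W n) :
    ∑ n ∈ Finset.range M, (x (n + 1) - x n) * W n ≤
      ∑ n ∈ Finset.range M, (X (n + 1) - X n) * W n + (X 0 - x 0) * W 0 := by
  set e : ℕ → ℝ := fun n ↦ X n - x n with he
  have he0 : ∀ n, 0 ≤ e n := fun n ↦ sub_nonneg.2 (hxX n)
  have hid : ∑ n ∈ Finset.range M, (x (n + 1) - x n) * W n =
      ∑ n ∈ Finset.range M, (X (n + 1) - X n) * W n -
        (∑ n ∈ Finset.range M, e (n + 1) * W n - ∑ n ∈ Finset.range M, e n * W n) := by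
    rw [← Finset.sum_sub_distrib, ← Finset.sum_sub_distrib]
    refine Finset.sum_congr rfl fun n _ ↦ ?_
    simp only [he]; ring
  have h1 : ∑ n ∈ Finset.range M, e (n + 1) * W (n + 1) ≤ ∑ n ∈ Finset.range M, e (n + 1) * W n :=
    Finset.sum_le_sum fun n _ ↦ mul_le_mul_of_nonneg_left (hW n) (he0 _)
  have h2 : ∑ n ∈ Finset.range M, e (n + 1) * W (n + 1) =
      ∑ n ∈ Finset.range (M + 1), e n * W n - e 0 * W 0 := by
    rw [Finset.sum_range_succ']; ring
  have h3 : ∑ n ∈ Finset.range M, e n * W n ≤ ∑ n ∈ Finset.range (M + 1), e n * W n := by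
    rw [Finset.sum_range_succ]
    have := mul_nonneg (he0 M) (hW0 M)
    linarith
  rw [hid]
  have e00 : (X 0 - x 0) * W 0 = e 0 * W 0 := rfl
  rw [e00]
  linarith

/-- `log₊ ξ_{i+1} − log₊ ξ_i ≤ (ξ_{i+1} − ξ_i)/2` for `i ≥ 0` (`log a − log b ≤ (a − b)/b`, `b ≥ 2`).
[folklore] -/
private theorem logPlus_classicalLocationZ_succ_sub_le {i : ℤ} (hi : 0 ≤ i) :
    logPlus (classicalLocationZ (i + 1)) - logPlus (classicalLocationZ i) ≤
      (classicalLocationZ (i + 1) - classicalLocationZ i) / 2 := by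
  have h0 : 0 ≤ classicalLocationZ i := by
    rcases hi.eq_or_lt with h | h
    · rw [← h, classicalLocationZ_zero]
    · exact (classicalLocationZ_pos h).le
  have h1 : 0 < classicalLocationZ (i + 1) := classicalLocationZ_pos (by omega)
  have hmono : classicalLocationZ i ≤ classicalLocationZ (i + 1) :=
    strictMono_classicalLocationZ.monotone (by omega)
  rw [logPlus_eq, logPlus_eq, abs_of_nonneg h0, abs_of_pos h1]
  have hb : (0 : ℝ) < 2 + classicalLocationZ i := by linarith
  rw [← Real.log_div (by linarith) hb.ne']
  have := Real.log_le_sub_one_of_pos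
    (show 0 < (2 + classicalLocationZ (i + 1)) / (2 + classicalLocationZ i) from
      div_pos (by linarith) hb)
  have e : (2 + classicalLocationZ (i + 1)) / (2 + classicalLocationZ i) - 1 =
      (classicalLocationZ (i + 1) - classicalLocationZ i) / (2 + classicalLocationZ i) := by
    rw [div_sub_one hb.ne']
    congr 1; ring
  rw [e] at this
  refine this.trans ?_
  exact div_le_div_of_nonneg_left (by linarith) (by norm_num) (by linarith)

/-- **The consecutive-gap sum** ((87) in the repaired form): under the location law (50) on
`[t₁, t₂]` above a real-rooted `t₀ < t₁` there is `C` with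
`Σ_{1 ≤ i ≤ M} (x_{i+1}(t) − x_i(t)) ψ_T(i)² log₊³ i ≤ C · T log³ T` for all `T ≥ 3`,
`t ∈ [t₁, t₂]`, `M` (monotone exchange against `X_i = ξ_i + B log₊ ξ_i ≥ x_i`, `ψ_T log₊³ ≪ log³ T`,
`X_{i+1} − X_i ≪ 1/log₊ ξ_i` by (44), `Σ ψ_T/log₊ ξ ≪ T`).
[cite: RodgersTaoFMP2020, Lemma 24 p. 55 (proof of (87), «telescoping series and (50)»)] -/
theorem exists_gap_weighted_sum_le {t₀ t₁ t₂ B : ℝ} (h01 : t₀ < t₁)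
    (hreal : HasOnlyRealZeros (deBruijnH t₀))
    (h50 : ∀ t ∈ Icc t₁ t₂, ∀ n : ℕ, 1 ≤ n →
      |deBruijnZero t n - classicalLocation (n : ℝ)| ≤ B * logPlus (classicalLocation (n : ℝ))) :
    ∃ C : ℝ, 0 < C ∧ ∀ T : ℝ, 3 ≤ T → ∀ t ∈ Icc t₁ t₂, ∀ M : ℤ,
      ∑ i ∈ Finset.Icc 1 M, (deBruijnZeroZ t (i + 1) - deBruijnZeroZ t i) *
          truncWeight T i ^ 2 * logPlus i ^ 3 ≤ C * (T * Real.log T ^ 3) := by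
  obtain ⟨C44, hC44, h44⟩ := exists_classicalLocationZ_succ_sub_le
  obtain ⟨Cψ, hCψ, hψℓ⟩ := exists_sum_truncWeight_div_logPlus_le
  set B' : ℝ := max B 0 with hB'
  have hB'0 : 0 ≤ B' := le_max_right _ _
  have hξ1 : 0 < classicalLocationZ 1 := classicalLocationZ_pos one_pos
  set K₀ : ℝ := (1 + B' / 2) * C44 * Cψ + classicalLocationZ 1 + B' * logPlus (classicalLocationZ 1)
    with hK₀
  have hK₀0 : 0 < K₀ := by
    have : 0 ≤ B' * logPlus (classicalLocationZ 1) := mul_nonneg hB'0 (logPlus_nonneg _)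
    positivity
  refine ⟨64 * K₀, by positivity, fun T hT t ht M ↦ ?_⟩
  obtain ⟨hlogT, hN3, -⟩ := log_facts_of_three_le hT
  have hT0 : 0 < T := by linarith
  have hN0 : 0 < T * Real.log T := by linarith
  have hΛ : ∃ t' : ℝ, t' < t ∧ HasOnlyRealZeros (deBruijnH t') := ⟨t₀, by linarith [ht.1], hreal⟩
  have hmx := strictMono_deBruijnZeroZ hΛ
  have hmξ := strictMono_classicalLocationZ
  have hloc : ∀ j : ℤ, |deBruijnZeroZ t j - classicalLocationZ j| ≤
      B' * logPlus (classicalLocationZ j) :=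
    fun j ↦ abs_deBruijnZeroZ_sub_classicalLocationZ_le (h50 t ht) j
  have hψ0 : ∀ i : ℤ, 0 ≤ truncWeight T i := fun i ↦ (truncWeight_pos hN0 i).le
  have hψ1 : ∀ i : ℤ, truncWeight T i ≤ 1 := fun i ↦ truncWeight_le_one hN0 i
  set g : ℤ → ℝ := fun i ↦ deBruijnZeroZ t (i + 1) - deBruijnZeroZ t i with hg
  have hg0 : ∀ i, 0 ≤ g i := fun i ↦ (sub_pos.2 (hmx (by omega))).le
  -- Step A: ψ log₊³ ≤ 64 log³ T
  have hA : ∑ i ∈ Finset.Icc 1 M, g i * truncWeight T i ^ 2 * logPlus i ^ 3 ≤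
      64 * Real.log T ^ 3 * ∑ i ∈ Finset.Icc 1 M, g i * truncWeight T i := by
    rw [Finset.mul_sum]
    refine Finset.sum_le_sum fun i _ ↦ ?_
    have := truncWeight_mul_logPlus_cube_le hT i
    calc g i * truncWeight T i ^ 2 * logPlus i ^ 3 =
        (g i * truncWeight T i) * (truncWeight T i * logPlus i ^ 3) := by ring
      _ ≤ (g i * truncWeight T i) * (64 * Real.log T ^ 3) :=
          mul_le_mul_of_nonneg_left this (mul_nonneg (hg0 i) (hψ0 i))
      _ = 64 * Real.log T ^ 3 * (g i * truncWeight T i) := by ring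
  -- Step B: the monotone exchange, in ℕ-indexing
  have hB : ∑ i ∈ Finset.Icc 1 M, g i * truncWeight T i ≤ K₀ * T := by
    rcases lt_or_ge M 1 with hM | hM
    · rw [Finset.Icc_eq_empty (by omega), Finset.sum_empty]; positivity
    set Mn : ℕ := M.toNat with hMn
    have hMcast : (Mn : ℤ) = M := Int.toNat_of_nonneg (by omega)
    have hIcc : Finset.Icc (1 : ℤ) M = (Finset.range Mn).map
        (Nat.castEmbedding.trans (addLeftEmbedding 1)) := by
      rw [Int.Icc_eq_finset_map]
      congr 2
      omega
    set xs : ℕ → ℝ := fun n ↦ deBruijnZeroZ t (1 + n) with hxs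
    set Xs : ℕ → ℝ := fun n ↦ classicalLocationZ (1 + n) + B' * logPlus (classicalLocationZ (1 + n))
      with hXs
    set Ws : ℕ → ℝ := fun n ↦ truncWeight T (1 + n) with hWs
    have hsum_eq : ∑ i ∈ Finset.Icc 1 M, g i * truncWeight T i =
        ∑ n ∈ Finset.range Mn, (xs (n + 1) - xs n) * Ws n := by
      rw [hIcc, Finset.sum_map]
      refine Finset.sum_congr rfl fun n _ ↦ ?_
      simp only [hg, hxs, hWs, Function.Embedding.trans_apply, Nat.castEmbedding_apply,
        addLeftEmbedding_apply]
      push_cast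
      ring_nf
    have hxX : ∀ n, xs n ≤ Xs n := by
      intro n
      simp only [hxs, hXs]
      have := hloc (1 + n)
      have := (abs_le.1 this).2
      linarith
    have hW0 : ∀ n, 0 ≤ Ws n := fun n ↦ hψ0 _
    have hWanti : ∀ n, Ws (n + 1) ≤ Ws n := by
      intro n
      simp only [hWs]
      refine truncWeight_le_truncWeight_of_abs_le hN0 ?_
      push_cast
      rw [abs_of_nonneg (by positivity), abs_of_nonneg (by positivity)]
      linarith
    have hex := sum_sub_mul_le_of_antitone xs Xs Ws Mn hxX hW0 hWanti
    -- the majorant differences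
    have hXdiff : ∀ n : ℕ, (Xs (n + 1) - Xs n) * Ws n ≤
        (1 + B' / 2) * C44 * (truncWeight T (1 + n) / logPlus (classicalLocationZ (1 + n))) := by
      intro n
      have hi1 : (1 : ℤ) ≤ 1 + n := by omega
      have hd := h44 (1 + n) hi1
      have hℓd := logPlus_classicalLocationZ_succ_sub_le (i := 1 + n) (by omega)
      have hd0 : 0 ≤ classicalLocationZ (1 + n + 1) - classicalLocationZ (1 + n) :=
        (sub_pos.2 (hmξ (by omega))).le
      have hℓ0 : 0 < logPlus (classicalLocationZ (1 + n)) := logPlus_pos _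
      have e1 : Xs (n + 1) - Xs n = (classicalLocationZ (1 + n + 1) - classicalLocationZ (1 + n)) +
          B' * (logPlus (classicalLocationZ (1 + n + 1)) - logPlus (classicalLocationZ (1 + n))) := by
        simp only [hXs]; push_cast; ring
      have h2 : Xs (n + 1) - Xs n ≤ (1 + B' / 2) * (C44 / logPlus (classicalLocationZ (1 + n))) := by
        rw [e1]
        calc _ ≤ (classicalLocationZ (1 + n + 1) - classicalLocationZ (1 + n)) +
              B' * ((classicalLocationZ (1 + n + 1) - classicalLocationZ (1 + n)) / 2) := by
              gcongr
          _ = (1 + B' / 2) * (classicalLocationZ (1 + n + 1) - classicalLocationZ (1 + n)) := by ring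
          _ ≤ (1 + B' / 2) * (C44 / logPlus (classicalLocationZ (1 + n))) :=
              mul_le_mul_of_nonneg_left hd (by positivity)
      calc (Xs (n + 1) - Xs n) * Ws n ≤ (1 + B' / 2) * (C44 / logPlus (classicalLocationZ (1 + n))) *
            truncWeight T (1 + n) := mul_le_mul_of_nonneg_right h2 (hψ0 _)
        _ = _ := by ring
    have hbdry : (Xs 0 - xs 0) * Ws 0 ≤ classicalLocationZ 1 + B' * logPlus (classicalLocationZ 1) := by
      simp only [hXs, hxs, hWs, Nat.cast_zero, add_zero]
      have hx1 : 0 < deBruijnZeroZ t 1 := by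
        have := hmx (show (0 : ℤ) < 1 by norm_num)
        rwa [deBruijnZeroZ_zero] at this
      have h1 : classicalLocationZ 1 + B' * logPlus (classicalLocationZ 1) - deBruijnZeroZ t 1 ≤
          classicalLocationZ 1 + B' * logPlus (classicalLocationZ 1) := by linarith
      have h2 : 0 ≤ classicalLocationZ 1 + B' * logPlus (classicalLocationZ 1) - deBruijnZeroZ t 1 := by
        have := hxX 0
        simp only [hxs, hXs, Nat.cast_zero, add_zero] at this
        linarith
      calc _ ≤ (classicalLocationZ 1 + B' * logPlus (classicalLocationZ 1)) * 1 :=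
            mul_le_mul h1 (hψ1 1) (hψ0 1) (by
              have : 0 ≤ B' * logPlus (classicalLocationZ 1) := mul_nonneg hB'0 (logPlus_nonneg _)
              linarith)
        _ = _ := mul_one _
    have hmaj : ∑ n ∈ Finset.range Mn, (Xs (n + 1) - Xs n) * Ws n ≤ (1 + B' / 2) * C44 * (Cψ * T) := by
      calc _ ≤ ∑ n ∈ Finset.range Mn, (1 + B' / 2) * C44 *
            (truncWeight T (1 + n) / logPlus (classicalLocationZ (1 + n))) := Finset.sum_le_sum fun n _ ↦ hXdiff n
        _ = (1 + B' / 2) * C44 * ∑ i ∈ Finset.Icc 1 M,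
            truncWeight T i / logPlus (classicalLocationZ i) := by
            rw [Finset.mul_sum, hIcc, Finset.sum_map]
            refine Finset.sum_congr rfl fun n _ ↦ ?_
            simp only [Function.Embedding.trans_apply, Nat.castEmbedding_apply, addLeftEmbedding_apply]
        _ ≤ (1 + B' / 2) * C44 * (Cψ * T) :=
            mul_le_mul_of_nonneg_left (hψℓ T hT M) (by positivity)
    have hT1 : (1 : ℝ) ≤ T := by linarith
    calc ∑ i ∈ Finset.Icc 1 M, g i * truncWeight T i
        = ∑ n ∈ Finset.range Mn, (xs (n + 1) - xs n) * Ws n := hsum_eq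
      _ ≤ (1 + B' / 2) * C44 * (Cψ * T) + (classicalLocationZ 1 + B' * logPlus (classicalLocationZ 1)) :=
          hex.trans (add_le_add hmaj hbdry)
      _ ≤ (1 + B' / 2) * C44 * (Cψ * T) + (classicalLocationZ 1 + B' * logPlus (classicalLocationZ 1)) * T := by
          have h0 : 0 ≤ classicalLocationZ 1 + B' * logPlus (classicalLocationZ 1) := by
            have : 0 ≤ B' * logPlus (classicalLocationZ 1) := mul_nonneg hB'0 (logPlus_nonneg _)
            linarith
          nlinarith
      _ = K₀ * T := by rw [hK₀]; ring
  have hl3 : 0 ≤ Real.log T ^ 3 := by positivity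
  calc _ ≤ 64 * Real.log T ^ 3 * ∑ i ∈ Finset.Icc 1 M, g i * truncWeight T i := hA
    _ ≤ 64 * Real.log T ^ 3 * (K₀ * T) := mul_le_mul_of_nonneg_left hB (by positivity)
    _ = 64 * K₀ * (T * Real.log T ^ 3) := by ring


/-! ### §6 The far part of the nearby sum: rows from Lemma 20 -/

/-- Tail of `Σ 1/h²` over integers: if `A ≤ |h|` on a finite `H ⊂ ℤ` (`A > 0`) then
`Σ_{h∈H} 1/h² ≤ 4/A`. [folklore] -/
private theorem sum_inv_sq_le_of_le_abs {A : ℝ} (hA : 0 < A) (H : Finset ℤ)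
    (hH : ∀ h ∈ H, A ≤ |(h : ℝ)|) : ∑ h ∈ H, 1 / ((h : ℝ)) ^ 2 ≤ 4 / A := by
  classical
  set a : ℕ := ⌈A⌉₊ with ha
  have ha1 : 1 ≤ a := Nat.ceil_pos.2 hA
  have haA : A ≤ a := Nat.le_ceil A
  have ha0 : (0 : ℝ) < a := by exact_mod_cast ha1
  have hcast : ∀ h : ℤ, ((h.natAbs : ℕ) : ℝ) = |(h : ℝ)| := by
    intro h
    rw [← Int.cast_natCast, Int.natCast_natAbs, Int.cast_abs]
  have hnat : ∀ h ∈ H, a ≤ h.natAbs := by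
    intro h hh
    have := hH h hh
    rw [← hcast] at this
    rw [ha, Nat.ceil_le]
    exact this
  set g : ℕ → ℝ := fun n ↦ 1 / ((n : ℝ)) ^ 2 with hg
  have hg0 : ∀ n, 0 ≤ g n := fun n ↦ by positivity
  have hterm : ∀ h ∈ H, 1 / ((h : ℝ)) ^ 2 = g h.natAbs := by
    intro h _
    simp only [hg]
    rw [hcast, sq_abs]
  rw [Finset.sum_congr rfl hterm]
  have hmaps : ∀ h ∈ H, h.natAbs ∈ H.image Int.natAbs := fun h hh ↦ Finset.mem_image_of_mem _ hh
  rw [← Finset.sum_fiberwise_of_maps_to hmaps]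
  have hfib : ∀ n ∈ H.image Int.natAbs, ∑ h ∈ H with h.natAbs = n, g h.natAbs ≤ 2 * g n := by
    intro n _
    have hval : ∀ h ∈ H.filter (fun h ↦ h.natAbs = n), g h.natAbs = g n := by
      intro h hh; rw [(Finset.mem_filter.1 hh).2]
    rw [Finset.sum_congr rfl hval, Finset.sum_const, nsmul_eq_mul]
    have hsub : H.filter (fun h ↦ h.natAbs = n) ⊆ ({(n : ℤ), -(n : ℤ)} : Finset ℤ) := by
      intro h hh
      rw [Finset.mem_filter] at hh
      rw [Finset.mem_insert, Finset.mem_singleton]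
      rcases Int.natAbs_eq h with h1 | h1
      · left; rw [h1, hh.2]
      · right; rw [h1, hh.2]
    have hcard : ((H.filter (fun h ↦ h.natAbs = n)).card : ℝ) ≤ 2 := by
      have := (Finset.card_le_card hsub).trans (Finset.card_le_two)
      exact_mod_cast this
    exact mul_le_mul_of_nonneg_right hcard (hg0 n)
  set N : ℕ := (H.image Int.natAbs).sup id + 1 with hN
  have hsubI : H.image Int.natAbs ⊆ Finset.Ioo (a - 1) N := by
    intro n hn
    rw [Finset.mem_Ioo]
    obtain ⟨h, hh, rfl⟩ := Finset.mem_image.1 hn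
    constructor
    · have := hnat h hh; omega
    · have : h.natAbs ≤ (H.image Int.natAbs).sup id :=
        Finset.le_sup (f := id) (Finset.mem_image_of_mem _ hh)
      omega
  have hIoo := sum_Ioo_inv_sq_le (α := ℝ) (a - 1) N
  have ecast : ((a - 1 : ℕ) : ℝ) + 1 = a := by
    rw [Nat.cast_sub ha1, Nat.cast_one]; ring
  rw [ecast] at hIoo
  calc ∑ n ∈ H.image Int.natAbs, ∑ h ∈ H with h.natAbs = n, g h.natAbs
      ≤ ∑ n ∈ H.image Int.natAbs, 2 * g n := Finset.sum_le_sum hfib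
    _ = 2 * ∑ n ∈ H.image Int.natAbs, g n := by rw [Finset.mul_sum]
    _ ≤ 2 * ∑ n ∈ Finset.Ioo (a - 1) N, g n := by
        refine mul_le_mul_of_nonneg_left ?_ (by norm_num)
        exact Finset.sum_le_sum_of_subset_of_nonneg hsubI fun n _ _ ↦ hg0 n
    _ = 2 * ∑ n ∈ Finset.Ioo (a - 1) N, ((n : ℝ) ^ 2)⁻¹ := by
        simp only [hg, one_div]
    _ ≤ 2 * (2 / a) := mul_le_mul_of_nonneg_left hIoo (by norm_num)
    _ = 4 / a := by ring
    _ ≤ 4 / A := div_le_div_of_nonneg_left (by norm_num) hA haA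

/-- **One row of the far part.** For `j ∈ ℤ*`, `t` with ordered zeros, the two clauses of
Lemma 20 at `j` (far and middle field, constant `C`, rate `ε_j > 0`), a bound `Λ ≥ log₊ j` for
`log₊(|j|+|k|)` over the relevant `k`, and `e = min(ε_j, 1)`:
`Σ_{k ∈ K : j ∼_T k, |k−j| ≥ e log₊² ξ_j} ψ_T(j)ψ_T(k) H̃_{jk} ≤ ψ_T(j) · 8 C e Λ⁴/log₊² ξ_j`
(far field `Σ_{|h| ≥ e⁻¹ℓ²} Λ⁴/h² ≤ 4eΛ⁴/ℓ²`, middle field `Σ_{|h| ≥ eℓ²} e²Λ⁴/h² ≤ 4eΛ⁴/ℓ²`).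
[cite: RodgersTaoFMP2020, Lemma 24 p. 55 (proof: «From Lemma 20 we see that
Σ_{k: j∼_T k, |k−j| ≥ ε(j) log²₊ ξ_j} H̃_jk ≪ ε(j) log²₊ j»)] -/
theorem far_row_sum_le {T t : ℝ} (hT : 0 < T * Real.log T)
    (hmono : StrictMono (deBruijnZeroZ t)) {C εj Λ : ℝ} (hC : 0 ≤ C) (hε : 0 < εj) (j : ℤ)
    (hΛj : logPlus (j : ℝ) ≤ Λ)
    (hΛ : ∀ k : ℤ, Nearby T j k → logPlus (|(j : ℝ)| + |(k : ℝ)|) ≤ Λ)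
    (hdec : ∀ k : ℤ, k ≠ 0 → k ≠ j →
      ((εj)⁻¹ * logPlus (classicalLocationZ j) ^ 2 ≤ |(k : ℝ) - j| →
        renormHamiltonianZ t j k ≤ C * logPlus (|(j : ℝ)| + |(k : ℝ)|) ^ 4 / ((k : ℝ) - j) ^ 2) ∧
      (εj * logPlus (classicalLocationZ j) ^ 2 ≤ |(k : ℝ) - j| →
        |(k : ℝ) - j| ≤ (εj)⁻¹ * logPlus (classicalLocationZ j) ^ 2 →
        renormHamiltonianZ t j k ≤ C * εj ^ 2 * logPlus (j : ℝ) ^ 4 / ((k : ℝ) - j) ^ 2))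
    {S : Set (ℤ × ℤ)} (hS : ∀ k : ℤ, (j, k) ∈ S → k ≠ 0 ∧ Nearby T j k ∧
      min εj 1 * logPlus (classicalLocationZ j) ^ 2 ≤ |(k : ℝ) - j|)
    (K : Finset ℤ) :
    ∑ k ∈ K, S.indicator (fun q : ℤ × ℤ ↦
        truncWeight T q.1 * truncWeight T q.2 * renormHamiltonianZ t q.1 q.2) (j, k) ≤
      truncWeight T j * (8 * C * min εj 1 * Λ ^ 4 / logPlus (classicalLocationZ j) ^ 2) := by
  classical
  set e : ℝ := min εj 1 with he
  set ℓ : ℝ := logPlus (classicalLocationZ j) with hℓ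
  have he0 : 0 < e := lt_min hε one_pos
  have he1 : e ≤ 1 := min_le_right _ _
  have heε : e ≤ εj := min_le_left _ _
  have hℓ0 : 0 < ℓ := logPlus_pos _
  have hΛ0 : 0 ≤ Λ := (logPlus_nonneg _).trans hΛj
  have hψ0 : ∀ i : ℤ, 0 ≤ truncWeight T i := fun i ↦ (truncWeight_pos hT i).le
  have hψ1 : ∀ i : ℤ, truncWeight T i ≤ 1 := fun i ↦ truncWeight_le_one hT i
  have hind : ∀ k ∈ K, S.indicator (fun q : ℤ × ℤ ↦
      truncWeight T q.1 * truncWeight T q.2 * renormHamiltonianZ t q.1 q.2) (j, k) =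
      if (j, k) ∈ S then truncWeight T j * truncWeight T k * renormHamiltonianZ t j k else 0 :=
    fun k _ ↦ Set.indicator_apply _ _ _
  rw [Finset.sum_congr rfl hind, ← Finset.sum_filter]
  set KP := K.filter (fun k ↦ (j, k) ∈ S) with hKP
  have hKPmem : ∀ k ∈ KP, k ≠ 0 ∧ Nearby T j k ∧ e * ℓ ^ 2 ≤ |(k : ℝ) - j| :=
    fun k hk ↦ hS k (Finset.mem_filter.1 hk).2
  rw [← Finset.sum_filter_add_sum_filter_not KP (fun k : ℤ ↦ e⁻¹ * ℓ ^ 2 ≤ |(k : ℝ) - j|)]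
  -- the far field
  have hfar : ∑ k ∈ KP.filter (fun k : ℤ ↦ e⁻¹ * ℓ ^ 2 ≤ |(k : ℝ) - j|),
      truncWeight T j * truncWeight T k * renormHamiltonianZ t j k ≤
      truncWeight T j * (C * Λ ^ 4) * (4 / (e⁻¹ * ℓ ^ 2)) := by
    have hpt : ∀ k ∈ KP.filter (fun k : ℤ ↦ e⁻¹ * ℓ ^ 2 ≤ |(k : ℝ) - j|),
        truncWeight T j * truncWeight T k * renormHamiltonianZ t j k ≤
        truncWeight T j * (C * Λ ^ 4) * (1 / ((k : ℝ) - j) ^ 2) := by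
      intro k hk
      rw [Finset.mem_filter] at hk
      obtain ⟨hk0, hnb, -⟩ := hKPmem k hk.1
      have hkj : k ≠ j := hnb.1.symm
      have hfarcl := (hdec k hk0 hkj).1 (le_trans (by
        refine mul_le_mul_of_nonneg_right ?_ (sq_nonneg _)
        exact inv_anti₀ he0 heε) hk.2)
      have hH0 : 0 ≤ renormHamiltonianZ t j k := renormHamiltonianZ_nonneg_of_strictMono hmono hkj.symm
      have hH : renormHamiltonianZ t j k ≤ C * Λ ^ 4 * (1 / ((k : ℝ) - j) ^ 2) := by
        refine hfarcl.trans ?_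
        rw [mul_one_div]
        exact div_le_div_of_nonneg_right
          (mul_le_mul_of_nonneg_left (pow_le_pow_left₀ (logPlus_nonneg _) (hΛ k hnb) 4) hC)
          (sq_nonneg _)
      calc truncWeight T j * truncWeight T k * renormHamiltonianZ t j k
          ≤ truncWeight T j * 1 * (C * Λ ^ 4 * (1 / ((k : ℝ) - j) ^ 2)) :=
            mul_le_mul (mul_le_mul_of_nonneg_left (hψ1 k) (hψ0 j)) hH hH0
              (mul_nonneg (hψ0 j) zero_le_one)
        _ = _ := by ring
    have htail := sum_inv_sq_le_of_le_abs (A := e⁻¹ * ℓ ^ 2) (by positivity)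
      ((KP.filter (fun k : ℤ ↦ e⁻¹ * ℓ ^ 2 ≤ |(k : ℝ) - j|)).image (fun k ↦ k - j)) (by
        intro h hh
        obtain ⟨k, hk, rfl⟩ := Finset.mem_image.1 hh
        rw [Finset.mem_filter] at hk
        push_cast; exact hk.2)
    rw [Finset.sum_image (fun a _ b _ hab ↦ by simpa using hab)] at htail
    push_cast at htail
    calc _ ≤ ∑ k ∈ KP.filter (fun k : ℤ ↦ e⁻¹ * ℓ ^ 2 ≤ |(k : ℝ) - j|),
          truncWeight T j * (C * Λ ^ 4) * (1 / ((k : ℝ) - j) ^ 2) := Finset.sum_le_sum hpt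
      _ = truncWeight T j * (C * Λ ^ 4) *
          ∑ k ∈ KP.filter (fun k : ℤ ↦ e⁻¹ * ℓ ^ 2 ≤ |(k : ℝ) - j|), 1 / ((k : ℝ) - j) ^ 2 := by
          rw [Finset.mul_sum]
      _ ≤ truncWeight T j * (C * Λ ^ 4) * (4 / (e⁻¹ * ℓ ^ 2)) :=
          mul_le_mul_of_nonneg_left htail (mul_nonneg (hψ0 j) (by positivity))
  -- the middle field
  have hmid : ∑ k ∈ KP.filter (fun k : ℤ ↦ ¬(e⁻¹ * ℓ ^ 2 ≤ |(k : ℝ) - j|)),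
      truncWeight T j * truncWeight T k * renormHamiltonianZ t j k ≤
      truncWeight T j * (C * e ^ 2 * Λ ^ 4) * (4 / (e * ℓ ^ 2)) := by
    have hpt : ∀ k ∈ KP.filter (fun k : ℤ ↦ ¬(e⁻¹ * ℓ ^ 2 ≤ |(k : ℝ) - j|)),
        truncWeight T j * truncWeight T k * renormHamiltonianZ t j k ≤
        truncWeight T j * (C * e ^ 2 * Λ ^ 4) * (1 / ((k : ℝ) - j) ^ 2) := by
      intro k hk
      rw [Finset.mem_filter, not_le] at hk
      obtain ⟨hk0, hnb, hel⟩ := hKPmem k hk.1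
      have hkj : k ≠ j := hnb.1.symm
      have hH0 : 0 ≤ renormHamiltonianZ t j k := renormHamiltonianZ_nonneg_of_strictMono hmono hkj.symm
      -- if εj > 1 the region is empty
      rcases le_or_gt εj 1 with hε1 | hε1
      · have hee : e = εj := min_eq_left hε1
        rw [hee] at hel hk
        have hmidcl := (hdec k hk0 hkj).2 hel hk.2.le
        have hH : renormHamiltonianZ t j k ≤ C * e ^ 2 * Λ ^ 4 * (1 / ((k : ℝ) - j) ^ 2) := by
          refine hmidcl.trans ?_
          rw [mul_one_div, hee]
          exact div_le_div_of_nonneg_right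
            (mul_le_mul_of_nonneg_left (pow_le_pow_left₀ (logPlus_nonneg _) hΛj 4)
              (by positivity)) (sq_nonneg _)
        calc truncWeight T j * truncWeight T k * renormHamiltonianZ t j k
            ≤ truncWeight T j * 1 * (C * e ^ 2 * Λ ^ 4 * (1 / ((k : ℝ) - j) ^ 2)) :=
              mul_le_mul (mul_le_mul_of_nonneg_left (hψ1 k) (hψ0 j)) hH hH0
                (mul_nonneg (hψ0 j) zero_le_one)
          _ = _ := by ring
      · exfalso
        have hee : e = 1 := min_eq_right hε1.le
        have h1 := hk.2
        simp only [hee, inv_one, one_mul] at h1 hel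
        linarith
    have htail := sum_inv_sq_le_of_le_abs (A := e * ℓ ^ 2) (by positivity)
      ((KP.filter (fun k : ℤ ↦ ¬(e⁻¹ * ℓ ^ 2 ≤ |(k : ℝ) - j|))).image (fun k ↦ k - j)) (by
        intro h hh
        obtain ⟨k, hk, rfl⟩ := Finset.mem_image.1 hh
        rw [Finset.mem_filter] at hk
        push_cast; exact (hKPmem k hk.1).2.2)
    rw [Finset.sum_image (fun a _ b _ hab ↦ by simpa using hab)] at htail
    push_cast at htail
    calc _ ≤ ∑ k ∈ KP.filter (fun k : ℤ ↦ ¬(e⁻¹ * ℓ ^ 2 ≤ |(k : ℝ) - j|)),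
          truncWeight T j * (C * e ^ 2 * Λ ^ 4) * (1 / ((k : ℝ) - j) ^ 2) := Finset.sum_le_sum hpt
      _ = truncWeight T j * (C * e ^ 2 * Λ ^ 4) *
          ∑ k ∈ KP.filter (fun k : ℤ ↦ ¬(e⁻¹ * ℓ ^ 2 ≤ |(k : ℝ) - j|)), 1 / ((k : ℝ) - j) ^ 2 := by
          rw [Finset.mul_sum]
      _ ≤ truncWeight T j * (C * e ^ 2 * Λ ^ 4) * (4 / (e * ℓ ^ 2)) :=
          mul_le_mul_of_nonneg_left htail (mul_nonneg (hψ0 j) (by positivity))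
  have he0' : e ≠ 0 := he0.ne'
  have hℓ0' : ℓ ≠ 0 := hℓ0.ne'
  calc _ ≤ truncWeight T j * (C * Λ ^ 4) * (4 / (e⁻¹ * ℓ ^ 2)) +
        truncWeight T j * (C * e ^ 2 * Λ ^ 4) * (4 / (e * ℓ ^ 2)) := add_le_add hfar hmid
    _ = truncWeight T j * (8 * C * e * Λ ^ 4 / ℓ ^ 2) := by
        field_simp
        ring

/-- Rows to pairs: if every row of a non-negative `F` on `ℤ²` has partial sums `≤ R(j)`, then
`Σ_{q∈s} F(q) ≤ Σ_{j ∈ fst(s)} R(j)` for every finite `s`. [folklore] -/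
private theorem sum_pairs_le_of_rows {F : ℤ × ℤ → ℝ} (hF : ∀ q, 0 ≤ F q) {R : ℤ → ℝ}
    (hrow : ∀ j : ℤ, ∀ K : Finset ℤ, ∑ k ∈ K, F (j, k) ≤ R j) (s : Finset (ℤ × ℤ)) :
    ∑ q ∈ s, F q ≤ ∑ j ∈ s.image Prod.fst, R j := by
  classical
  calc ∑ q ∈ s, F q ≤ ∑ q ∈ s.image Prod.fst ×ˢ s.image Prod.snd, F q :=
        Finset.sum_le_sum_of_subset_of_nonneg Finset.subset_product fun q _ _ ↦ hF q
    _ = ∑ j ∈ s.image Prod.fst, ∑ k ∈ s.image Prod.snd, F (j, k) := Finset.sum_product _ _ _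
    _ ≤ ∑ j ∈ s.image Prod.fst, R j := Finset.sum_le_sum fun j _ ↦ hrow j _

/-- For nearby `k`: `log₊(|j| + |k|) ≤ log₊(2T² + 6|j| + 2)` (`T ≥ 1`; `|k − j| < (2(T²+2|j|))^{1/10} + 2
≤ 2T² + 4|j| + 2`). [cite: RodgersTaoFMP2020, §1.2 p. 7 (definition of ∼_T)] -/
theorem logPlus_add_le_of_nearby {T : ℝ} (hT : 1 ≤ T) {j k : ℤ} (h : Nearby T j k) :
    logPlus (|(j : ℝ)| + |(k : ℝ)|) ≤ logPlus (2 * T ^ 2 + 6 * |(j : ℝ)| + 2) := by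
  have hR := h.abs_sub_lt_radius
  have hy : (1 : ℝ) ≤ 2 * (T ^ 2 + 2 * |(j : ℝ)|) := by nlinarith [abs_nonneg (j : ℝ)]
  have hpow : (2 * (T ^ 2 + 2 * |(j : ℝ)|)) ^ (1 / 10 : ℝ) ≤ 2 * (T ^ 2 + 2 * |(j : ℝ)|) := by
    calc _ ≤ (2 * (T ^ 2 + 2 * |(j : ℝ)|)) ^ (1 : ℝ) :=
          Real.rpow_le_rpow_of_exponent_le hy (by norm_num)
      _ = _ := Real.rpow_one _
  have hk : |(k : ℝ)| ≤ |(j : ℝ)| + |(k : ℝ) - j| := by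
    have := abs_sub_abs_le_abs_sub (k : ℝ) j; linarith
  refine logPlus_mono ?_
  rw [abs_of_nonneg (by positivity : (0 : ℝ) ≤ |(j : ℝ)| + |(k : ℝ)|),
    abs_of_nonneg (by positivity : (0 : ℝ) ≤ 2 * T ^ 2 + 6 * |(j : ℝ)| + 2)]
  linarith

/-- `log₊ j ≤ log₊(2T² + 6|j| + 2)`. [folklore] -/
private theorem logPlus_le_logPlus_rad (T : ℝ) (j : ℤ) :
    logPlus (j : ℝ) ≤ logPlus (2 * T ^ 2 + 6 * |(j : ℝ)| + 2) := by
  refine logPlus_mono ?_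
  rw [abs_of_nonneg (by positivity : (0 : ℝ) ≤ 2 * T ^ 2 + 6 * |(j : ℝ)| + 2)]
  nlinarith [abs_nonneg (j : ℝ), sq_nonneg T]

/-- For `j² ≥ T ≥ 1`: `log₊(2T² + 6|j| + 2) ≤ 7 log₊ j`. [folklore] -/
private theorem logPlus_rad_le_of_sq_ge {T : ℝ} (hT : 1 ≤ T) {j : ℤ} (hj : T ≤ (j : ℝ) ^ 2) :
    logPlus (2 * T ^ 2 + 6 * |(j : ℝ)| + 2) ≤ 7 * logPlus (j : ℝ) := by
  set u := |(j : ℝ)| with hu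
  have hu0 : 0 ≤ u := abs_nonneg _
  have hT2 : T ^ 2 ≤ u ^ 4 := by
    have hj' : T ≤ u ^ 2 := by rwa [hu, sq_abs]
    calc T ^ 2 ≤ (u ^ 2) ^ 2 := pow_le_pow_left₀ (by linarith) hj' 2
      _ = u ^ 4 := by ring
  rw [logPlus_eq, logPlus_eq, abs_of_nonneg (by positivity)]
  have e7 : 7 * Real.log (2 + u) = Real.log ((2 + u) ^ 7) := by rw [Real.log_pow]; norm_num
  rw [e7]
  refine Real.log_le_log (by positivity) ?_
  have h4 : u ^ 4 ≤ (2 + u) ^ 4 := pow_le_pow_left₀ hu0 (by linarith) 4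
  have h4' : 16 + 32 * u ≤ (2 + u) ^ 4 := by nlinarith [sq_nonneg u, mul_nonneg hu0 (sq_nonneg u)]
  have h3 : (8 : ℝ) ≤ (2 + u) ^ 3 := by nlinarith [sq_nonneg u, mul_nonneg hu0 (sq_nonneg u)]
  calc 2 + (2 * T ^ 2 + 6 * u + 2) ≤ 8 * (2 + u) ^ 4 := by nlinarith
    _ ≤ (2 + u) ^ 3 * (2 + u) ^ 4 := mul_le_mul_of_nonneg_right h3 (by positivity)
    _ = (2 + u) ^ 7 := by ring

/-- For `|j| ≤ T`, `T ≥ 3`: `log₊(2T² + 6|j| + 2) ≤ 5 log T`. [folklore] -/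
private theorem logPlus_rad_le_of_abs_le {T : ℝ} (hT : 3 ≤ T) {j : ℤ} (hj : |(j : ℝ)| ≤ T) :
    logPlus (2 * T ^ 2 + 6 * |(j : ℝ)| + 2) ≤ 5 * Real.log T := by
  have hT0 : 0 < T := by linarith
  rw [logPlus_eq, abs_of_nonneg (by positivity)]
  have e5 : 5 * Real.log T = Real.log (T ^ 5) := by rw [Real.log_pow]; norm_num
  rw [e5]
  refine Real.log_le_log (by positivity) ?_
  have h1 : 2 + (2 * T ^ 2 + 6 * |(j : ℝ)| + 2) ≤ 12 * T ^ 2 := by nlinarith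
  have h2 : 12 * T ^ 2 ≤ T ^ 5 := by
    have : (12 : ℝ) ≤ T ^ 3 := by nlinarith
    nlinarith
  linarith

/-- Growth lemma: `log T ≤ κ √T` for `T ≥ T₀(κ)` (`log T ≤ 4 T^{1/4}`). [folklore] -/
private theorem exists_log_le_mul_sqrt {κ : ℝ} (hκ : 0 < κ) :
    ∃ T₀ : ℝ, 1 ≤ T₀ ∧ ∀ T : ℝ, T₀ ≤ T → Real.log T ≤ κ * Real.sqrt T := by
  refine ⟨max 1 (256 / κ ^ 4), le_max_left _ _, fun T hT ↦ ?_⟩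
  have hT1 : 1 ≤ T := (le_max_left _ _).trans hT
  have hT0 : 0 < T := by linarith
  have hlog : Real.log T ≤ 4 * Real.sqrt (Real.sqrt T) := by
    have h1 : Real.log T = 4 * Real.log (Real.sqrt (Real.sqrt T)) := by
      rw [Real.log_sqrt (Real.sqrt_nonneg _), Real.log_sqrt hT0.le]; ring
    rw [h1]
    have hs : 0 < Real.sqrt (Real.sqrt T) := Real.sqrt_pos.2 (Real.sqrt_pos.2 hT0)
    have := Real.log_le_sub_one_of_pos hs
    linarith
  -- 4 √√T ≤ κ √T  ⟸  √√T ≥ 4/κ  ⟸ √T ≥ 16/κ²  ⟸ T ≥ 256/κ⁴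
  have hT2 : 256 / κ ^ 4 ≤ T := (le_max_right _ _).trans hT
  have hs1 : 16 / κ ^ 2 ≤ Real.sqrt T := by
    rw [show 16 / κ ^ 2 = Real.sqrt ((16 / κ ^ 2) ^ 2) by rw [Real.sqrt_sq (by positivity)]]
    exact Real.sqrt_le_sqrt (by rw [show (16 / κ ^ 2) ^ 2 = 256 / κ ^ 4 by ring]; exact hT2)
  have hs2 : 4 / κ ≤ Real.sqrt (Real.sqrt T) := by
    rw [show 4 / κ = Real.sqrt ((4 / κ) ^ 2) by rw [Real.sqrt_sq (by positivity)]]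
    exact Real.sqrt_le_sqrt (by rw [show (4 / κ) ^ 2 = 16 / κ ^ 2 by ring]; exact hs1)
  have hss : Real.sqrt (Real.sqrt T) * Real.sqrt (Real.sqrt T) = Real.sqrt T :=
    Real.mul_self_sqrt (Real.sqrt_nonneg _)
  calc Real.log T ≤ 4 * Real.sqrt (Real.sqrt T) := hlog
    _ = (κ * (4 / κ)) * Real.sqrt (Real.sqrt T) := by field_simp
    _ ≤ (κ * Real.sqrt (Real.sqrt T)) * Real.sqrt (Real.sqrt T) := by
        refine mul_le_mul_of_nonneg_right ?_ (Real.sqrt_nonneg _)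
        exact mul_le_mul_of_nonneg_left hs2 hκ.le
    _ = κ * Real.sqrt T := by rw [mul_assoc, hss]

/-- **The far part, summed over rows** (the `j`-sum of «≪ ε(j) log²₊ j»): with `e_j ∈ (0,1]`,
`e_j ≤ η''` for `|j| ≥ J`, `Λ_j = log₊(2T² + 6|j| + 2)`, `c log₊ j ≤ log₊ ξ_j`, for `T ≥ 3` and any
finite `A ⊂ ℤ`:
`Σ_{j∈A} ψ_T(j) · 8C e_j Λ_j⁴/log₊² ξ_j ≤ 8C [20000 (2√T + 1) log⁴ T + (2401/c²)((2J+1) log₊² J + 40 η'' T log³ T)]`.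
[cite: RodgersTaoFMP2020, Lemma 24 p. 55 (proof: «… ≤ ½ δ T log³ T if δ(T) goes to zero slowly enough»)] -/
theorem far_weight_sum_le {c C η'' : ℝ} (hc : 0 < c) (hC : 0 ≤ C) (hη : 0 ≤ η'')
    (hcle : ∀ j : ℤ, j ≠ 0 → c * logPlus j ≤ logPlus (classicalLocationZ j))
    (e : ℤ → ℝ) (he0 : ∀ j, 0 < e j) (he1 : ∀ j, e j ≤ 1) {J : ℕ}
    (hJ : ∀ j : ℤ, (J : ℝ) ≤ |(j : ℝ)| → e j ≤ η'') {T : ℝ} (hT : 3 ≤ T) (A : Finset ℤ) :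
    ∑ j ∈ A, truncWeight T j * (8 * C * e j * logPlus (2 * T ^ 2 + 6 * |(j : ℝ)| + 2) ^ 4 /
        logPlus (classicalLocationZ j) ^ 2) ≤
      8 * C * (20000 * (2 * Real.sqrt T + 1) * Real.log T ^ 4 +
        2401 / c ^ 2 * ((2 * J + 1) * logPlus (J : ℝ) ^ 2 + 40 * η'' * (T * Real.log T ^ 3))) := by
  classical
  obtain ⟨hlogT, hN3, -⟩ := log_facts_of_three_le hT
  have hT0 : 0 < T := by linarith
  have hT1 : 1 ≤ T := by linarith
  have hN0 : 0 < T * Real.log T := by linarith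
  have hl2 : (1 : ℝ) / 2 < Real.log 2 := by have := Real.log_two_gt_d9; linarith
  have hψ0 : ∀ i : ℤ, 0 ≤ truncWeight T i := fun i ↦ (truncWeight_pos hN0 i).le
  have hψ1 : ∀ i : ℤ, truncWeight T i ≤ 1 := fun i ↦ truncWeight_le_one hN0 i
  set Λ : ℤ → ℝ := fun j ↦ logPlus (2 * T ^ 2 + 6 * |(j : ℝ)| + 2) with hΛ
  set f : ℤ → ℝ := fun j ↦ truncWeight T j * (8 * C * e j * Λ j ^ 4 /
    logPlus (classicalLocationZ j) ^ 2) with hf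
  have hf0 : ∀ j, 0 ≤ f j := fun j ↦ by
    have := he0 j; have := hψ0 j
    simp only [hf]; positivity
  change ∑ j ∈ A, f j ≤ _
  rw [← Finset.sum_filter_add_sum_filter_not A (fun j : ℤ ↦ (j : ℝ) ^ 2 < T)]
  -- small |j| < √T: at most 2√T + 1 indices, each term ≤ 8C · 2500 log⁴ T · 4
  have hsmall : ∑ j ∈ A.filter (fun j : ℤ ↦ (j : ℝ) ^ 2 < T), f j ≤
      8 * C * (20000 * (2 * Real.sqrt T + 1) * Real.log T ^ 4) := by
    have hb : ∀ j ∈ A.filter (fun j : ℤ ↦ (j : ℝ) ^ 2 < T), f j ≤ 8 * C * (2500 * Real.log T ^ 4) := by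
      intro j hj
      rw [Finset.mem_filter] at hj
      have hjT : |(j : ℝ)| ≤ T := by
        have h1 : |(j : ℝ)| ^ 2 < T := by rw [sq_abs]; exact hj.2
        nlinarith [abs_nonneg (j : ℝ)]
      have hΛle : Λ j ≤ 5 * Real.log T := logPlus_rad_le_of_abs_le hT hjT
      have hΛ0 : 0 ≤ Λ j := logPlus_nonneg _
      have hℓ : Real.log 2 ≤ logPlus (classicalLocationZ j) := log_two_le_logPlus _
      have hℓ2 : 1 / 4 ≤ logPlus (classicalLocationZ j) ^ 2 := by nlinarith
      simp only [hf]
      calc truncWeight T j * (8 * C * e j * Λ j ^ 4 / logPlus (classicalLocationZ j) ^ 2)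
          ≤ 1 * (8 * C * 1 * (5 * Real.log T) ^ 4 / (1 / 4)) := by
            refine mul_le_mul (hψ1 j) ?_ (by have := he0 j; positivity) zero_le_one
            refine div_le_div₀ (by positivity) ?_ (by norm_num) hℓ2
            gcongr
            · exact he1 j
        _ = 8 * C * (2500 * Real.log T ^ 4) := by ring
    have hsub : A.filter (fun j : ℤ ↦ (j : ℝ) ^ 2 < T) ⊆
        Finset.Icc (-⌊Real.sqrt T⌋) ⌊Real.sqrt T⌋ := by
      intro j hj
      rw [Finset.mem_filter] at hj
      have h1 : |(j : ℝ)| ≤ Real.sqrt T := by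
        rw [← Real.sqrt_sq (abs_nonneg (j : ℝ)), sq_abs]
        exact Real.sqrt_le_sqrt hj.2.le
      rw [Finset.mem_Icc]
      have h2 : ((j : ℤ) : ℝ) ≤ Real.sqrt T := (le_abs_self _).trans h1
      have h3 : -Real.sqrt T ≤ ((j : ℤ) : ℝ) := by have := neg_abs_le (j : ℝ); linarith
      constructor
      · have := Int.le_floor.2 h2
        have h4 : ((-j : ℤ) : ℝ) ≤ Real.sqrt T := by push_cast; linarith
        have := Int.le_floor.2 h4
        omega
      · exact Int.le_floor.2 h2
    have hcard : ((A.filter (fun j : ℤ ↦ (j : ℝ) ^ 2 < T)).card : ℝ) ≤ 2 * Real.sqrt T + 1 := by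
      have h1 := Finset.card_le_card hsub
      rw [Int.card_Icc] at h1
      have hfl0 : 0 ≤ ⌊Real.sqrt T⌋ := Int.floor_nonneg.2 (Real.sqrt_nonneg T)
      have h2 : ((⌊Real.sqrt T⌋ + 1 - -⌊Real.sqrt T⌋).toNat : ℤ) = 2 * ⌊Real.sqrt T⌋ + 1 := by
        rw [Int.toNat_of_nonneg (by omega)]; ring
      have h3 : (((⌊Real.sqrt T⌋ + 1 - -⌊Real.sqrt T⌋).toNat : ℕ) : ℝ) = 2 * (⌊Real.sqrt T⌋ : ℝ) + 1 := by
        have : (((⌊Real.sqrt T⌋ + 1 - -⌊Real.sqrt T⌋).toNat : ℕ) : ℝ) =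
            (((⌊Real.sqrt T⌋ + 1 - -⌊Real.sqrt T⌋).toNat : ℤ) : ℝ) := by norm_cast
        rw [this, h2]; push_cast; ring
      calc ((A.filter (fun j : ℤ ↦ (j : ℝ) ^ 2 < T)).card : ℝ)
          ≤ (((⌊Real.sqrt T⌋ + 1 - -⌊Real.sqrt T⌋).toNat : ℕ) : ℝ) := by exact_mod_cast h1
        _ = 2 * (⌊Real.sqrt T⌋ : ℝ) + 1 := h3
        _ ≤ 2 * Real.sqrt T + 1 := by linarith [Int.floor_le (Real.sqrt T)]
    calc ∑ j ∈ A.filter (fun j : ℤ ↦ (j : ℝ) ^ 2 < T), f j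
        ≤ (A.filter (fun j : ℤ ↦ (j : ℝ) ^ 2 < T)).card • (8 * C * (2500 * Real.log T ^ 4)) :=
          Finset.sum_le_card_nsmul _ _ _ hb
      _ = ((A.filter (fun j : ℤ ↦ (j : ℝ) ^ 2 < T)).card : ℝ) * (8 * C * (2500 * Real.log T ^ 4)) := by
          rw [nsmul_eq_mul]
      _ ≤ (2 * Real.sqrt T + 1) * (8 * C * (2500 * Real.log T ^ 4)) :=
          mul_le_mul_of_nonneg_right hcard (by positivity)
      _ ≤ 8 * C * (20000 * (2 * Real.sqrt T + 1) * Real.log T ^ 4) := by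
          have : 0 ≤ (2 * Real.sqrt T + 1) * (8 * C * Real.log T ^ 4) := by positivity
          nlinarith
  -- large |j| ≥ √T
  have hlarge : ∑ j ∈ A.filter (fun j : ℤ ↦ ¬((j : ℝ) ^ 2 < T)), f j ≤
      8 * C * (2401 / c ^ 2 * ((2 * J + 1) * logPlus (J : ℝ) ^ 2 + 40 * η'' * (T * Real.log T ^ 3))) := by
    set A₂ := A.filter (fun j : ℤ ↦ ¬((j : ℝ) ^ 2 < T)) with hA₂
    have hmem : ∀ j ∈ A₂, T ≤ (j : ℝ) ^ 2 ∧ j ≠ 0 := by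
      intro j hj
      rw [hA₂, Finset.mem_filter, not_lt] at hj
      refine ⟨hj.2, ?_⟩
      rintro rfl
      simp at hj; linarith
    have hb : ∀ j ∈ A₂, f j ≤ 8 * C * (2401 / c ^ 2) * (truncWeight T j * e j * logPlus (j : ℝ) ^ 2) := by
      intro j hj
      obtain ⟨hjT, hj0⟩ := hmem j hj
      have hΛle : Λ j ≤ 7 * logPlus (j : ℝ) := logPlus_rad_le_of_sq_ge hT1 hjT
      have hℓ : c * logPlus (j : ℝ) ≤ logPlus (classicalLocationZ j) := hcle j hj0
      have hlam0 : 0 < logPlus (j : ℝ) := logPlus_pos _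
      have hΛ0 : 0 ≤ Λ j := logPlus_nonneg _
      simp only [hf]
      have h1 : Λ j ^ 4 / logPlus (classicalLocationZ j) ^ 2 ≤
          (7 * logPlus (j : ℝ)) ^ 4 / (c * logPlus (j : ℝ)) ^ 2 :=
        div_le_div₀ (by positivity) (pow_le_pow_left₀ hΛ0 hΛle 4) (by positivity)
          (pow_le_pow_left₀ (by positivity) hℓ 2)
      have h2 : (7 * logPlus (j : ℝ)) ^ 4 / (c * logPlus (j : ℝ)) ^ 2 =
          2401 / c ^ 2 * logPlus (j : ℝ) ^ 2 := by
        field_simp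
        ring
      calc truncWeight T j * (8 * C * e j * Λ j ^ 4 / logPlus (classicalLocationZ j) ^ 2)
          = truncWeight T j * (8 * C * e j) * (Λ j ^ 4 / logPlus (classicalLocationZ j) ^ 2) := by
            ring
        _ ≤ truncWeight T j * (8 * C * e j) * (2401 / c ^ 2 * logPlus (j : ℝ) ^ 2) := by
            rw [← h2]
            exact mul_le_mul_of_nonneg_left h1 (by have := he0 j; have := hψ0 j; positivity)
        _ = _ := by ring
    -- Σ_{A₂} ψ e λ² ≤ (2J+1) λ_J² + η'' Σ ψ λ²
    obtain ⟨hsE1, htE1⟩ := tsum_truncWeight_mul_logPlus_sq_le hT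
    have hsplit : ∑ j ∈ A₂, truncWeight T j * e j * logPlus (j : ℝ) ^ 2 ≤
        (2 * J + 1) * logPlus (J : ℝ) ^ 2 + η'' * (40 * (T * Real.log T ^ 3)) := by
      rw [← Finset.sum_filter_add_sum_filter_not A₂ (fun j : ℤ ↦ |(j : ℝ)| < J)]
      refine add_le_add ?_ ?_
      · -- |j| < J
        have hb2 : ∀ j ∈ A₂.filter (fun j : ℤ ↦ |(j : ℝ)| < J),
            truncWeight T j * e j * logPlus (j : ℝ) ^ 2 ≤ logPlus (J : ℝ) ^ 2 := by
          intro j hj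
          rw [Finset.mem_filter] at hj
          have hlam : logPlus (j : ℝ) ≤ logPlus (J : ℝ) :=
            logPlus_mono (by rw [Nat.abs_cast]; exact hj.2.le)
          calc truncWeight T j * e j * logPlus (j : ℝ) ^ 2 ≤ 1 * 1 * logPlus (J : ℝ) ^ 2 := by
                refine mul_le_mul (mul_le_mul (hψ1 j) (he1 j) (he0 j).le zero_le_one)
                  (pow_le_pow_left₀ (logPlus_nonneg _) hlam 2) (sq_nonneg _) (by norm_num)
            _ = logPlus (J : ℝ) ^ 2 := by ring
        have hsub2 : A₂.filter (fun j : ℤ ↦ |(j : ℝ)| < J) ⊆ Finset.Icc (-(J : ℤ)) J := by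
          intro j hj
          rw [Finset.mem_filter] at hj
          have := abs_lt.1 hj.2
          rw [Finset.mem_Icc]
          constructor
          · exact_mod_cast this.1.le
          · exact_mod_cast this.2.le
        have hcard2 : ((A₂.filter (fun j : ℤ ↦ |(j : ℝ)| < J)).card : ℝ) ≤ 2 * J + 1 := by
          have h1 := Finset.card_le_card hsub2
          rw [Int.card_Icc] at h1
          have h2 : ((J : ℤ) + 1 - -(J : ℤ)).toNat = 2 * J + 1 := by
            have : (J : ℤ) + 1 - -(J : ℤ) = ((2 * J + 1 : ℕ) : ℤ) := by push_cast; ring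
            rw [this, Int.toNat_natCast]
          rw [h2] at h1
          exact_mod_cast h1
        calc _ ≤ (A₂.filter (fun j : ℤ ↦ |(j : ℝ)| < J)).card • logPlus (J : ℝ) ^ 2 :=
              Finset.sum_le_card_nsmul _ _ _ hb2
          _ = ((A₂.filter (fun j : ℤ ↦ |(j : ℝ)| < J)).card : ℝ) * logPlus (J : ℝ) ^ 2 := by
              rw [nsmul_eq_mul]
          _ ≤ (2 * J + 1) * logPlus (J : ℝ) ^ 2 :=
              mul_le_mul_of_nonneg_right hcard2 (sq_nonneg _)
      · -- |j| ≥ J: e ≤ η''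
        have hb3 : ∀ j ∈ A₂.filter (fun j : ℤ ↦ ¬(|(j : ℝ)| < J)),
            truncWeight T j * e j * logPlus (j : ℝ) ^ 2 ≤
              η'' * (truncWeight T j * logPlus (j : ℝ) ^ 2) := by
          intro j hj
          rw [Finset.mem_filter, not_lt] at hj
          have := hJ j hj.2
          calc truncWeight T j * e j * logPlus (j : ℝ) ^ 2 =
              e j * (truncWeight T j * logPlus (j : ℝ) ^ 2) := by ring
            _ ≤ η'' * (truncWeight T j * logPlus (j : ℝ) ^ 2) :=
                mul_le_mul_of_nonneg_right this (mul_nonneg (hψ0 j) (sq_nonneg _))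
        calc _ ≤ ∑ j ∈ A₂.filter (fun j : ℤ ↦ ¬(|(j : ℝ)| < J)),
              η'' * (truncWeight T j * logPlus (j : ℝ) ^ 2) := Finset.sum_le_sum hb3
          _ = η'' * ∑ j ∈ A₂.filter (fun j : ℤ ↦ ¬(|(j : ℝ)| < J)),
              truncWeight T j * logPlus (j : ℝ) ^ 2 := by rw [Finset.mul_sum]
          _ ≤ η'' * ∑' j : ℤ, truncWeight T j * logPlus (j : ℝ) ^ 2 := by
              refine mul_le_mul_of_nonneg_left ?_ hη
              exact hsE1.sum_le_tsum _ fun j _ ↦ mul_nonneg (hψ0 j) (sq_nonneg _)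
          _ ≤ η'' * (40 * (T * Real.log T ^ 3)) := mul_le_mul_of_nonneg_left htE1 hη
    calc ∑ j ∈ A₂, f j ≤ ∑ j ∈ A₂, 8 * C * (2401 / c ^ 2) *
          (truncWeight T j * e j * logPlus (j : ℝ) ^ 2) := Finset.sum_le_sum hb
      _ = 8 * C * (2401 / c ^ 2) * ∑ j ∈ A₂, truncWeight T j * e j * logPlus (j : ℝ) ^ 2 := by
          rw [Finset.mul_sum]
      _ ≤ 8 * C * (2401 / c ^ 2) *
          ((2 * J + 1) * logPlus (J : ℝ) ^ 2 + η'' * (40 * (T * Real.log T ^ 3))) :=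
          mul_le_mul_of_nonneg_left hsplit (by positivity)
      _ = _ := by ring
  calc _ ≤ _ := add_le_add hsmall hlarge
    _ = _ := by ring


/-! ### §7 The near pairs `P⁺`: chain hypotheses, the energy of consecutive pairs, the upper bound -/

/-- `max − min = |k − j|` on `ℤ`, cast to `ℝ`. [folklore] -/
private theorem cast_max_sub_min_eq_abs (j k : ℤ) :
    (((max j k - min j k : ℤ) : ℝ)) = |(k : ℝ) - j| := by
  rcases le_total j k with h | h
  · rw [max_eq_right h, min_eq_left h, abs_of_nonneg (by exact_mod_cast sub_nonneg.2 h)]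
    push_cast; ring
  · rw [max_eq_left h, min_eq_right h, abs_of_nonpos (by exact_mod_cast sub_nonpos.2 h)]
    push_cast; ring

/-- **Chain hypotheses on the near pairs.** For `p = (j,k)` with `1 ≤ j, k`, `j ≠ k`, `J ≤ j`,
`|k − j| < η' log₊² ξ_j` (`0 < η' ≤ 1`), where `100 K₂² log₊² ξ_n ≤ n` for `2n ≥ J`, and every
`i ∈ [min p, max p)`: `ψ_T(j)ψ_T(k) ≤ 9 ψ_T(i)²`, `ξ_max − ξ_min ≥ (max − min)/((K₂/c) log₊ ξ_i)` and
`max − min ≤ η' K₂² log₊² ξ_i` — the hypotheses of `pair_chain_sum_le`.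
[cite: RodgersTaoFMP2020, Lemma 24 p. 55 (proof of (86): «ψ_T(j) ≍ ψ_T(k) for j, k in the sum»)] -/
theorem pairSet_chain_bounds {T η' K₂ c : ℝ} (hN : 0 < T * Real.log T) (hη1 : η' ≤ 1)
    (hK₂ : 1 ≤ K₂)
    (hK₂le : ∀ i a : ℤ, i ≠ 0 → |a| ≤ 2 * |i| →
      logPlus (classicalLocationZ a) ≤ K₂ * logPlus (classicalLocationZ i))
    (hc : 0 < c)
    (hcle : ∀ lo hi : ℤ, 1 ≤ lo → lo ≤ hi →
      c * (((hi - lo : ℤ) : ℝ)) / logPlus (classicalLocationZ hi) ≤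
        classicalLocationZ hi - classicalLocationZ lo)
    {J : ℕ} (hJ : ∀ n : ℤ, (J : ℝ) ≤ 2 * n → 100 * K₂ ^ 2 * logPlus (classicalLocationZ n) ^ 2 ≤ n)
    {p : ℤ × ℤ} (hp1 : 1 ≤ p.1) (hp2 : 1 ≤ p.2) (hne : p.1 ≠ p.2) (hpJ : (J : ℤ) ≤ p.1)
    (hnear : |(p.2 : ℝ) - p.1| < η' * logPlus (classicalLocationZ p.1) ^ 2)
    {i : ℤ} (hi : i ∈ Finset.Ico (min p.1 p.2) (max p.1 p.2)) :
    truncWeight T p.1 * truncWeight T p.2 ≤ 9 * truncWeight T i ^ 2 ∧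
    (((max p.1 p.2 - min p.1 p.2 : ℤ) : ℝ)) / (K₂ / c * logPlus (classicalLocationZ i)) ≤
      classicalLocationZ (max p.1 p.2) - classicalLocationZ (min p.1 p.2) ∧
    (((max p.1 p.2 - min p.1 p.2 : ℤ) : ℝ)) ≤ η' * K₂ ^ 2 * logPlus (classicalLocationZ i) ^ 2 := by
  set j := p.1 with hj
  set k := p.2 with hk
  set lo := min j k with hlo
  set hi' := max j k with hhi
  set ℓ : ℤ → ℝ := fun n ↦ logPlus (classicalLocationZ n) with hℓ
  rw [Finset.mem_Ico] at hi
  have hlen : (((hi' - lo : ℤ) : ℝ)) = |(k : ℝ) - j| := cast_max_sub_min_eq_abs j k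
  have hlo1 : 1 ≤ lo := le_min hp1 hp2
  have hjhi : j ≤ hi' := le_max_left _ _
  have hlohi : lo < hi' := by
    rcases lt_or_gt_of_ne hne with h | h
    · simp only [hlo, hhi, min_eq_left h.le, max_eq_right h.le]; exact h
    · simp only [hlo, hhi, min_eq_right h.le, max_eq_left h.le]; exact h
  have hℓ0 : ∀ n, 0 < ℓ n := fun n ↦ logPlus_pos _
  -- 100 K₂² ℓ_j² ≤ j
  have hj1 : (1 : ℝ) ≤ j := by exact_mod_cast hp1
  have hJj' : (J : ℝ) ≤ (j : ℝ) := by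
    have : ((J : ℤ) : ℝ) ≤ (j : ℝ) := by exact_mod_cast hpJ
    push_cast at this; exact this
  have hJj : (J : ℝ) ≤ 2 * (j : ℝ) := by linarith
  have hℓj : 100 * K₂ ^ 2 * ℓ j ^ 2 ≤ j := hJ j hJj
  have hK₂sq : 1 ≤ K₂ ^ 2 := one_le_pow₀ hK₂
  have hℓj' : ℓ j ^ 2 ≤ (j : ℝ) / 100 := by
    have : ℓ j ^ 2 ≤ K₂ ^ 2 * ℓ j ^ 2 := le_mul_of_one_le_left (sq_nonneg _) hK₂sq
    linarith
  have hlen_lt : (((hi' - lo : ℤ) : ℝ)) < η' * ℓ j ^ 2 := by rw [hlen]; exact hnear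
  have hlen_le : (((hi' - lo : ℤ) : ℝ)) ≤ ℓ j ^ 2 := by
    have : η' * ℓ j ^ 2 ≤ 1 * ℓ j ^ 2 := mul_le_mul_of_nonneg_right hη1 (sq_nonneg _)
    linarith
  -- lo ≥ j/2, hi ≤ 2 lo
  have hlo_ge : (j : ℝ) / 2 ≤ lo := by
    have h1 : (lo : ℝ) = hi' - (((hi' - lo : ℤ) : ℝ)) := by push_cast; ring
    have h2 : (j : ℝ) ≤ hi' := by exact_mod_cast hjhi
    rw [h1]; linarith
  have hhi_le : (hi' : ℝ) ≤ 2 * lo := by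
    have h1 : (hi' : ℝ) = lo + (((hi' - lo : ℤ) : ℝ)) := by push_cast; ring
    have hlo1' : (1 : ℝ) ≤ lo := by exact_mod_cast hlo1
    rw [h1]; nlinarith
  have hi0 : i ≠ 0 := by omega
  have hilo : (lo : ℝ) ≤ i := by exact_mod_cast hi.1
  have hi2 : ∀ a : ℤ, a ≤ hi' → 1 ≤ a → |a| ≤ 2 * |i| := by
    intro a ha ha1
    rw [abs_of_pos (by omega : 0 < a), abs_of_pos (by omega : 0 < i)]
    have : (a : ℝ) ≤ 2 * (i : ℝ) := by
      have : (a : ℝ) ≤ hi' := by exact_mod_cast ha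
      linarith
    exact_mod_cast this
  have hℓji : ℓ j ≤ K₂ * ℓ i := hK₂le i j hi0 (hi2 j hjhi hp1)
  have hℓhii : ℓ hi' ≤ K₂ * ℓ i := hK₂le i hi' hi0 (hi2 hi' le_rfl (by omega))
  have hℓjlo : ℓ j ≤ K₂ * ℓ lo := by
    refine hK₂le lo j (by omega) ?_
    rw [abs_of_pos (by omega : 0 < j), abs_of_pos (by omega : 0 < lo)]
    have : (j : ℝ) ≤ 2 * (lo : ℝ) := by linarith
    exact_mod_cast this
  -- (1) ψ-comparability
  have hJlo : (J : ℝ) ≤ 2 * (lo : ℝ) := by linarith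
  have hℓlo : 100 * K₂ ^ 2 * ℓ lo ^ 2 ≤ lo := hJ lo hJlo
  have hψlo : truncWeight T lo ≤ 3 * truncWeight T i := by
    refine truncWeight_le_three_mul hN (by omega) hi.1 ?_
    have h1 : (i : ℝ) - lo < η' * ℓ j ^ 2 := by
      have : (i : ℝ) - lo ≤ (((hi' - lo : ℤ) : ℝ)) := by
        push_cast
        have : (i : ℝ) ≤ hi' := by exact_mod_cast hi.2.le
        linarith
      exact this.trans_lt hlen_lt
    have h2 : η' * ℓ j ^ 2 ≤ K₂ ^ 2 * ℓ lo ^ 2 := by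
      calc η' * ℓ j ^ 2 ≤ 1 * ℓ j ^ 2 := mul_le_mul_of_nonneg_right hη1 (sq_nonneg _)
        _ = ℓ j ^ 2 := one_mul _
        _ ≤ (K₂ * ℓ lo) ^ 2 := pow_le_pow_left₀ (hℓ0 j).le hℓjlo 2
        _ = K₂ ^ 2 * ℓ lo ^ 2 := by ring
    nlinarith
  have hψhi : truncWeight T hi' ≤ truncWeight T lo :=
    truncWeight_le_truncWeight_of_abs_le hN (by
      rw [abs_of_pos (by exact_mod_cast (by omega : 0 < lo)),
        abs_of_pos (by exact_mod_cast (by omega : 0 < hi'))]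
      exact_mod_cast hlohi.le)
  have hψ0 : ∀ n : ℤ, 0 ≤ truncWeight T n := fun n ↦ (truncWeight_pos hN n).le
  have hprod : truncWeight T j * truncWeight T k = truncWeight T lo * truncWeight T hi' := by
    rcases le_total j k with h | h
    · simp only [hlo, hhi, min_eq_left h, max_eq_right h]
    · simp only [hlo, hhi, min_eq_right h, max_eq_left h]; ring
  have hlen0 : (0 : ℝ) ≤ (((hi' - lo : ℤ) : ℝ)) := by
    exact_mod_cast (by omega : (0 : ℤ) ≤ hi' - lo)
  have hη0 : 0 ≤ η' := by
    by_contra hneg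
    rw [not_le] at hneg
    have : η' * ℓ j ^ 2 < 0 := mul_neg_of_neg_of_pos hneg (pow_pos (hℓ0 j) 2)
    linarith
  refine ⟨?_, ?_, ?_⟩
  · rw [hprod]
    calc truncWeight T lo * truncWeight T hi' ≤ (3 * truncWeight T i) * (3 * truncWeight T i) :=
          mul_le_mul hψlo (hψhi.trans hψlo) (hψ0 _) (by linarith [hψ0 i])
      _ = 9 * truncWeight T i ^ 2 := by ring
  · -- (2) the spacing lower bound
    have hD := hcle lo hi' hlo1 hlohi.le
    calc (((hi' - lo : ℤ) : ℝ)) / (K₂ / c * ℓ i) = c * (((hi' - lo : ℤ) : ℝ)) / (K₂ * ℓ i) := by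
          field_simp
      _ ≤ c * (((hi' - lo : ℤ) : ℝ)) / ℓ hi' :=
          div_le_div_of_nonneg_left (by positivity) (hℓ0 _) hℓhii
      _ ≤ _ := hD
  · -- (3) the length
    calc (((hi' - lo : ℤ) : ℝ)) ≤ η' * ℓ j ^ 2 := hlen_lt.le
      _ ≤ η' * (K₂ * ℓ i) ^ 2 :=
          mul_le_mul_of_nonneg_left (pow_le_pow_left₀ (hℓ0 j).le hℓji 2) hη0
      _ = η' * K₂ ^ 2 * ℓ i ^ 2 := by ring


/-- `H̃_{jk} = H̃_{min, max}` (symmetry). [cite: RodgersTaoFMP2020, §7 p. 44 (71)] -/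
theorem renormHamiltonianZ_min_max (t : ℝ) (j k : ℤ) :
    renormHamiltonianZ t j k = renormHamiltonianZ t (min j k) (max j k) := by
  rcases le_total j k with h | h
  · rw [min_eq_left h, max_eq_right h]
  · rw [min_eq_right h, max_eq_left h, renormHamiltonianZ_comm]

/-- The consecutive pairs carry part of the truncated energy:
`Σ_{1 ≤ i ≤ M} ψ_T(i)ψ_T(i+1) Ẽ_{i,i+1}(t) ≤ Ẽ_T(t)` (when `Ẽ_T(t)` is finite and the zeros are
ordered). [cite: RodgersTaoFMP2020, §7 p. 42 (67)] -/
theorem sum_consecutive_energy_le_truncEnergy {T t : ℝ} (hN : 0 < T * Real.log T)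
    (hmono : StrictMono (deBruijnZeroZ t)) (hS : Summable (truncEnergyTerm T t)) (M : ℤ) :
    ∑ i ∈ Finset.Icc 1 M, truncWeight T i * truncWeight T (i + 1) * renormEnergyZ t i (i + 1) ≤
      truncEnergy T t := by
  classical
  set F : ℤ × ℤ → ℝ := fun q ↦ truncWeight T q.1 * truncWeight T q.2 * renormEnergyZ t q.1 q.2
    with hF
  have hF0 : ∀ q ∈ zstarOffDiag, 0 ≤ F q := fun q hq ↦
    mul_nonneg (mul_nonneg (truncWeight_pos hN _).le (truncWeight_pos hN _).le)
      (renormEnergyZ_nonneg_of_strictMono hmono hq.2.2)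
  have hcomp : (F ∘ (↑) : zstarOffDiag → ℝ) = truncEnergyTerm T t := by
    funext p; rfl
  have hsub : Summable (zstarOffDiag.indicator F) := by
    rw [← summable_subtype_iff_indicator, hcomp]; exact hS
  have htsum : truncEnergy T t = ∑' q, zstarOffDiag.indicator F q := by
    rw [truncEnergy_eq, ← tsum_subtype zstarOffDiag F]
    rfl
  have hind0 : ∀ q, 0 ≤ zstarOffDiag.indicator F q := fun q ↦ by
    by_cases hq : q ∈ zstarOffDiag
    · rw [Set.indicator_of_mem hq]; exact hF0 q hq
    · rw [Set.indicator_of_notMem hq]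
  set φ : ℤ → ℤ × ℤ := fun i ↦ (i, i + 1) with hφ
  have hinj : Set.InjOn φ (Finset.Icc (1 : ℤ) M) := fun a _ b _ h ↦ by
    simpa [hφ] using congrArg Prod.fst h
  have hmem : ∀ i ∈ Finset.Icc (1 : ℤ) M, φ i ∈ zstarOffDiag := by
    intro i hi
    rw [Finset.mem_Icc] at hi
    simp only [hφ, mem_zstarOffDiag]
    exact ⟨by omega, by omega, by omega⟩
  calc ∑ i ∈ Finset.Icc 1 M, truncWeight T i * truncWeight T (i + 1) * renormEnergyZ t i (i + 1)
      = ∑ i ∈ Finset.Icc 1 M, zstarOffDiag.indicator F (φ i) := by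
        refine Finset.sum_congr rfl fun i hi ↦ ?_
        rw [Set.indicator_of_mem (hmem i hi)]
    _ = ∑ q ∈ (Finset.Icc 1 M).image φ, zstarOffDiag.indicator F q :=
        (Finset.sum_image hinj).symm
    _ ≤ ∑' q, zstarOffDiag.indicator F q := hsub.sum_le_tsum _ fun q _ ↦ hind0 q
    _ = truncEnergy T t := htsum.symm

/-- **Upper bound for the near pairs** ((86), (87) and the repaired last display, assembled): for
`T ≥ 100`, `m ≥ 1`, `0 < η' ≤ 1`, the index threshold `J` with `100 K₂² log₊² ξ_n ≤ n` (`2n ≥ J`),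
the near-pair sum is at most
`η' · [(18K₂³/c)(80 log 2 · C₄₄ C_L² · m + C_L³ C_core) T log³ T + (18K₂³/c) 12 log 2 · C₄₄³ (m/4^m) Ẽ_T(t)]`
(per pair `renormHamiltonianZ_le_chain_sum`, exchange `pair_chain_sum_le`, then (44), the gap sum
`exists_gap_weighted_sum_le`, `Σ ψ_T log₊² ≪ T log³ T` and the consecutive-pair energy).
[cite: RodgersTaoFMP2020, Lemma 24 pp. 55–56 (proof, (86)–(87) and last display)] -/
theorem nearPairs_indicator_tsum_le {t : ℝ} {T η' K₂ c C44 CL Ccore : ℝ} {J m : ℕ}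
    (hΛ : ∃ t' : ℝ, t' < t ∧ HasOnlyRealZeros (deBruijnH t'))
    (hT : 100 ≤ T) (hm : 1 ≤ m) (hη0 : 0 < η') (hη1 : η' ≤ 1)
    (hK₂ : 1 ≤ K₂)
    (hK₂le : ∀ i a : ℤ, i ≠ 0 → |a| ≤ 2 * |i| →
      logPlus (classicalLocationZ a) ≤ K₂ * logPlus (classicalLocationZ i))
    (hc : 0 < c)
    (hcle : ∀ lo hi : ℤ, 1 ≤ lo → lo ≤ hi →
      c * (((hi - lo : ℤ) : ℝ)) / logPlus (classicalLocationZ hi) ≤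
        classicalLocationZ hi - classicalLocationZ lo)
    (hC44 : 0 < C44)
    (h44 : ∀ i : ℤ, 1 ≤ i →
      classicalLocationZ (i + 1) - classicalLocationZ i ≤ C44 / logPlus (classicalLocationZ i))
    (hCL : 1 ≤ CL) (hCLle : ∀ j : ℤ, logPlus (classicalLocationZ j) ≤ CL * logPlus j)
    (hJ : ∀ n : ℤ, (J : ℝ) ≤ 2 * n → 100 * K₂ ^ 2 * logPlus (classicalLocationZ n) ^ 2 ≤ n)
    (hcore : ∀ M : ℤ, ∑ i ∈ Finset.Icc 1 M, (deBruijnZeroZ t (i + 1) - deBruijnZeroZ t i) *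
        truncWeight T i ^ 2 * logPlus i ^ 3 ≤ Ccore * (T * Real.log T ^ 3))
    (hS : Summable (truncEnergyTerm T t)) :
    ∑' q : ℤ × ℤ, {q : ℤ × ℤ | 1 ≤ q.1 ∧ 1 ≤ q.2 ∧ q.1 ≠ q.2 ∧ (J : ℤ) ≤ q.1 ∧
        |(q.2 : ℝ) - q.1| < η' * logPlus (classicalLocationZ q.1) ^ 2}.indicator
        (fun q ↦ truncWeight T q.1 * truncWeight T q.2 * renormHamiltonianZ t q.1 q.2) q ≤
      η' * (18 * K₂ ^ 3 / c * (80 * Real.log 2 * C44 * CL ^ 2 * m + CL ^ 3 * Ccore) *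
          (T * Real.log T ^ 3) +
        18 * K₂ ^ 3 / c * (12 * Real.log 2 * C44 ^ 3) * (m / 4 ^ m) * truncEnergy T t) := by
  classical
  -- basic facts
  have hT3 : (3 : ℝ) ≤ T := by linarith
  obtain ⟨hlogT, hN3, -⟩ := log_facts_of_three_le hT3
  have hN : 0 < T * Real.log T := by linarith
  have hN100 : 100 ≤ T * Real.log T := by nlinarith
  have hmono := strictMono_deBruijnZeroZ hΛ
  have hmξ := strictMono_classicalLocationZ
  have hψ0 : ∀ n : ℤ, 0 ≤ truncWeight T n := fun n ↦ (truncWeight_pos hN n).le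
  have hψ1 : ∀ n : ℤ, truncWeight T n ≤ 1 := fun n ↦ truncWeight_le_one hN n
  have hl2 : 0 < Real.log 2 := Real.log_pos one_lt_two
  have hm1 : (1 : ℝ) ≤ m := by exact_mod_cast hm
  set ψ : ℤ → ℝ := fun n ↦ truncWeight T n with hψ
  set ℓ : ℤ → ℝ := fun n ↦ logPlus (classicalLocationZ n) with hℓ
  set d : ℤ → ℝ := fun i ↦ classicalLocationZ (i + 1) - classicalLocationZ i with hd
  set g : ℤ → ℝ := fun i ↦ deBruijnZeroZ t (i + 1) - deBruijnZeroZ t i with hg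
  set c4 : ℝ := 4 * Real.log 2 * m / 4 ^ m with hc4
  set Q : ℤ → ℝ := fun i ↦ m * Real.log 2 + g i / d i +
    c4 * (1 + d i ^ 2 * renormEnergyZ t i (i + 1)) with hQ
  set G : ℤ × ℤ → ℝ := fun q ↦ ψ q.1 * ψ q.2 * renormHamiltonianZ t q.1 q.2 with hG
  set P : Set (ℤ × ℤ) := {q : ℤ × ℤ | 1 ≤ q.1 ∧ 1 ≤ q.2 ∧ q.1 ≠ q.2 ∧ (J : ℤ) ≤ q.1 ∧
    |(q.2 : ℝ) - q.1| < η' * ℓ q.1 ^ 2} with hP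
  have hℓ0 : ∀ n, 0 < ℓ n := fun n ↦ logPlus_pos _
  have hd0 : ∀ i, 0 < d i := fun i ↦ sub_pos.2 (hmξ (by omega))
  have hg0 : ∀ i, 0 < g i := fun i ↦ sub_pos.2 (hmono (by omega))
  have hc4_0 : 0 ≤ c4 := by rw [hc4]; positivity
  have hc4_le : c4 ≤ m * Real.log 2 := by
    rw [hc4]
    have h4m : (4 : ℝ) ≤ 4 ^ m := by
      calc (4 : ℝ) = 4 ^ 1 := by norm_num
        _ ≤ 4 ^ m := pow_le_pow_right₀ (by norm_num) hm
    rw [div_le_iff₀ (by positivity)]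
    nlinarith [mul_nonneg (sub_nonneg.2 h4m) (mul_nonneg (Nat.cast_nonneg m) hl2.le)]
  have hE0 : ∀ i : ℤ, 0 ≤ renormEnergyZ t i (i + 1) := fun i ↦
    renormEnergyZ_nonneg_of_strictMono hmono (by omega)
  have hQ0 : ∀ i, 0 ≤ Q i := fun i ↦ by
    have := hd0 i; have := hg0 i; have := hE0 i
    simp only [hQ]; positivity
  have hG0 : ∀ q : ℤ × ℤ, q.1 ≠ q.2 → 0 ≤ G q := fun q hq ↦
    mul_nonneg (mul_nonneg (hψ0 _) (hψ0 _)) (renormHamiltonianZ_nonneg_of_strictMono hmono hq)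
  have hind0 : ∀ q, 0 ≤ P.indicator G q := fun q ↦ by
    by_cases hq : q ∈ P
    · rw [Set.indicator_of_mem hq]; exact hG0 q hq.2.2.1
    · rw [Set.indicator_of_notMem hq]
  change ∑' q, P.indicator G q ≤ _
  refine Real.tsum_le_of_sum_le hind0 fun s ↦ ?_
  -- the box [1, M]² containing s
  set M : ℤ := ∑ q ∈ s, (|q.1| + |q.2|) with hM
  have hMge : ∀ q ∈ s, q.1 ≤ M ∧ q.2 ≤ M := by
    intro q hq
    have h1 : |q.1| + |q.2| ≤ M :=
      Finset.single_le_sum (f := fun q : ℤ × ℤ ↦ |q.1| + |q.2|) (fun q _ ↦ by positivity) hq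
    exact ⟨(le_abs_self _).trans (by linarith [abs_nonneg q.2]),
      (le_abs_self _).trans (by linarith [abs_nonneg q.1])⟩
  set PM : Finset (ℤ × ℤ) := ((Finset.Icc 1 M) ×ˢ (Finset.Icc 1 M)).filter (fun q ↦ q ∈ P)
    with hPM
  have hPMmem : ∀ q ∈ PM, (1 ≤ q.1 ∧ q.1 ≤ M) ∧ (1 ≤ q.2 ∧ q.2 ≤ M) ∧ q ∈ P := by
    intro q hq
    rw [hPM, Finset.mem_filter, Finset.mem_product, Finset.mem_Icc, Finset.mem_Icc] at hq
    exact ⟨hq.1.1, hq.1.2, hq.2⟩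
  -- Step 1: the partial sum is dominated by the sum over PM
  have hstep1 : ∑ q ∈ s, P.indicator G q ≤ ∑ q ∈ PM, G q := by
    rw [show ∑ q ∈ s, P.indicator G q = ∑ q ∈ s, (if q ∈ P then G q else 0) from
      Finset.sum_congr rfl fun q _ ↦ Set.indicator_apply _ _ _, ← Finset.sum_filter]
    refine Finset.sum_le_sum_of_subset_of_nonneg ?_ fun q hq _ ↦ hG0 q (hPMmem q hq).2.2.2.2.1
    intro q hq
    rw [Finset.mem_filter] at hq
    obtain ⟨hqs, hqP⟩ := hq
    rw [hPM, Finset.mem_filter, Finset.mem_product, Finset.mem_Icc, Finset.mem_Icc]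
    exact ⟨⟨⟨hqP.1, (hMge q hqs).1⟩, ⟨hqP.2.1, (hMge q hqs).2⟩⟩, hqP⟩
  -- Step 2: the per-pair bound
  have hstep2 : ∑ q ∈ PM, G q ≤ ∑ q ∈ PM, (ψ q.1 * ψ q.2) *
      ∑ i ∈ Finset.Ico (min q.1 q.2) (max q.1 q.2),
        d i / (classicalLocationZ (max q.1 q.2) - classicalLocationZ (min q.1 q.2)) * Q i := by
    refine Finset.sum_le_sum fun q hq ↦ ?_
    obtain ⟨-, -, hqP⟩ := hPMmem q hq
    have hlt : min q.1 q.2 < max q.1 q.2 := min_lt_max.2 hqP.2.2.1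
    have hPW := renormHamiltonianZ_le_chain_sum hΛ hlt hm
    simp only [hG]
    rw [renormHamiltonianZ_min_max t q.1 q.2]
    exact mul_le_mul_of_nonneg_left hPW (mul_nonneg (hψ0 _) (hψ0 _))
  -- Step 3: the exchange
  have hPhyp : ∀ p ∈ PM, p.1 ≠ p.2 ∧ 1 ≤ min p.1 p.2 ∧ max p.1 p.2 ≤ M := by
    intro p hp
    obtain ⟨h1, h2, hpP⟩ := hPMmem p hp
    exact ⟨hpP.2.2.1, le_min h1.1 h2.1, max_le h1.2 h2.2⟩
  have hchain : ∀ p ∈ PM, ∀ i ∈ Finset.Ico (min p.1 p.2) (max p.1 p.2),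
      ψ p.1 * ψ p.2 ≤ 9 * ψ i ^ 2 ∧
      (((max p.1 p.2 - min p.1 p.2 : ℤ) : ℝ)) / (K₂ / c * ℓ i) ≤
        classicalLocationZ (max p.1 p.2) - classicalLocationZ (min p.1 p.2) ∧
      (((max p.1 p.2 - min p.1 p.2 : ℤ) : ℝ)) ≤ η' * K₂ ^ 2 * ℓ i ^ 2 := by
    intro p hp i hi
    obtain ⟨h1, h2, hpP⟩ := hPMmem p hp
    exact pairSet_chain_bounds hN hη1 hK₂ hK₂le hc hcle hJ h1.1 h2.1 hpP.2.2.1 hpP.2.2.2.1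
      hpP.2.2.2.2 hi
  have hstep3 := pair_chain_sum_le (M := M) PM hPhyp (fun p ↦ ψ p.1 * ψ p.2)
    (fun i ↦ 9 * ψ i ^ 2) (fun i ↦ by positivity)
    (fun p hp i hi ↦ (hchain p hp i hi).1) ℓ hℓ0 (A := K₂ / c) (by positivity)
    (fun p hp i hi ↦ (hchain p hp i hi).2.1) (fun i ↦ η' * K₂ ^ 2 * ℓ i ^ 2)
    (fun i ↦ by positivity) (fun p hp i hi ↦ (hchain p hp i hi).2.2) Q hQ0
  -- Step 4: the index sum
  have hψ3 : ∀ i : ℤ, 1 ≤ i → ψ i ≤ 3 * ψ (i + 1) := by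
    intro i hi
    refine truncWeight_le_three_mul hN (by omega) (by omega) ?_
    push_cast
    have : (0 : ℝ) ≤ (i : ℝ) := by exact_mod_cast (by omega : (0 : ℤ) ≤ i)
    linarith
  have hterm : ∀ i ∈ Finset.Icc (1 : ℤ) M,
      9 * ψ i ^ 2 * ℓ i * (η' * K₂ ^ 2 * ℓ i ^ 2) * d i * Q i ≤
        9 * η' * K₂ ^ 2 * (2 * m * Real.log 2 * C44 * CL ^ 2 * (ψ i * logPlus i ^ 2) +
          CL ^ 3 * (g i * ψ i ^ 2 * logPlus i ^ 3) +
          3 * c4 * C44 ^ 3 * (ψ i * ψ (i + 1) * renormEnergyZ t i (i + 1))) := by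
    intro i hi
    rw [Finset.mem_Icc] at hi
    have hi1 := hi.1
    have hℓd : ℓ i * d i ≤ C44 := by
      have := h44 i hi1
      rw [le_div_iff₀ (hℓ0 i)] at this
      simpa [mul_comm] using this
    have hℓlam : ℓ i ≤ CL * logPlus (i : ℝ) := hCLle i
    have hlam0 : 0 ≤ logPlus (i : ℝ) := logPlus_nonneg _
    have hψi0 := hψ0 i
    have hψi1 := hψ1 i
    have hℓi0 := (hℓ0 i).le
    have hdi0 := (hd0 i).le
    have hgi0 := (hg0 i).le
    have hEi := hE0 i
    -- (a) ψ² ℓ³ d ≤ C44 CL² ψ λ²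
    have ha : ψ i ^ 2 * ℓ i ^ 3 * d i ≤ C44 * CL ^ 2 * (ψ i * logPlus (i : ℝ) ^ 2) := by
      have h1 : ψ i ^ 2 ≤ ψ i := by nlinarith
      have h2 : ℓ i ^ 2 ≤ (CL * logPlus (i : ℝ)) ^ 2 := pow_le_pow_left₀ hℓi0 hℓlam 2
      calc ψ i ^ 2 * ℓ i ^ 3 * d i = ψ i ^ 2 * ℓ i ^ 2 * (ℓ i * d i) := by ring
        _ ≤ ψ i * (CL * logPlus (i : ℝ)) ^ 2 * C44 := by
            refine mul_le_mul (mul_le_mul h1 h2 (sq_nonneg _) hψi0) hℓd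
              (mul_nonneg hℓi0 hdi0) (mul_nonneg hψi0 (sq_nonneg _))
        _ = C44 * CL ^ 2 * (ψ i * logPlus (i : ℝ) ^ 2) := by ring
    -- (b) ψ² ℓ³ g ≤ CL³ g ψ² λ³
    have hb : ψ i ^ 2 * ℓ i ^ 3 * g i ≤ CL ^ 3 * (g i * ψ i ^ 2 * logPlus (i : ℝ) ^ 3) := by
      have h2 : ℓ i ^ 3 ≤ (CL * logPlus (i : ℝ)) ^ 3 := pow_le_pow_left₀ hℓi0 hℓlam 3
      calc ψ i ^ 2 * ℓ i ^ 3 * g i ≤ ψ i ^ 2 * (CL * logPlus (i : ℝ)) ^ 3 * g i :=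
            mul_le_mul_of_nonneg_right (mul_le_mul_of_nonneg_left h2 (sq_nonneg _)) hgi0
        _ = CL ^ 3 * (g i * ψ i ^ 2 * logPlus (i : ℝ) ^ 3) := by ring
    -- (c) ψ² (ℓ d)³ Ẽ ≤ 3 C44³ ψ ψ' Ẽ
    have hc' : ψ i ^ 2 * ℓ i ^ 3 * d i ^ 3 * renormEnergyZ t i (i + 1) ≤
        3 * C44 ^ 3 * (ψ i * ψ (i + 1) * renormEnergyZ t i (i + 1)) := by
      have h1 : (ℓ i * d i) ^ 3 ≤ C44 ^ 3 := pow_le_pow_left₀ (mul_nonneg hℓi0 hdi0) hℓd 3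
      have h2 : ψ i ^ 2 ≤ ψ i * (3 * ψ (i + 1)) := by
        rw [sq]; exact mul_le_mul_of_nonneg_left (hψ3 i hi1) hψi0
      calc ψ i ^ 2 * ℓ i ^ 3 * d i ^ 3 * renormEnergyZ t i (i + 1)
          = ψ i ^ 2 * (ℓ i * d i) ^ 3 * renormEnergyZ t i (i + 1) := by ring
        _ ≤ (ψ i * (3 * ψ (i + 1))) * C44 ^ 3 * renormEnergyZ t i (i + 1) := by
            refine mul_le_mul_of_nonneg_right (mul_le_mul h2 h1 (by positivity)
              (mul_nonneg hψi0 (by linarith [hψ0 (i + 1)]))) hEi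
        _ = 3 * C44 ^ 3 * (ψ i * ψ (i + 1) * renormEnergyZ t i (i + 1)) := by ring
    -- assemble
    have hexp : 9 * ψ i ^ 2 * ℓ i * (η' * K₂ ^ 2 * ℓ i ^ 2) * d i * Q i =
        9 * η' * K₂ ^ 2 * ((m * Real.log 2 + c4) * (ψ i ^ 2 * ℓ i ^ 3 * d i) +
          ψ i ^ 2 * ℓ i ^ 3 * g i +
          c4 * (ψ i ^ 2 * ℓ i ^ 3 * d i ^ 3 * renormEnergyZ t i (i + 1))) := by
      have hdi : d i ≠ 0 := (hd0 i).ne'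
      simp only [hQ]
      field_simp
      ring
    rw [hexp]
    refine mul_le_mul_of_nonneg_left ?_ (by positivity)
    have h3 : (m * Real.log 2 + c4) * (ψ i ^ 2 * ℓ i ^ 3 * d i) ≤
        2 * m * Real.log 2 * C44 * CL ^ 2 * (ψ i * logPlus (i : ℝ) ^ 2) := by
      calc (m * Real.log 2 + c4) * (ψ i ^ 2 * ℓ i ^ 3 * d i)
          ≤ (2 * (m * Real.log 2)) * (C44 * CL ^ 2 * (ψ i * logPlus (i : ℝ) ^ 2)) :=
            mul_le_mul (by linarith) ha (by positivity) (by positivity)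
        _ = _ := by ring
    have h4 : c4 * (ψ i ^ 2 * ℓ i ^ 3 * d i ^ 3 * renormEnergyZ t i (i + 1)) ≤
        3 * c4 * C44 ^ 3 * (ψ i * ψ (i + 1) * renormEnergyZ t i (i + 1)) := by
      calc _ ≤ c4 * (3 * C44 ^ 3 * (ψ i * ψ (i + 1) * renormEnergyZ t i (i + 1))) :=
            mul_le_mul_of_nonneg_left hc' hc4_0
        _ = _ := by ring
    linarith
  -- the three index sums
  obtain ⟨hsE1, htE1⟩ := tsum_truncWeight_mul_logPlus_sq_le hT3
  have hsum1 : ∑ i ∈ Finset.Icc (1 : ℤ) M, ψ i * logPlus (i : ℝ) ^ 2 ≤ 40 * (T * Real.log T ^ 3) :=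
    (hsE1.sum_le_tsum _ fun i _ ↦ mul_nonneg (hψ0 i) (sq_nonneg _)).trans htE1
  have hsum2 := hcore M
  have hsum3 := sum_consecutive_energy_le_truncEnergy hN hmono hS M
  have hstep4 : ∑ i ∈ Finset.Icc (1 : ℤ) M,
      9 * ψ i ^ 2 * ℓ i * (η' * K₂ ^ 2 * ℓ i ^ 2) * d i * Q i ≤
      9 * η' * K₂ ^ 2 * (2 * m * Real.log 2 * C44 * CL ^ 2 * (40 * (T * Real.log T ^ 3)) +
        CL ^ 3 * (Ccore * (T * Real.log T ^ 3)) +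
        3 * c4 * C44 ^ 3 * truncEnergy T t) := by
    refine (Finset.sum_le_sum hterm).trans ?_
    rw [← Finset.mul_sum, Finset.sum_add_distrib, Finset.sum_add_distrib, ← Finset.mul_sum,
      ← Finset.mul_sum, ← Finset.mul_sum]
    refine mul_le_mul_of_nonneg_left ?_ (by positivity)
    exact add_le_add (add_le_add (mul_le_mul_of_nonneg_left hsum1 (by positivity))
      (mul_le_mul_of_nonneg_left hsum2 (by positivity)))
      (mul_le_mul_of_nonneg_left hsum3 (by positivity))
  -- conclusion
  have hE0' : 0 ≤ truncEnergy T t := truncEnergy_nonneg hN hmono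
  have hTL0 : 0 ≤ T * Real.log T ^ 3 := by positivity
  calc ∑ q ∈ s, P.indicator G q ≤ ∑ q ∈ PM, G q := hstep1
    _ ≤ _ := hstep2
    _ ≤ 2 * (K₂ / c) * ∑ i ∈ Finset.Icc 1 M,
        9 * ψ i ^ 2 * ℓ i * (η' * K₂ ^ 2 * ℓ i ^ 2) * d i * Q i := hstep3
    _ ≤ 2 * (K₂ / c) * (9 * η' * K₂ ^ 2 * (2 * m * Real.log 2 * C44 * CL ^ 2 *
        (40 * (T * Real.log T ^ 3)) + CL ^ 3 * (Ccore * (T * Real.log T ^ 3)) +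
        3 * c4 * C44 ^ 3 * truncEnergy T t)) :=
        mul_le_mul_of_nonneg_left hstep4 (by positivity)
    _ = η' * (18 * K₂ ^ 3 / c * (80 * Real.log 2 * C44 * CL ^ 2 * m + CL ^ 3 * Ccore) *
          (T * Real.log T ^ 3) +
        18 * K₂ ^ 3 / c * (12 * Real.log 2 * C44 ^ 3) * (m / 4 ^ m) * truncEnergy T t) := by
        rw [hc4]
        field_simp
        ring


/-! ### §8 The far part and the bounded-index part of the nearby sum; the covering inequality -/

/-- **The far part of the nearby sum** (from Lemma 20, summed): with `e_j = min(ε(j), 1)`,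
`e_j ≤ η''` for `|j| ≥ J`, `c log₊ j ≤ log₊ ξ_j`, `T ≥ 3`,
`Σ_{j ∼_T k, |k−j| ≥ e_j log₊² ξ_j} ψ_T(j)ψ_T(k)H̃_{jk}(t) ≤ 8C[20000(2√T+1)log⁴ T + (2401/c²)((2J+1)log₊² J + 40 η'' T log³ T)]`.
[cite: RodgersTaoFMP2020, Lemma 24 p. 55 (proof: «Σ_{j,k: j∼_T k; |k−j| ≥ ε(j) log²₊ ξ_j} ψ_T(j)ψ_T(k)H̃_jk(t) ≤ ½ δ T log³ T»)] -/
theorem farPairs_indicator_tsum_le {t T C c η'' : ℝ} (hT : 3 ≤ T)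
    (hmono : StrictMono (deBruijnZeroZ t)) (hC : 0 ≤ C) (hc : 0 < c) (hη : 0 ≤ η'')
    (hcle : ∀ j : ℤ, j ≠ 0 → c * logPlus j ≤ logPlus (classicalLocationZ j))
    (ε : ℤ → ℝ) (hε0 : ∀ j, 0 < ε j)
    (hdec : ∀ j k : ℤ, j ≠ 0 → k ≠ 0 → j ≠ k →
      ((ε j)⁻¹ * logPlus (classicalLocationZ j) ^ 2 ≤ |(k : ℝ) - j| →
        renormHamiltonianZ t j k ≤ C * logPlus (|(j : ℝ)| + |(k : ℝ)|) ^ 4 / ((k : ℝ) - j) ^ 2) ∧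
      (ε j * logPlus (classicalLocationZ j) ^ 2 ≤ |(k : ℝ) - j| →
        |(k : ℝ) - j| ≤ (ε j)⁻¹ * logPlus (classicalLocationZ j) ^ 2 →
        renormHamiltonianZ t j k ≤ C * ε j ^ 2 * logPlus (j : ℝ) ^ 4 / ((k : ℝ) - j) ^ 2))
    {J : ℕ} (hJ : ∀ j : ℤ, (J : ℝ) ≤ |(j : ℝ)| → min (ε j) 1 ≤ η'') :
    ∑' q : ℤ × ℤ, {q : ℤ × ℤ | q ∈ nearbyPairs T ∧
        min (ε q.1) 1 * logPlus (classicalLocationZ q.1) ^ 2 ≤ |(q.2 : ℝ) - q.1|}.indicator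
        (fun q ↦ truncWeight T q.1 * truncWeight T q.2 * renormHamiltonianZ t q.1 q.2) q ≤
      8 * C * (20000 * (2 * Real.sqrt T + 1) * Real.log T ^ 4 +
        2401 / c ^ 2 * ((2 * J + 1) * logPlus (J : ℝ) ^ 2 + 40 * η'' * (T * Real.log T ^ 3))) := by
  classical
  obtain ⟨hlogT, hN3, -⟩ := log_facts_of_three_le hT
  have hT1 : (1 : ℝ) ≤ T := by linarith
  have hN : 0 < T * Real.log T := by linarith
  have hψ0 : ∀ n : ℤ, 0 ≤ truncWeight T n := fun n ↦ (truncWeight_pos hN n).le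
  set e : ℤ → ℝ := fun j ↦ min (ε j) 1 with he
  have he0 : ∀ j, 0 < e j := fun j ↦ lt_min (hε0 j) one_pos
  have he1 : ∀ j, e j ≤ 1 := fun j ↦ min_le_right _ _
  set Λ : ℤ → ℝ := fun j ↦ logPlus (2 * T ^ 2 + 6 * |(j : ℝ)| + 2) with hΛ
  set G : ℤ × ℤ → ℝ := fun q ↦ truncWeight T q.1 * truncWeight T q.2 *
    renormHamiltonianZ t q.1 q.2 with hG
  set S : Set (ℤ × ℤ) := {q : ℤ × ℤ | q ∈ nearbyPairs T ∧
    e q.1 * logPlus (classicalLocationZ q.1) ^ 2 ≤ |(q.2 : ℝ) - q.1|} with hS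
  have hG0 : ∀ q : ℤ × ℤ, q.1 ≠ q.2 → 0 ≤ G q := fun q hq ↦
    mul_nonneg (mul_nonneg (hψ0 _) (hψ0 _)) (renormHamiltonianZ_nonneg_of_strictMono hmono hq)
  have hind0 : ∀ q, 0 ≤ S.indicator G q := fun q ↦ by
    by_cases hq : q ∈ S
    · rw [Set.indicator_of_mem hq]; exact hG0 q hq.1.2.2.ne
    · rw [Set.indicator_of_notMem hq]
  change ∑' q, S.indicator G q ≤ _
  refine Real.tsum_le_of_sum_le hind0 fun s ↦ ?_
  set R : ℤ → ℝ := fun j ↦ truncWeight T j * (8 * C * e j * Λ j ^ 4 /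
    logPlus (classicalLocationZ j) ^ 2) with hR
  have hrow : ∀ j : ℤ, ∀ K : Finset ℤ, ∑ k ∈ K, S.indicator G (j, k) ≤ R j := by
    intro j K
    rcases eq_or_ne j 0 with rfl | hj
    · have : ∀ k ∈ K, S.indicator G ((0 : ℤ), k) = 0 := by
        intro k _
        refine Set.indicator_of_notMem ?_ _
        intro hq
        exact hq.1.1 rfl
      rw [Finset.sum_congr rfl this, Finset.sum_const_zero]
      have := he0 0; have := hψ0 0
      simp only [hR]; positivity
    · have hS' : ∀ k : ℤ, (j, k) ∈ S → k ≠ 0 ∧ Nearby T j k ∧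
          min (ε j) 1 * logPlus (classicalLocationZ j) ^ 2 ≤ |(k : ℝ) - j| :=
        fun k hk ↦ ⟨hk.1.2.1, hk.1.2.2, hk.2⟩
      exact far_row_sum_le hN hmono hC (hε0 j) j (logPlus_le_logPlus_rad T j)
        (fun k hk ↦ logPlus_add_le_of_nearby hT1 hk) (fun k hk0 hkj ↦ hdec j k hj hk0 hkj.symm)
        hS' K
  refine (sum_pairs_le_of_rows hind0 hrow s).trans ?_
  exact far_weight_sum_le hc hC hη hcle e he0 he1 hJ hT _

/-- **The bounded-index part of the nearby sum is `O(1)`**: for fixed `J`, the pairs `j ∼_T k` with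
`|j| < J` and `|k − j| < e_j log₊² ξ_j` (`e_j ≤ 1`) lie in a fixed box, on which
`ψ_T(j)ψ_T(k)H̃_{jk}(t) ≤ K(2+|j|)³(2+|k|)³` is bounded uniformly in `T` and `t ∈ [t₁,t₂]`.
[cite: RodgersTaoFMP2020, Lemma 24 p. 54 («the claim is trivial from compactness for T = O(1)»)] -/
theorem exists_smallPairs_indicator_tsum_le {K : ℝ} (hK : 0 ≤ K) (J : ℕ) :
    ∃ CJ : ℝ, 0 ≤ CJ ∧ ∀ T t : ℝ, 0 < T * Real.log T → StrictMono (deBruijnZeroZ t) →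
      (∀ j k : ℤ, j ≠ 0 → k ≠ 0 → j ≠ k →
        renormHamiltonianZ t j k ≤ K * ((2 + |(j : ℝ)|) ^ 3 * (2 + |(k : ℝ)|) ^ 3)) →
      ∀ e : ℤ → ℝ, (∀ j, e j ≤ 1) →
      ∑' q : ℤ × ℤ, {q : ℤ × ℤ | q ∈ nearbyPairs T ∧ |(q.1 : ℝ)| < J ∧
          |(q.2 : ℝ) - q.1| < e q.1 * logPlus (classicalLocationZ q.1) ^ 2}.indicator
          (fun q ↦ truncWeight T q.1 * truncWeight T q.2 * renormHamiltonianZ t q.1 q.2) q ≤ CJ := by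
  classical
  set R : ℕ := J + ⌈logPlus (classicalLocationZ J) ^ 2⌉₊ with hRdef
  set B : ℝ := K * ((2 + (J : ℝ)) ^ 3 * (2 + (R : ℝ)) ^ 3) with hB
  have hB0 : 0 ≤ B := by positivity
  refine ⟨((2 * J + 1) * (2 * R + 1) : ℕ) * B, by positivity, fun T t hN hmono hHle e he1 ↦ ?_⟩
  have hψ0 : ∀ n : ℤ, 0 ≤ truncWeight T n := fun n ↦ (truncWeight_pos hN n).le
  have hψ1 : ∀ n : ℤ, truncWeight T n ≤ 1 := fun n ↦ truncWeight_le_one hN n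
  set G : ℤ × ℤ → ℝ := fun q ↦ truncWeight T q.1 * truncWeight T q.2 *
    renormHamiltonianZ t q.1 q.2 with hG
  set S : Set (ℤ × ℤ) := {q : ℤ × ℤ | q ∈ nearbyPairs T ∧ |(q.1 : ℝ)| < J ∧
    |(q.2 : ℝ) - q.1| < e q.1 * logPlus (classicalLocationZ q.1) ^ 2} with hS
  have hG0 : ∀ q : ℤ × ℤ, q.1 ≠ q.2 → 0 ≤ G q := fun q hq ↦
    mul_nonneg (mul_nonneg (hψ0 _) (hψ0 _)) (renormHamiltonianZ_nonneg_of_strictMono hmono hq)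
  have hind0 : ∀ q, 0 ≤ S.indicator G q := fun q ↦ by
    by_cases hq : q ∈ S
    · rw [Set.indicator_of_mem hq]; exact hG0 q hq.1.2.2.ne
    · rw [Set.indicator_of_notMem hq]
  change ∑' q, S.indicator G q ≤ _
  refine Real.tsum_le_of_sum_le hind0 fun s ↦ ?_
  set Box : Finset (ℤ × ℤ) := (Finset.Icc (-(J : ℤ)) J) ×ˢ (Finset.Icc (-(R : ℤ)) R) with hBox
  -- membership in S forces the box and the bound
  have hmem : ∀ q ∈ S, q ∈ Box ∧ G q ≤ B := by
    intro q hq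
    obtain ⟨hnb, hj, hk⟩ := hq
    obtain ⟨hj0, hk0, hjk⟩ := (mem_nearbyPairs (p := q)).1 hnb
    have hjabs : |q.1| ≤ (J : ℤ) := by
      have : |(q.1 : ℝ)| ≤ J := hj.le
      rw [← Int.cast_abs] at this
      exact_mod_cast this
    have hℓ : logPlus (classicalLocationZ q.1) ≤ logPlus (classicalLocationZ (J : ℤ)) :=
      logPlus_classicalLocationZ_mono (by rw [abs_of_nonneg (by positivity : (0 : ℤ) ≤ J)]; exact hjabs)
    have hℓJ : logPlus (classicalLocationZ (J : ℤ)) = logPlus (classicalLocationZ J) := rfl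
    have hceil : logPlus (classicalLocationZ J) ^ 2 ≤ (⌈logPlus (classicalLocationZ J) ^ 2⌉₊ : ℝ) :=
      Nat.le_ceil _
    have hkabs : |(q.2 : ℝ)| ≤ R := by
      have h1 : |(q.2 : ℝ)| ≤ |(q.1 : ℝ)| + |(q.2 : ℝ) - q.1| := by
        have := abs_sub_abs_le_abs_sub (q.2 : ℝ) q.1; linarith
      have h2 : e q.1 * logPlus (classicalLocationZ q.1) ^ 2 ≤ 1 * logPlus (classicalLocationZ J) ^ 2 :=
        mul_le_mul (he1 _) (pow_le_pow_left₀ (logPlus_nonneg _) hℓ 2) (sq_nonneg _) zero_le_one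
      rw [hRdef]; push_cast
      linarith
    have hkabs' : |q.2| ≤ (R : ℤ) := by
      rw [← Int.cast_abs] at hkabs; exact_mod_cast hkabs
    constructor
    · rw [hBox, Finset.mem_product, Finset.mem_Icc, Finset.mem_Icc]
      constructor
      · constructor <;> linarith [abs_le.1 hjabs]
      · constructor <;> linarith [abs_le.1 hkabs']
    · have hH := hHle q.1 q.2 hj0 hk0 hjk.ne
      have hH0 : 0 ≤ renormHamiltonianZ t q.1 q.2 := renormHamiltonianZ_nonneg_of_strictMono hmono hjk.ne
      calc G q ≤ 1 * 1 * (K * ((2 + |(q.1 : ℝ)|) ^ 3 * (2 + |(q.2 : ℝ)|) ^ 3)) := by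
            simp only [hG]
            exact mul_le_mul (mul_le_mul (hψ1 _) (hψ1 _) (hψ0 _) zero_le_one) hH hH0 (by norm_num)
        _ ≤ 1 * 1 * (K * ((2 + (J : ℝ)) ^ 3 * (2 + (R : ℝ)) ^ 3)) := by
            refine mul_le_mul_of_nonneg_left (mul_le_mul_of_nonneg_left (mul_le_mul
              (pow_le_pow_left₀ (by positivity) (by linarith [hj.le]) 3)
              (pow_le_pow_left₀ (by positivity) (by linarith [hkabs]) 3) (by positivity)
              (by positivity)) hK) (by norm_num)
        _ = B := by rw [hB]; ring
  calc ∑ q ∈ s, S.indicator G q = ∑ q ∈ s.filter (fun q ↦ q ∈ S), G q := by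
        rw [Finset.sum_filter]
        exact Finset.sum_congr rfl fun q _ ↦ Set.indicator_apply _ _ _
    _ ≤ ∑ q ∈ s.filter (fun q ↦ q ∈ S), B :=
        Finset.sum_le_sum fun q hq ↦ (hmem q (Finset.mem_filter.1 hq).2).2
    _ = ((s.filter (fun q ↦ q ∈ S)).card : ℝ) * B := by rw [Finset.sum_const, nsmul_eq_mul]
    _ ≤ (Box.card : ℝ) * B := by
        refine mul_le_mul_of_nonneg_right ?_ hB0
        exact_mod_cast Finset.card_le_card fun q hq ↦ (hmem q (Finset.mem_filter.1 hq).2).1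
    _ = ((2 * J + 1) * (2 * R + 1) : ℕ) * B := by
        rw [hBox, Finset.card_product, Int.card_Icc, Int.card_Icc]
        congr 1
        have h1 : ((J : ℤ) + 1 - -(J : ℤ)).toNat = 2 * J + 1 := by
          have : (J : ℤ) + 1 - -(J : ℤ) = ((2 * J + 1 : ℕ) : ℤ) := by push_cast; ring
          rw [this, Int.toNat_natCast]
        have h2 : ((R : ℤ) + 1 - -(R : ℤ)).toNat = 2 * R + 1 := by
          have : (R : ℤ) + 1 - -(R : ℤ) = ((2 * R + 1 : ℕ) : ℤ) := by push_cast; ring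
          rw [this, Int.toNat_natCast]
        rw [h1, h2]

/-- **Covering inequality for the nearby sum.** If `G ≥ 0` on `Nb` and on `P`, `G(−q) = G(q)`,
`far, small ⊆ Nb`, and every `q ∈ Nb ∖ far` lies in `small`, in `P` or in `−P`, then
`Σ_{Nb} G ≤ Σ_{far} G + Σ_{small} G + 2 Σ_{P} G` (all as summable series on `ℤ²`). [folklore] -/
private theorem tsum_indicator_le_of_cover {G : ℤ × ℤ → ℝ} {Nb far small P : Set (ℤ × ℤ)}
    (hG : ∀ q ∈ Nb, 0 ≤ G q) (hGP : ∀ q ∈ P, 0 ≤ G q) (hsymm : ∀ q, G (-q) = G q)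
    (hfar : far ⊆ Nb) (hsmall : small ⊆ Nb)
    (hcover : ∀ q ∈ Nb, q ∉ far → q ∈ small ∨ q ∈ P ∨ -q ∈ P)
    (hsNb : Summable (Nb.indicator G)) (hsP : Summable (P.indicator G)) :
    ∑' q, Nb.indicator G q ≤
      ∑' q, far.indicator G q + ∑' q, small.indicator G q + 2 * ∑' q, P.indicator G q := by
  classical
  have hNb0 : ∀ q, 0 ≤ Nb.indicator G q := fun q ↦ by
    by_cases hq : q ∈ Nb
    · rw [Set.indicator_of_mem hq]; exact hG q hq
    · rw [Set.indicator_of_notMem hq]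
  have hsub_le : ∀ {S : Set (ℤ × ℤ)}, S ⊆ Nb → ∀ q, 0 ≤ S.indicator G q ∧ S.indicator G q ≤ Nb.indicator G q := by
    intro S hS q
    by_cases hq : q ∈ S
    · rw [Set.indicator_of_mem hq, Set.indicator_of_mem (hS hq)]
      exact ⟨hG q (hS hq), le_rfl⟩
    · rw [Set.indicator_of_notMem hq]
      exact ⟨le_rfl, hNb0 q⟩
  have hsfar : Summable (far.indicator G) :=
    Summable.of_nonneg_of_le (fun q ↦ (hsub_le hfar q).1) (fun q ↦ (hsub_le hfar q).2) hsNb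
  have hssmall : Summable (small.indicator G) :=
    Summable.of_nonneg_of_le (fun q ↦ (hsub_le hsmall q).1) (fun q ↦ (hsub_le hsmall q).2) hsNb
  have hP0 : ∀ q, 0 ≤ P.indicator G q := fun q ↦ by
    by_cases hq : q ∈ P
    · rw [Set.indicator_of_mem hq]; exact hGP q hq
    · rw [Set.indicator_of_notMem hq]
  -- the reflected set
  set Pn : ℤ × ℤ → ℝ := fun q ↦ P.indicator G (-q) with hPn
  have hsPn : Summable Pn := by
    have : Pn = (P.indicator G) ∘ (Equiv.neg (ℤ × ℤ)) := by
      funext q; simp [hPn]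
    rw [this]
    exact (Equiv.neg (ℤ × ℤ)).summable_iff.2 hsP
  have htPn : ∑' q, Pn q = ∑' q, P.indicator G q := by
    simp only [hPn]
    exact (Equiv.neg (ℤ × ℤ)).tsum_eq (P.indicator G)
  have hPn_eq : ∀ q, Pn q = (if -q ∈ P then G q else 0) := by
    intro q
    simp only [hPn]
    rw [Set.indicator_apply, hsymm q]
  -- pointwise cover
  have hpt : ∀ q, Nb.indicator G q ≤
      far.indicator G q + small.indicator G q + P.indicator G q + Pn q := by
    intro q
    have h1 := (hsub_le hfar q).1
    have h2 := (hsub_le hsmall q).1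
    have h3 := hP0 q
    have h4 : 0 ≤ Pn q := by
      rw [hPn_eq]
      split_ifs with h
      · rw [← hsymm q]; exact hGP _ h
      · exact le_rfl
    by_cases hq : q ∈ Nb
    · rw [Set.indicator_of_mem hq]
      by_cases hqf : q ∈ far
      · rw [Set.indicator_of_mem hqf]; linarith
      · rcases hcover q hq hqf with h | h | h
        · rw [Set.indicator_of_mem h]; linarith
        · rw [Set.indicator_of_mem h]; linarith
        · have : Pn q = G q := by rw [hPn_eq, if_pos h]
          linarith
    · rw [Set.indicator_of_notMem hq]; linarith
  have hsR : Summable (fun q ↦ far.indicator G q + small.indicator G q + P.indicator G q + Pn q) :=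
    ((hsfar.add hssmall).add hsP).add hsPn
  calc ∑' q, Nb.indicator G q
      ≤ ∑' q, (far.indicator G q + small.indicator G q + P.indicator G q + Pn q) :=
        hsNb.tsum_le_tsum hpt hsR
    _ = ∑' q, far.indicator G q + ∑' q, small.indicator G q + ∑' q, P.indicator G q + ∑' q, Pn q := by
        rw [((hsfar.add hssmall).add hsP).tsum_add hsPn, (hsfar.add hssmall).tsum_add hsP,
          hsfar.tsum_add hssmall]
    _ = _ := by rw [htPn]; ring


/-! ### §9 Lemma 24 with RH-free content: the schema on a window above a real-rooted time -/

/-- The index threshold: if `100 K₂² C_L² log²(2 + x) ≤ x` for `x ≥ N₀` and `J ≥ 2N₀`, then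
`100 K₂² log₊² ξ_n ≤ n` whenever `2n ≥ J`. [folklore] -/
private theorem threshold_logPlus_sq_le {K₂ CL : ℝ}
    (hCLle : ∀ j : ℤ, logPlus (classicalLocationZ j) ≤ CL * logPlus j) {N₀ J : ℕ}
    (hN₀ : ∀ x : ℝ, (N₀ : ℝ) ≤ x → 100 * K₂ ^ 2 * CL ^ 2 * Real.log (2 + x) ^ 2 ≤ x)
    (hJ2 : 2 * N₀ ≤ J) (n : ℤ) (hn : (J : ℝ) ≤ 2 * n) :
    100 * K₂ ^ 2 * logPlus (classicalLocationZ n) ^ 2 ≤ n := by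
  have hJ0 : (0 : ℝ) ≤ J := Nat.cast_nonneg _
  have hn0 : 0 ≤ n := by
    by_contra h
    rw [not_le] at h
    have : (n : ℝ) ≤ -1 := by exact_mod_cast (show n ≤ -1 by omega)
    linarith
  have hnN : (N₀ : ℝ) ≤ n := by
    have : ((2 * N₀ : ℕ) : ℝ) ≤ J := by exact_mod_cast hJ2
    push_cast at this; linarith
  have h1 := hN₀ (n : ℝ) hnN
  have h2 : logPlus (classicalLocationZ n) ≤ CL * Real.log (2 + (n : ℝ)) := by
    have := hCLle n
    rwa [logPlus_eq (n : ℝ), abs_of_nonneg (by exact_mod_cast hn0)] at this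
  have h3 : logPlus (classicalLocationZ n) ^ 2 ≤ (CL * Real.log (2 + (n : ℝ))) ^ 2 :=
    pow_le_pow_left₀ (logPlus_nonneg _) h2 2
  calc 100 * K₂ ^ 2 * logPlus (classicalLocationZ n) ^ 2
      ≤ 100 * K₂ ^ 2 * (CL * Real.log (2 + (n : ℝ))) ^ 2 := by gcongr
    _ = 100 * K₂ ^ 2 * CL ^ 2 * Real.log (2 + (n : ℝ)) ^ 2 := by ring
    _ ≤ n := h1

/-- Arithmetic of the far part: with `log T ≤ κ √T`, `κ = η/(12·8·20000·3·C)`, the threshold `T_b ≤ T`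
and `η'' = η c²/(12·8·2401·40·C)`, the bound of `farPairs_indicator_tsum_le` is `≤ (η/4) T log³ T`.
[folklore] -/
private theorem far_total_le {T η C c : ℝ} {J : ℕ} (hT1 : 1 ≤ T) (hlogT : 1 ≤ Real.log T) (hη : 0 < η)
    (hC : 0 < C) (hc : 0 < c)
    (hκT : Real.log T ≤ η / (12 * 8 * 20000 * 3 * C) * Real.sqrt T)
    (hTb : 12 * 8 * C * (2401 / c ^ 2) * ((2 * J + 1) * logPlus (J : ℝ) ^ 2) / η ≤ T) :
    8 * C * (20000 * (2 * Real.sqrt T + 1) * Real.log T ^ 4 +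
      2401 / c ^ 2 * ((2 * J + 1) * logPlus (J : ℝ) ^ 2 +
        40 * (η * c ^ 2 / (12 * 8 * 2401 * 40 * C)) * (T * Real.log T ^ 3))) ≤
      η / 4 * (T * Real.log T ^ 3) := by
  have hT0 : 0 < T := by linarith
  set X : ℝ := T * Real.log T ^ 3 with hX
  have hX0 : 0 < X := by positivity
  have hTX : T ≤ X := by
    have : (1 : ℝ) ≤ Real.log T ^ 3 := one_le_pow₀ hlogT
    rw [hX]; exact le_mul_of_one_le_right hT0.le this
  set κ : ℝ := η / (12 * 8 * 20000 * 3 * C) with hκ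
  have hsq : Real.sqrt T * Real.sqrt T = T := Real.mul_self_sqrt hT0.le
  have hsqrt1 : 1 ≤ Real.sqrt T := by
    rw [← Real.sqrt_one]; exact Real.sqrt_le_sqrt hT1
  have hL3 : 0 ≤ Real.log T ^ 3 := by positivity
  have p1 : 8 * C * (20000 * (2 * Real.sqrt T + 1) * Real.log T ^ 4) ≤ η / 12 * X := by
    have h1 : (2 * Real.sqrt T + 1) * Real.log T ≤ 3 * κ * T := by
      calc (2 * Real.sqrt T + 1) * Real.log T ≤ (3 * Real.sqrt T) * (κ * Real.sqrt T) :=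
            mul_le_mul (by linarith) hκT (by positivity) (by positivity)
        _ = 3 * κ * (Real.sqrt T * Real.sqrt T) := by ring
        _ = 3 * κ * T := by rw [hsq]
    have hC0 : C ≠ 0 := hC.ne'
    calc 8 * C * (20000 * (2 * Real.sqrt T + 1) * Real.log T ^ 4)
        = 8 * C * 20000 * ((2 * Real.sqrt T + 1) * Real.log T) * Real.log T ^ 3 := by ring
      _ ≤ 8 * C * 20000 * (3 * κ * T) * Real.log T ^ 3 :=
          mul_le_mul_of_nonneg_right (mul_le_mul_of_nonneg_left h1 (by positivity)) hL3
      _ = η / 12 * X := by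
          rw [hκ, hX]; field_simp
  have p2 : 8 * C * (2401 / c ^ 2 * ((2 * J + 1) * logPlus (J : ℝ) ^ 2)) ≤ η / 12 * X := by
    have hc0 : c ≠ 0 := hc.ne'
    have hη0 : η ≠ 0 := hη.ne'
    have h1 : 8 * C * (2401 / c ^ 2 * ((2 * J + 1) * logPlus (J : ℝ) ^ 2)) =
        η / 12 * (12 * 8 * C * (2401 / c ^ 2) * ((2 * J + 1) * logPlus (J : ℝ) ^ 2) / η) := by
      field_simp
    rw [h1]
    exact mul_le_mul_of_nonneg_left (hTb.trans hTX) (by positivity)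
  have p3 : 8 * C * (2401 / c ^ 2 * (40 * (η * c ^ 2 / (12 * 8 * 2401 * 40 * C)) * X)) =
      η / 12 * X := by
    have hc0 : c ≠ 0 := hc.ne'
    have hC0 : C ≠ 0 := hC.ne'
    field_simp
  calc 8 * C * (20000 * (2 * Real.sqrt T + 1) * Real.log T ^ 4 +
      2401 / c ^ 2 * ((2 * J + 1) * logPlus (J : ℝ) ^ 2 +
        40 * (η * c ^ 2 / (12 * 8 * 2401 * 40 * C)) * X))
      = 8 * C * (20000 * (2 * Real.sqrt T + 1) * Real.log T ^ 4) +
        8 * C * (2401 / c ^ 2 * ((2 * J + 1) * logPlus (J : ℝ) ^ 2)) +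
        8 * C * (2401 / c ^ 2 * (40 * (η * c ^ 2 / (12 * 8 * 2401 * 40 * C)) * X)) := by ring
    _ ≤ η / 12 * X + η / 12 * X + η / 12 * X := add_le_add (add_le_add p1 p2) p3.le
    _ = η / 4 * X := by ring

/-- The near pairs `P⁺` carry a summable family: `ψ_T(j)ψ_T(k)H̃_{jk}(t) ≤ K ψ_T(j)(2+|j|)³ ψ_T(k)(2+|k|)³`
(the polynomial majorant of Lemma 19's proof file). [cite: RodgersTaoFMP2020, §7 p. 44 (proof of
Lemma 19: «the sum here is absolutely convergent»)] -/
theorem summable_nearPairs_indicator {t T K η' : ℝ} {J : ℕ} (hN : 0 < T * Real.log T)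
    (hN1 : 1 ≤ T * Real.log T) (hmono : StrictMono (deBruijnZeroZ t)) (hK : 0 ≤ K)
    (hHle : ∀ j k : ℤ, j ≠ 0 → k ≠ 0 → j ≠ k →
      renormHamiltonianZ t j k ≤ K * ((2 + |(j : ℝ)|) ^ 3 * (2 + |(k : ℝ)|) ^ 3)) :
    Summable ({q : ℤ × ℤ | 1 ≤ q.1 ∧ 1 ≤ q.2 ∧ q.1 ≠ q.2 ∧ (J : ℤ) ≤ q.1 ∧
        |(q.2 : ℝ) - q.1| < η' * logPlus (classicalLocationZ q.1) ^ 2}.indicator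
        (fun q : ℤ × ℤ ↦ truncWeight T q.1 * truncWeight T q.2 * renormHamiltonianZ t q.1 q.2)) := by
  classical
  have hψ0 : ∀ n : ℤ, 0 ≤ truncWeight T n := fun n ↦ (truncWeight_pos hN n).le
  set Mj : ℤ → ℝ := fun j ↦ truncWeight T j * (2 + |(j : ℝ)|) ^ 3 with hMj
  have hsMj : Summable Mj := summable_truncWeight_mul_cube hN1
  have hMj0 : ∀ j, 0 ≤ Mj j := fun j ↦ mul_nonneg (hψ0 j) (by positivity)
  have hMaj : Summable (fun q : ℤ × ℤ ↦ K * (Mj q.1 * Mj q.2)) :=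
    (hsMj.mul_of_nonneg hsMj hMj0 hMj0).mul_left K
  refine Summable.of_nonneg_of_le (fun q ↦ ?_) (fun q ↦ ?_) hMaj
  · by_cases hq : q ∈ {q : ℤ × ℤ | 1 ≤ q.1 ∧ 1 ≤ q.2 ∧ q.1 ≠ q.2 ∧ (J : ℤ) ≤ q.1 ∧
        |(q.2 : ℝ) - q.1| < η' * logPlus (classicalLocationZ q.1) ^ 2}
    · rw [Set.indicator_of_mem hq]
      exact mul_nonneg (mul_nonneg (hψ0 _) (hψ0 _))
        (renormHamiltonianZ_nonneg_of_strictMono hmono hq.2.2.1)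
    · rw [Set.indicator_of_notMem hq]
  · by_cases hq : q ∈ {q : ℤ × ℤ | 1 ≤ q.1 ∧ 1 ≤ q.2 ∧ q.1 ≠ q.2 ∧ (J : ℤ) ≤ q.1 ∧
        |(q.2 : ℝ) - q.1| < η' * logPlus (classicalLocationZ q.1) ^ 2}
    · rw [Set.indicator_of_mem hq]
      obtain ⟨h1, h2, h3, -, -⟩ := hq
      have hHq := hHle q.1 q.2 (by omega) (by omega) h3
      calc truncWeight T q.1 * truncWeight T q.2 * renormHamiltonianZ t q.1 q.2
          ≤ truncWeight T q.1 * truncWeight T q.2 *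
            (K * ((2 + |(q.1 : ℝ)|) ^ 3 * (2 + |(q.2 : ℝ)|) ^ 3)) :=
            mul_le_mul_of_nonneg_left hHq (mul_nonneg (hψ0 _) (hψ0 _))
        _ = K * (truncWeight T q.1 * (2 + |(q.1 : ℝ)|) ^ 3 *
            (truncWeight T q.2 * (2 + |(q.2 : ℝ)|) ^ 3)) := by ring
    · rw [Set.indicator_of_notMem hq]
      exact mul_nonneg hK (mul_nonneg (hMj0 _) (hMj0 _))

/-- **Near pairs beyond the threshold are in `P⁺` or in `−P⁺`**: for `j ∼_T k` with `|j| ≥ J`,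
`|k − j| < min(ε(j),1) log₊² ξ_j`, `ε(j) ≤ η' ≤ 1` beyond `J` and `100 K₂² log₊² ξ_n ≤ n` for `2n ≥ J`,
the pair `(j,k)` (if `j > 0`) or `(−j,−k)` (if `j < 0`) has both entries `≥ 1`.
[cite: RodgersTaoFMP2020, Lemma 24 p. 55 (the range «j ∼_T k, |k−j| < ε(j) log²₊ ξ_j» of (85))] -/
theorem mem_nearPairs_or_neg {T η' K₂ : ℝ} {J : ℕ} (ε : ℤ → ℝ) (hη'1 : η' ≤ 1) (hK₂ : 1 ≤ K₂)
    (hJε : ∀ j : ℤ, (J : ℝ) ≤ |(j : ℝ)| → ε j ≤ η')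
    (hJ : ∀ n : ℤ, (J : ℝ) ≤ 2 * n → 100 * K₂ ^ 2 * logPlus (classicalLocationZ n) ^ 2 ≤ n)
    {q : ℤ × ℤ} (hq : q ∈ nearbyPairs T)
    (hlt : |(q.2 : ℝ) - q.1| < min (ε q.1) 1 * logPlus (classicalLocationZ q.1) ^ 2)
    (hjJ : (J : ℝ) ≤ |(q.1 : ℝ)|) :
    q ∈ {q : ℤ × ℤ | 1 ≤ q.1 ∧ 1 ≤ q.2 ∧ q.1 ≠ q.2 ∧ (J : ℤ) ≤ q.1 ∧
        |(q.2 : ℝ) - q.1| < η' * logPlus (classicalLocationZ q.1) ^ 2} ∨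
    -q ∈ {q : ℤ × ℤ | 1 ≤ q.1 ∧ 1 ≤ q.2 ∧ q.1 ≠ q.2 ∧ (J : ℤ) ≤ q.1 ∧
        |(q.2 : ℝ) - q.1| < η' * logPlus (classicalLocationZ q.1) ^ 2} := by
  obtain ⟨hj0, hk0, hnear⟩ := (mem_nearbyPairs (p := q)).1 hq
  have hℓeven : ∀ j : ℤ, logPlus (classicalLocationZ (-j)) = logPlus (classicalLocationZ j) := by
    intro j; rw [classicalLocationZ_neg, logPlus_neg]
  have hℓabs : ∀ j : ℤ, logPlus (classicalLocationZ |j|) = logPlus (classicalLocationZ j) := by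
    intro j; rw [← abs_classicalLocationZ_eq_abs, logPlus_abs]
  have hεj : ε q.1 ≤ η' := hJε q.1 hjJ
  have hℓ2 : 0 ≤ logPlus (classicalLocationZ q.1) ^ 2 := sq_nonneg _
  have hlt' : |(q.2 : ℝ) - q.1| < η' * logPlus (classicalLocationZ q.1) ^ 2 :=
    hlt.trans_le (mul_le_mul_of_nonneg_right ((min_le_left _ _).trans hεj) hℓ2)
  have hJabs : (J : ℝ) ≤ 2 * ((|q.1| : ℤ) : ℝ) := by
    rw [Int.cast_abs]; linarith [abs_nonneg (q.1 : ℝ)]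
  have hℓj := hJ |q.1| hJabs
  rw [hℓabs, Int.cast_abs] at hℓj
  have hK₂sq : 1 ≤ K₂ ^ 2 := one_le_pow₀ hK₂
  have hℓj' : logPlus (classicalLocationZ q.1) ^ 2 ≤ |(q.1 : ℝ)| / 100 := by
    have : logPlus (classicalLocationZ q.1) ^ 2 ≤ K₂ ^ 2 * logPlus (classicalLocationZ q.1) ^ 2 :=
      le_mul_of_one_le_left hℓ2 hK₂sq
    linarith
  have hdist : |(q.2 : ℝ) - q.1| < |(q.1 : ℝ)| / 100 := by
    have : η' * logPlus (classicalLocationZ q.1) ^ 2 ≤ 1 * logPlus (classicalLocationZ q.1) ^ 2 :=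
      mul_le_mul_of_nonneg_right hη'1 hℓ2
    linarith
  have hJj : (J : ℤ) ≤ |q.1| := by
    have : (J : ℝ) ≤ ((|q.1| : ℤ) : ℝ) := by rw [Int.cast_abs]; exact hjJ
    exact_mod_cast this
  rcases lt_or_gt_of_ne hj0 with hjneg | hjpos
  · right
    have hja : |q.1| = -q.1 := abs_of_neg hjneg
    have hjr : |(q.1 : ℝ)| = -(q.1 : ℝ) := by
      rw [← Int.cast_abs, hja]; push_cast; ring
    have hq1 : (q.1 : ℝ) ≤ -1 := by exact_mod_cast (show q.1 ≤ -1 by omega)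
    have hk : q.2 ≤ -1 := by
      have h1 := (abs_lt.1 hdist).2
      rw [hjr] at h1
      have : (q.2 : ℝ) < 0 := by linarith
      have : q.2 < 0 := by exact_mod_cast this
      omega
    refine ⟨?_, ?_, ?_, ?_, ?_⟩
    · rw [Prod.fst_neg]; omega
    · rw [Prod.snd_neg]; omega
    · rw [Prod.fst_neg, Prod.snd_neg]; exact fun h ↦ hnear.1 (neg_injective h)
    · rw [Prod.fst_neg, ← hja]; exact hJj
    · rw [Prod.fst_neg, Prod.snd_neg, hℓeven]
      push_cast
      rw [show -(q.2 : ℝ) - -(q.1 : ℝ) = -((q.2 : ℝ) - q.1) by ring, abs_neg]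
      exact hlt'
  · left
    have hja : |q.1| = q.1 := abs_of_pos hjpos
    have hjr : |(q.1 : ℝ)| = (q.1 : ℝ) := by rw [← Int.cast_abs, hja]
    have hq1 : (1 : ℝ) ≤ (q.1 : ℝ) := by exact_mod_cast (show 1 ≤ q.1 by omega)
    have hk : 1 ≤ q.2 := by
      have h1 := (abs_lt.1 hdist).1
      rw [hjr] at h1
      have : (0 : ℝ) < (q.2 : ℝ) := by linarith
      have : 0 < q.2 := by exact_mod_cast this
      omega
    refine ⟨by omega, hk, hnear.1, ?_, hlt'⟩
    rw [← hja]; exact hJj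

/-- **Rodgers–Tao 2020, Lemma 24 — RH-FREE CONTENT twin (schema, `η`-form).** On a time window
`[t₁, t₂]` strictly above a real-rooted time `t₀ < t₁`, under the location law (50) and the gap law
(52) on `[t₁, t₂]` (the hypothesis shapes H1/H2 of the cell's Lemma 20 twin
`rodgers_tao_renormHamiltonian_decay_of`), there is a constant `c > 0` such that: for every
`η > 0` there is `T₁` with, for all `T ≥ T₁`, `t ∈ [t₁, t₂]`, `m ≥ 1` and every `δ ≥ η`, if
`H̃_T(t) ≥ δ m T log³ T` and `Ẽ_T(t)` is finite then `Ẽ_T(t) ≥ c δ 2^{2m} T log³ T`.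
(«`δ = δ(T) → 0` sufficiently slowly» enters only through the lower bound `η ≤ δ`: the threshold
depends on `η`, the conclusion is uniform in `δ ≥ η`; the as-printed `δ(T)`-form is
`rodgers_tao_truncEnergy_lower_bound_of_cor33`.) Proof = the printed one: (85) from Lemma 19
(`rodgers_tao_truncHamiltonian_expansion_of`) and Lemma 20 (`rodgers_tao_renormHamiltonian_decay_of`;
far part `farPairs_indicator_tsum_le`, bounded indices `exists_smallPairs_indicator_tsum_le`), then
(86)–(87) and the last display through `nearPairs_indicator_tsum_le` (the per-pair inequality
`renormHamiltonianZ_le_chain_sum` and the exchange `pair_chain_sum_le`); see the module docstring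
for the one repaired step.
[cite: RodgersTaoFMP2020, Lemma 24 p. 54 (= arXiv:1801.05914v4 Lemma 7.9) and its proof pp. 54–56] -/
theorem rodgers_tao_truncEnergy_lower_bound_of {t₀ t₁ t₂ B : ℝ} (h01 : t₀ < t₁)
    (hreal : HasOnlyRealZeros (deBruijnH t₀))
    (h50 : ∀ t ∈ Icc t₁ t₂, ∀ n : ℕ, 1 ≤ n →
      |deBruijnZero t n - classicalLocation (n : ℝ)| ≤ B * logPlus (classicalLocation (n : ℝ)))
    (h52 : ∀ ε : ℝ, 0 < ε → ∃ j₀ : ℕ, ∀ t ∈ Icc t₁ t₂, ∀ j k : ℕ, j₀ ≤ j → j < k →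
      (k : ℝ) ≤ j + logPlus (classicalLocation (j : ℝ)) ^ 2 →
      |deBruijnZero t k - deBruijnZero t j -
          4 * π * ((k : ℝ) - j) / logPlus (classicalLocation (j : ℝ))| ≤
        ε * logPlus (classicalLocation (j : ℝ))) :
    ∃ c : ℝ, 0 < c ∧ ∀ η : ℝ, 0 < η → ∃ T₁ : ℝ, ∀ T : ℝ, T₁ ≤ T → ∀ t ∈ Icc t₁ t₂,
      ∀ m : ℕ, 1 ≤ m → ∀ δ : ℝ, η ≤ δ →
        δ * m * (T * Real.log T ^ 3) ≤ truncHamiltonian T t →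
        Summable (truncEnergyTerm T t) →
          c * (δ * 2 ^ (2 * m) * (T * Real.log T ^ 3)) ≤ truncEnergy T t := by
  classical
  -- constants from (43)–(45), (50), Prop. 13, Lemma 20
  obtain ⟨K₂, hK₂, hK₂le⟩ := exists_logPlus_classicalLocationZ_le_of_abs_le_two_mul
  obtain ⟨c₈, hc₈, hc₈le⟩ := exists_mul_sub_div_le_classicalLocationZ_sub
  obtain ⟨C44, hC44, h44⟩ := exists_classicalLocationZ_succ_sub_le
  obtain ⟨CL, hCL, hCLle⟩ := exists_logPlus_classicalLocationZ_le
  obtain ⟨cL, hcL, -, hcLle⟩ := exists_mul_logPlus_le_logPlus_classicalLocationZ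
  obtain ⟨Ccore, hCcore, hcore⟩ := exists_gap_weighted_sum_le h01 hreal h50
  obtain ⟨Kp, hKp0, hKp⟩ := exists_renormHamiltonianZ_poly_bound h01 hreal h50
  obtain ⟨ε, hε0, hεlim, C₂₀, hdec⟩ := rodgers_tao_renormHamiltonian_decay_of h01 hreal h50 h52
  obtain ⟨N₀, hN₀⟩ := exists_nat_mul_log_sq_le (100 * K₂ ^ 2 * CL ^ 2)
  have hl2 : 0 < Real.log 2 := Real.log_pos one_lt_two
  set C₂₀' : ℝ := max C₂₀ 1 with hC₂₀'
  have hC₂₀'1 : 1 ≤ C₂₀' := le_max_right _ _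
  have hC₂₀'0 : 0 < C₂₀' := by linarith
  have hC₂₀le : C₂₀ ≤ C₂₀' := le_max_left _ _
  set A₁ : ℝ := 18 * K₂ ^ 3 / c₈ * (80 * Real.log 2 * C44 * CL ^ 2 + CL ^ 3 * Ccore) with hA₁
  set A₂ : ℝ := 18 * K₂ ^ 3 / c₈ * (12 * Real.log 2 * C44 ^ 3) with hA₂
  have hA₁0 : 0 < A₁ := by positivity
  have hA₂0 : 0 < A₂ := by positivity
  refine ⟨1 / (8 * A₂), by positivity, fun η hη ↦ ?_⟩
  -- choices depending on η
  set η' : ℝ := min 1 (η / (5 * A₁)) with hη'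
  have hη'0 : 0 < η' := lt_min one_pos (by positivity)
  have hη'1 : η' ≤ 1 := min_le_left _ _
  have hη'A : η' * A₁ ≤ η / 5 := by
    have : η' ≤ η / (5 * A₁) := min_le_right _ _
    rw [le_div_iff₀ (by positivity)] at this
    linarith
  set η'' : ℝ := η * cL ^ 2 / (12 * 8 * 2401 * 40 * C₂₀') with hη''
  have hη''0 : 0 < η'' := by positivity
  obtain ⟨Jε, hJε⟩ := hεlim (min η' η'') (lt_min hη'0 hη''0)
  set J : ℕ := max ⌈Jε⌉₊ (2 * N₀) with hJdef
  have hJε' : ∀ j : ℤ, (J : ℝ) ≤ |(j : ℝ)| → ε j ≤ min η' η'' := by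
    intro j hj
    refine hJε j ((Nat.le_ceil Jε).trans (le_trans ?_ hj))
    exact_mod_cast le_max_left _ _
  have hJ : ∀ n : ℤ, (J : ℝ) ≤ 2 * n → 100 * K₂ ^ 2 * logPlus (classicalLocationZ n) ^ 2 ≤ n :=
    threshold_logPlus_sq_le hCLle hN₀ (le_max_right _ _)
  obtain ⟨CJ, hCJ0, hCJ⟩ := exists_smallPairs_indicator_tsum_le hKp0 J
  obtain ⟨T19, hT19⟩ := rodgers_tao_truncHamiltonian_expansion_of h01 hreal h50 (η / 100)
    (by positivity)
  obtain ⟨Tκ, -, hTκ⟩ :=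
    exists_log_le_mul_sqrt (κ := η / (12 * 8 * 20000 * 3 * C₂₀')) (by positivity)
  set Tb : ℝ := 12 * 8 * C₂₀' * (2401 / cL ^ 2) * ((2 * J + 1) * logPlus (J : ℝ) ^ 2) / η with hTb
  set T₁ : ℝ := max (max (max (max 100 T19) Tκ) (100 * CJ / η)) Tb with hT₁
  refine ⟨T₁, fun T hT t ht m hm δ hδ hH hS ↦ ?_⟩
  -- unpacking the thresholds
  have e1 : max (max (max 100 T19) Tκ) (100 * CJ / η) ≤ T₁ := le_max_left _ _
  have e2 : max (max 100 T19) Tκ ≤ T₁ := (le_max_left _ _).trans e1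
  have e3 : max 100 T19 ≤ T₁ := (le_max_left _ _).trans e2
  have hT100 : (100 : ℝ) ≤ T := ((le_max_left _ _).trans e3).trans hT
  have hT19' : T19 ≤ T := ((le_max_right _ _).trans e3).trans hT
  have hTκ' : Tκ ≤ T := ((le_max_right _ _).trans e2).trans hT
  have hTCJ : 100 * CJ / η ≤ T := ((le_max_right _ _).trans e1).trans hT
  have hTb' : Tb ≤ T := (le_max_right _ _).trans hT
  have hT3 : (3 : ℝ) ≤ T := by linarith
  obtain ⟨hlogT, hN3, -⟩ := log_facts_of_three_le hT3
  have hT0 : 0 < T := by linarith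
  have hT1 : (1 : ℝ) ≤ T := by linarith
  have hN : 0 < T * Real.log T := by linarith
  have hN1 : 1 ≤ T * Real.log T := by linarith
  set X : ℝ := T * Real.log T ^ 3 with hX
  have hX0 : 0 < X := by positivity
  have hTX : T ≤ X := by
    have : (1 : ℝ) ≤ Real.log T ^ 3 := one_le_pow₀ hlogT
    rw [hX]; exact le_mul_of_one_le_right hT0.le this
  have hΛ : ∃ t' : ℝ, t' < t ∧ HasOnlyRealZeros (deBruijnH t') := ⟨t₀, by linarith [ht.1], hreal⟩
  have hmono := strictMono_deBruijnZeroZ hΛ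
  have hψ0 : ∀ n : ℤ, 0 ≤ truncWeight T n := fun n ↦ (truncWeight_pos hN n).le
  have hm1 : (1 : ℝ) ≤ m := by exact_mod_cast hm
  have hm0 : (0 : ℝ) < m := by positivity
  have hδ0 : 0 < δ := hη.trans_le hδ
  -- the objects on ℤ × ℤ
  set G : ℤ × ℤ → ℝ := fun q ↦ truncWeight T q.1 * truncWeight T q.2 *
    renormHamiltonianZ t q.1 q.2 with hG
  set e : ℤ → ℝ := fun j ↦ min (ε j) 1 with he
  have he1 : ∀ j, e j ≤ 1 := fun j ↦ min_le_right _ _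
  set Nb : Set (ℤ × ℤ) := nearbyPairs T with hNb
  set far : Set (ℤ × ℤ) := {q : ℤ × ℤ | q ∈ nearbyPairs T ∧
    min (ε q.1) 1 * logPlus (classicalLocationZ q.1) ^ 2 ≤ |(q.2 : ℝ) - q.1|} with hfar
  set small : Set (ℤ × ℤ) := {q : ℤ × ℤ | q ∈ nearbyPairs T ∧ |(q.1 : ℝ)| < J ∧
    |(q.2 : ℝ) - q.1| < e q.1 * logPlus (classicalLocationZ q.1) ^ 2} with hsmall
  set P : Set (ℤ × ℤ) := {q : ℤ × ℤ | 1 ≤ q.1 ∧ 1 ≤ q.2 ∧ q.1 ≠ q.2 ∧ (J : ℤ) ≤ q.1 ∧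
    |(q.2 : ℝ) - q.1| < η' * logPlus (classicalLocationZ q.1) ^ 2} with hP
  have hG0 : ∀ q : ℤ × ℤ, q.1 ≠ q.2 → 0 ≤ G q := fun q hq ↦
    mul_nonneg (mul_nonneg (hψ0 _) (hψ0 _)) (renormHamiltonianZ_nonneg_of_strictMono hmono hq)
  have hGNb : ∀ q ∈ Nb, 0 ≤ G q := fun q hq ↦ hG0 q hq.2.2.ne
  have hGP : ∀ q ∈ P, 0 ≤ G q := fun q hq ↦ hG0 q hq.2.2.1
  have hGsymm : ∀ q : ℤ × ℤ, G (-q) = G q := fun q ↦ by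
    simp only [hG, Prod.fst_neg, Prod.snd_neg, truncWeight_neg, renormHamiltonianZ_neg_neg]
  -- (1) Lemma 19 at (T, t): the lower bound for the nearby sum
  obtain ⟨-, hSG, hdiff⟩ := hT19 T hT19' t ht
  have hcompG : (G ∘ (↑) : nearbyPairs T → ℝ) = fun p : nearbyPairs T ↦
      truncWeight T p.1.1 * truncWeight T p.1.2 * renormHamiltonianZ t p.1.1 p.1.2 := by
    funext p; rfl
  have hsNb : Summable (Nb.indicator G) := by
    rw [hNb, ← summable_subtype_iff_indicator, hcompG]; exact hSG
  have htNb : ∑' q, Nb.indicator G q = ∑' p : nearbyPairs T,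
      truncWeight T p.1.1 * truncWeight T p.1.2 * renormHamiltonianZ t p.1.1 p.1.2 := by
    rw [hNb]
    exact (tsum_subtype (nearbyPairs T) G).symm
  have hlow : δ * m * X - η / 100 * X ≤ ∑' q, Nb.indicator G q := by
    rw [htNb]
    have := (abs_le.1 hdiff).2
    linarith
  -- (2) the far part
  have hdec' : ∀ j k : ℤ, j ≠ 0 → k ≠ 0 → j ≠ k →
      ((ε j)⁻¹ * logPlus (classicalLocationZ j) ^ 2 ≤ |(k : ℝ) - j| →
        renormHamiltonianZ t j k ≤
          C₂₀' * logPlus (|(j : ℝ)| + |(k : ℝ)|) ^ 4 / ((k : ℝ) - j) ^ 2) ∧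
      (ε j * logPlus (classicalLocationZ j) ^ 2 ≤ |(k : ℝ) - j| →
        |(k : ℝ) - j| ≤ (ε j)⁻¹ * logPlus (classicalLocationZ j) ^ 2 →
        renormHamiltonianZ t j k ≤ C₂₀' * ε j ^ 2 * logPlus (j : ℝ) ^ 4 / ((k : ℝ) - j) ^ 2) := by
    intro j k hj hk hjk
    obtain ⟨h1, h2, -⟩ := hdec t ht j k hj hk hjk
    constructor
    · intro hfar'
      refine (h1 hfar').trans (div_le_div_of_nonneg_right ?_ (sq_nonneg _))
      exact mul_le_mul_of_nonneg_right hC₂₀le (pow_nonneg (logPlus_nonneg _) 4)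
    · intro hm1' hm2'
      refine (h2 hm1' hm2').trans (div_le_div_of_nonneg_right ?_ (sq_nonneg _))
      have h0 : 0 ≤ ε j ^ 2 * logPlus (j : ℝ) ^ 4 := by positivity
      calc C₂₀ * ε j ^ 2 * logPlus (j : ℝ) ^ 4 = C₂₀ * (ε j ^ 2 * logPlus (j : ℝ) ^ 4) := by ring
        _ ≤ C₂₀' * (ε j ^ 2 * logPlus (j : ℝ) ^ 4) := mul_le_mul_of_nonneg_right hC₂₀le h0
        _ = _ := by ring
  have hJfar : ∀ j : ℤ, (J : ℝ) ≤ |(j : ℝ)| → min (ε j) 1 ≤ η'' := fun j hj ↦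
    (min_le_left _ _).trans ((hJε' j hj).trans (min_le_right _ _))
  have hfarB := farPairs_indicator_tsum_le hT3 hmono hC₂₀'0.le hcL hη''0.le hcLle ε hε0 hdec'
    hJfar
  have hfar_le := far_total_le (J := J) hT1 hlogT hη hC₂₀'0 hcL (hTκ T hTκ') hTb'
  have hfarB' : ∑' q, far.indicator G q ≤ η / 4 * X := hfarB.trans hfar_le
  -- (3) the bounded-index part
  have hsmallB : ∑' q, small.indicator G q ≤ CJ :=
    hCJ T t hN hmono (fun j k hj hk hjk ↦ (hKp t ht j k hj hk hjk).2.2.2) e he1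
  have hCJ_le : CJ ≤ η / 100 * X := by
    have h1 : 100 * CJ / η ≤ T := hTCJ
    rw [div_le_iff₀ hη] at h1
    have : η * T ≤ η * X := mul_le_mul_of_nonneg_left hTX hη.le
    linarith
  -- (4) the near pairs: summability and the covering
  have hsP : Summable (P.indicator G) :=
    summable_nearPairs_indicator (J := J) (η' := η') hN hN1 hmono hKp0
      (fun j k hj hk hjk ↦ (hKp t ht j k hj hk hjk).2.2.2)
  have hcover : ∀ q ∈ Nb, q ∉ far → q ∈ small ∨ q ∈ P ∨ -q ∈ P := by
    intro q hq hqfar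
    have hlt : |(q.2 : ℝ) - q.1| < min (ε q.1) 1 * logPlus (classicalLocationZ q.1) ^ 2 := by
      by_contra h
      rw [not_lt] at h
      exact hqfar ⟨hq, h⟩
    by_cases hjJ : |(q.1 : ℝ)| < J
    · exact Or.inl ⟨hq, hjJ, hlt⟩
    · rw [not_lt] at hjJ
      exact Or.inr (mem_nearPairs_or_neg ε hη'1 hK₂
        (fun j hj ↦ (hJε' j hj).trans (min_le_left _ _)) hJ hq hlt hjJ)
  have hcov := tsum_indicator_le_of_cover (Nb := Nb) (far := far) (small := small) (P := P)
    hGNb hGP hGsymm (fun q hq ↦ hq.1) (fun q hq ↦ hq.1) hcover hsNb hsP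
  -- (5) the upper bound for the near pairs
  have hU := nearPairs_indicator_tsum_le (J := J) (m := m) hΛ hT100 hm hη'0 hη'1 hK₂ hK₂le
    hc₈ hc₈le hC44 h44 hCL hCLle hJ (fun M ↦ hcore T hT3 t ht M) hS
  have hA₁m : 18 * K₂ ^ 3 / c₈ * (80 * Real.log 2 * C44 * CL ^ 2 * m + CL ^ 3 * Ccore) ≤
      A₁ * m := by
    rw [hA₁]
    have h1 : CL ^ 3 * Ccore ≤ CL ^ 3 * Ccore * m :=
      le_mul_of_one_le_right (by positivity) hm1
    have h2 : 0 ≤ 18 * K₂ ^ 3 / c₈ := by positivity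
    calc 18 * K₂ ^ 3 / c₈ * (80 * Real.log 2 * C44 * CL ^ 2 * m + CL ^ 3 * Ccore)
        ≤ 18 * K₂ ^ 3 / c₈ * (80 * Real.log 2 * C44 * CL ^ 2 * m + CL ^ 3 * Ccore * m) :=
          mul_le_mul_of_nonneg_left (by linarith) h2
      _ = _ := by ring
  have hE0 : 0 ≤ truncEnergy T t := truncEnergy_nonneg hN hmono
  have h4m : (0 : ℝ) < 4 ^ m := by positivity
  have hU' : ∑' q, P.indicator G q ≤ η / 5 * m * X + A₂ * (m / 4 ^ m) * truncEnergy T t := by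
    refine hU.trans ?_
    have hWm : 0 ≤ A₂ * (m / 4 ^ m) * truncEnergy T t := by positivity
    calc η' * (18 * K₂ ^ 3 / c₈ * (80 * Real.log 2 * C44 * CL ^ 2 * m + CL ^ 3 * Ccore) * X +
          18 * K₂ ^ 3 / c₈ * (12 * Real.log 2 * C44 ^ 3) * (m / 4 ^ m) * truncEnergy T t)
        ≤ η' * (A₁ * m * X + A₂ * (m / 4 ^ m) * truncEnergy T t) := by
          refine mul_le_mul_of_nonneg_left ?_ hη'0.le
          exact add_le_add (mul_le_mul_of_nonneg_right hA₁m hX0.le) le_rfl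
      _ = (η' * A₁) * m * X + η' * (A₂ * (m / 4 ^ m) * truncEnergy T t) := by ring
      _ ≤ (η / 5) * m * X + 1 * (A₂ * (m / 4 ^ m) * truncEnergy T t) := by
          refine add_le_add ?_ (mul_le_mul_of_nonneg_right hη'1 hWm)
          exact mul_le_mul_of_nonneg_right (mul_le_mul_of_nonneg_right hη'A hm0.le) hX0.le
      _ = _ := by ring
  -- (6) conclusion
  have hηX : η * X ≤ δ * m * X :=
    mul_le_mul_of_nonneg_right (hδ.trans (le_mul_of_one_le_right hδ0.le hm1)) hX0.le
  have hηmX : η * m * X ≤ δ * m * X :=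
    mul_le_mul_of_nonneg_right (mul_le_mul_of_nonneg_right hδ hm0.le) hX0.le
  have key : 33 / 100 * (δ * m * X) ≤ 2 * (A₂ * (m / 4 ^ m) * truncEnergy T t) := by
    have hsm : ∑' q, small.indicator G q ≤ η / 100 * X := hsmallB.trans hCJ_le
    linarith [hcov, hlow, hfarB', hsm, hU', hηX, hηmX]
  have h4 : (2 : ℝ) ^ (2 * m) = 4 ^ m := by rw [pow_mul]; norm_num
  rw [h4]
  have hpos : 0 < 2 * (A₂ * (m / 4 ^ m)) := by positivity
  have hfinal : 1 / (8 * A₂) * (δ * 4 ^ m * X) ≤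
      33 / 100 * (δ * m * X) / (2 * (A₂ * (m / 4 ^ m))) := by
    rw [le_div_iff₀ hpos]
    have hA₂ne : A₂ ≠ 0 := hA₂0.ne'
    have h4ne : (4 : ℝ) ^ m ≠ 0 := h4m.ne'
    have : 1 / (8 * A₂) * (δ * 4 ^ m * X) * (2 * (A₂ * (m / 4 ^ m))) = 1 / 4 * (δ * m * X) := by
      field_simp
      ring
    rw [this]
    have : 0 ≤ δ * m * X := mul_nonneg (mul_nonneg hδ0.le hm0.le) hX0.le
    linarith
  refine hfinal.trans ?_
  rw [div_le_iff₀ hpos]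
  linarith [key]


/-! ### §10 «`δ(T) → 0` sufficiently slowly»: the threshold rate, and Lemma 24 as printed -/

/-- **From `η`-thresholds to a threshold rate** («`δ = δ(T)` go to zero as `T → ∞` sufficiently
slowly»): if a property `P η T` holds for `T ≥ T₁(η)` for every `η > 0`, then there is a positive
rate `δ₀(T) → 0` such that for every `δ(T)` eventually `≥ δ₀(T)` and all large `T`, some
`0 < η ≤ δ(T)` has `P η T` (diagonal / `Nat.findGreatest` inversion of the thresholds for
`η_n = 1/(n+1)`). [cite: RodgersTaoFMP2020, Lemma 24 p. 54 («let δ = δ(T) go to zero as T → ∞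
sufficiently slowly»)] -/
theorem exists_rate_of_thresholds {P : ℝ → ℝ → Prop}
    (h : ∀ η : ℝ, 0 < η → ∃ T₁ : ℝ, ∀ T : ℝ, T₁ ≤ T → P η T) :
    ∃ δ₀ : ℝ → ℝ, (∀ T, 0 < δ₀ T) ∧ Tendsto δ₀ atTop (𝓝 0) ∧
      ∀ δ : ℝ → ℝ, (∀ᶠ T in atTop, δ₀ T ≤ δ T) →
        ∃ T₁ : ℝ, ∀ T : ℝ, T₁ ≤ T → ∃ η : ℝ, 0 < η ∧ η ≤ δ T ∧ P η T := by
  classical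
  have hη : ∀ n : ℕ, (0 : ℝ) < 1 / ((n : ℝ) + 1) := fun n ↦ by positivity
  choose Tη hTη using fun n : ℕ ↦ h (1 / ((n : ℝ) + 1)) (hη n)
  -- a monotone envelope of the thresholds, tending to infinity
  set Th : ℕ → ℝ := fun n ↦ (∑ k ∈ Finset.range (n + 1), |Tη k|) + n with hTh
  have hTh_ge : ∀ n k : ℕ, k ≤ n → Tη k ≤ Th n := by
    intro n k hk
    have h1 : |Tη k| ≤ ∑ i ∈ Finset.range (n + 1), |Tη i| :=
      Finset.single_le_sum (f := fun i ↦ |Tη i|) (fun i _ ↦ abs_nonneg _)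
        (Finset.mem_range.2 (by omega))
    have h2 : (0 : ℝ) ≤ n := Nat.cast_nonneg _
    have h3 := le_abs_self (Tη k)
    simp only [hTh]
    linarith
  have hTh_n : ∀ n : ℕ, (n : ℝ) ≤ Th n := fun n ↦ by
    have := Finset.sum_nonneg (s := Finset.range (n + 1)) (fun i _ ↦ abs_nonneg (Tη i))
    simp only [hTh]
    linarith
  -- the inverse: N(T) = the largest n with Th n ≤ T
  set N : ℝ → ℕ := fun T ↦ Nat.findGreatest (fun n ↦ Th n ≤ T) ⌈T⌉₊ with hN
  have hN_ge : ∀ (T : ℝ) (n : ℕ), Th n ≤ T → n ≤ N T := by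
    intro T n hn
    refine Nat.le_findGreatest ?_ hn
    have : (n : ℝ) ≤ T := (hTh_n n).trans hn
    exact_mod_cast this.trans (Nat.le_ceil T)
  have hN_spec : ∀ T : ℝ, Th 0 ≤ T → Th (N T) ≤ T := by
    intro T h0
    exact Nat.findGreatest_spec (P := fun n ↦ Th n ≤ T) (Nat.zero_le _) h0
  set δ₀ : ℝ → ℝ := fun T ↦ 1 / ((N T : ℝ) + 1) with hδ₀
  refine ⟨δ₀, fun T ↦ hη _, ?_, ?_⟩
  · rw [Metric.tendsto_atTop]
    intro e he
    obtain ⟨n, hn⟩ := exists_nat_one_div_lt he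
    refine ⟨Th n, fun T hT ↦ ?_⟩
    have hNn : (n : ℝ) ≤ N T := by exact_mod_cast hN_ge T n hT
    rw [Real.dist_eq, sub_zero, abs_of_pos (hη _)]
    calc δ₀ T = 1 / ((N T : ℝ) + 1) := rfl
      _ ≤ 1 / ((n : ℝ) + 1) := one_div_le_one_div_of_le (by positivity) (by linarith)
      _ < e := hn
  · intro δ hδ
    obtain ⟨Ts, hTs⟩ := Filter.eventually_atTop.1 hδ
    refine ⟨max Ts (Th 0), fun T hT ↦ ?_⟩
    have hT1 : Ts ≤ T := (le_max_left _ _).trans hT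
    have hT2 : Th 0 ≤ T := (le_max_right _ _).trans hT
    exact ⟨1 / ((N T : ℝ) + 1), hη _, hTs T hT1,
      hTη (N T) T ((hTh_ge (N T) (N T) le_rfl).trans (hN_spec T hT2))⟩

/-- **Lemma 24 as printed, from Corollary 10 (50) + (52) as printed** (the reduction; the fact
itself is VACUOUS-AS-PRINTED and already discharged ex falso as
`rodgers_tao_truncEnergy_lower_bound_holds` — no second `_holds` is declared here). On
`Λ/2 ≤ t ≤ 0` for a real-rooted witness `t₀ < 0` in place of `Λ`, the as-printed Corollary 10 facts
`RodgersTao2020.cor33_location` (50) and `RodgersTao2020.cor33_gaps` (52) give the typed Lemma 24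
`rodgers_tao_truncEnergy_lower_bound` via the schema `rodgers_tao_truncEnergy_lower_bound_of` on the
window `[t₀/2, 0]` and the threshold rate `exists_rate_of_thresholds` (the printed «`δ(T) → 0`
sufficiently slowly»). This records that the printed implication
(50) + (52) + Prop. 13 + (44)–(45) ⟹ Lemma 24 is kernel-checked with content.
[cite: RodgersTaoFMP2020, Lemma 24 p. 54 (= arXiv:1801.05914v4 Lemma 7.9) and Corollary 10 p. 23] -/
theorem rodgers_tao_truncEnergy_lower_bound_of_cor33 :
    RodgersTao2020.cor33_location → RodgersTao2020.cor33_gaps →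
      rodgers_tao_truncEnergy_lower_bound := by
  intro hloc hgap t₀ ht₀ hreal
  obtain ⟨A, hA⟩ := hloc
  have h50 : ∀ t ∈ Icc (t₀ / 2) 0, ∀ n : ℕ, 1 ≤ n →
      |deBruijnZero t n - classicalLocation (n : ℝ)| ≤ A * logPlus (classicalLocation (n : ℝ)) :=
    fun t ht n hn ↦ hA t ⟨t₀, by linarith [ht.1], hreal⟩ ht.2 n hn
  have h52 : ∀ ε : ℝ, 0 < ε → ∃ j₀ : ℕ, ∀ t ∈ Icc (t₀ / 2) 0, ∀ j k : ℕ, j₀ ≤ j → j < k →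
      (k : ℝ) ≤ j + logPlus (classicalLocation (j : ℝ)) ^ 2 →
      |deBruijnZero t k - deBruijnZero t j -
          4 * π * ((k : ℝ) - j) / logPlus (classicalLocation (j : ℝ))| ≤
        ε * logPlus (classicalLocation (j : ℝ)) := by
    intro ε hε
    obtain ⟨j₀, hj₀⟩ := hgap ε hε
    exact ⟨j₀, fun t ht j k hj hjk hkj ↦ hj₀ t ⟨t₀, by linarith [ht.1], hreal⟩ ht.2 j k hj hjk hkj⟩
  have h01 : t₀ < t₀ / 2 := by linarith
  obtain ⟨c, hc, hmain⟩ := rodgers_tao_truncEnergy_lower_bound_of h01 hreal h50 h52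
  obtain ⟨δ₀, hδ₀pos, hδ₀lim, hrate⟩ := exists_rate_of_thresholds
    (P := fun η T ↦ ∀ t ∈ Icc (t₀ / 2) 0, ∀ m : ℕ, 1 ≤ m → ∀ δ : ℝ, η ≤ δ →
      δ * m * (T * Real.log T ^ 3) ≤ truncHamiltonian T t →
      Summable (truncEnergyTerm T t) →
        c * (δ * 2 ^ (2 * m) * (T * Real.log T ^ 3)) ≤ truncEnergy T t)
    (fun η hη ↦ hmain η hη)
  refine ⟨δ₀, hδ₀pos, hδ₀lim, c, hc, fun δ _ _ hev ↦ ?_⟩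
  obtain ⟨T₁, hT₁⟩ := hrate δ hev
  refine ⟨T₁, fun T hT t ht1 ht2 m hm hH hS ↦ ?_⟩
  obtain ⟨η, -, hηδ, hP⟩ := hT₁ T hT
  exact hP t ⟨ht1, ht2⟩ m hm (δ T) hηδ hH hS

end Literature.NumberTheory.LFunctions

end
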